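import Summits.RiemannHypothesis.RiemannHypothesis.Theorems.TiltedLandingLaw421R3Lens1PinningIso
import Summits.RiemannHypothesis.RiemannHypothesis.Theorems.Splittings.JensenWindowDeGuaCount
import Literature.Analysis.Complex.RoucheTheorem

-- ======== PinningIsoB-v1 830c0db8b31b106b (import lines stripped) ========

/-!
# TiltedLandingLaw421R3 — lens-1: `TopPinning` on the Jensen-isolated population WITHOUT clean feet (additive follow-up to (3p))

LENS-1 gen-5 ADDITIVE module image `rh33346-cover/lens-1/PinningIsoB-v1.lean` = §1b of `PinningIso-v2.lean` b19b4526 VERBATIM, importing the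
landed (3p) `…R3Lens1PinningIso` (`RhW08.Lens1PinningIso.JensenIsolated`, `ne_zero_of_jensenIsolated`, …) instead of carrying §1/§2 again;
namespace `RhW08.Lens1PinningIso` (extended); 0 `sorry`, no instances/notation.  Checkable BY IMPORT only after (3p) lands; until then the
monolithic `PinningIso-v2.lean` (farm rc 0 · 0 err · 0 warn · 0 sorry) is the certificate that these bytes elaborate after §1.

CONTENT: `exists_uniform_far_gap`, `exists_nl_margin`, `shifted_clear`, ★★★ `pinning_of_jensenIsolated'` (EngineHyps5 + f⁽ʲ⁾ a = 0 + 0 < Im a +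
JensenIsolated ⇒ the LITERAL `TopPinning` disjunction), `TopPinningCrossing` (OPEN residual: non-isolated = crossing lower-or-equal mates) with the
exact split `topPinning_of_crossing : TopPinningCrossing → TopPinning` / `crossing_of_topPinning`.
HONEST LABEL: `TopPinning` / `TopPinningCrossing` / `RegUmbrella11S` / 33346 / 33347 OPEN; nothing here bears on the truth of RH; RH is not proved.
-/

noncomputable section

namespace RhW08.Lens1PinningIso

open Complex Set Metric
open scoped ComplexConjugate
open Literature.Analysis.Complex
open Summit.RiemannHypothesis.RiemannHypothesis.Theorems.Splittings.JensenWindow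
open RhIdea6.G17.W07C7 RhIdea6.G17.W07C7.Rev6 RhIdea6.G18.W07C8.Law421BirthS RhIdea6.G19.W07C11.Seam
open RhIdea6.G20.W07C12.Frac RhIdea6.G20.W07C12.StColP RhW07.C12.FieldSplit RhIdea6.G21.W07C13.TentMax
open RhW07.C14.TwoSided RhW07.C14.Classes RhW07.C14.Lineage RhW07.C14.Booking
open RhW07.C13.Heredity RhIdea6.G22.W07C15pre.Injection RhW07.E3.Cell RhW07.E3.Lit
open RhW08.Round1 RhW08.StSwap RhW08.Round2 RhW08.QuadW RhW08.SealSwapQ RhW08.SealSwap RhW08.SuccB RhW08.SuccSplit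
open RhW08.SuccTheft RhW08.Column RhW08.Hurwitz RhW08.ClusterQ RhW08.ClusterQM RhW08.NewtonDoor RhW08.NewtonDoorGenusOne RhW08.PurseP
open RhW08.Lens1SignCut RhW08.Lens1Coverage RhW08.IsolatedTilt RhW08.Lens1Pinning

/-! ## §1b DIRTY FEET REMOVED — generic δ-shifted windows (uniform far gap + finitely many zeros of `G·G′` and NL events near the feet)

The clean-feet hypothesis of §1 is an artefact of the window's corners.  Shift both feet lines outward by a GENERIC `ε > 0` smaller than
the UNIFORM slack `g` of the strictly-far zeros (`exists_uniform_far_gap`, after `RhW08.SuccB.exists_uniform_gap`) and than the NL MARGIN `m`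
(`exists_nl_margin`: finitely many NL events near the base, so an NL event within `Im a + m` of `Re a` is within `Im a`): the shifted corners miss the
finitely many zeros of `f^{(j)}`, `f^{(j+1)}` in the box (`RhW08.SuccB.finite_zeros_box`, `Set.Ioo_infinite`), the sides are (strictly) clear, and the
§1 argument runs verbatim; the conclusion is the LITERAL `TopPinning` disjunction (closed disc / closed base). -/

/-- UNIFORM SLACK of the STRICTLY FAR non-real zeros of an entire `G ≢ 0` (zeros in `|Im| ≤ Hs`) from the closed disc of `a` — hypothesis-free:
only zeros that ARE strictly far are quantified (finitely many in the box `|Re c − Re a| < Im a + Hs + 2`; slack `≥ 1` outside). -/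
theorem exists_uniform_far_gap {G : ℂ → ℂ} (hG : Differentiable ℂ G) (hne : G ≠ 0) {Hs : ℝ}
    (hstrip : ∀ c : ℂ, G c = 0 → |c.im| ≤ Hs) {a : ℂ} (haim : 0 < a.im) (haHs : a.im ≤ Hs) :
    ∃ g : ℝ, 0 < g ∧ g ≤ 1 ∧
      ∀ c : ℂ, G c = 0 → a.im + |c.im| < |a.re - c.re| → a.im + |c.im| + g ≤ |a.re - c.re| := by
  have hHs : 0 ≤ Hs := le_trans haim.le haHs
  set L : ℝ := a.im + Hs + 2 with hL
  have hz₀ : ((a.re : ℂ)) ∈ Ioo (a.re - L) (a.re + L) ×ℂ Ioo (-(Hs + 1)) (Hs + 1) :=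
    ofReal_mem_box (by rw [sub_self, abs_zero]; linarith) hHs
  have hfin := finite_zeros_box hG hne hz₀
  have hout : ∀ c : ℂ, G c = 0 → c ∉ Ioo (a.re - L) (a.re + L) ×ℂ Ioo (-(Hs + 1)) (Hs + 1) →
      a.im + |c.im| + 1 ≤ |a.re - c.re| := by
    intro c hGc hbox
    have hci : |c.im| ≤ Hs := hstrip c hGc
    have hre : L ≤ |a.re - c.re| := by
      by_contra hlt
      rw [not_le] at hlt
      apply hbox
      rw [mem_reProdIm]
      rw [abs_lt] at hlt
      rw [abs_le] at hci
      exact ⟨⟨by linarith, by linarith⟩, ⟨by linarith, by linarith⟩⟩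
    linarith
  set T : Set ℂ := {c : ℂ | G c = 0 ∧ c ∈ Ioo (a.re - L) (a.re + L) ×ℂ Ioo (-(Hs + 1)) (Hs + 1)} ∩
    {c : ℂ | a.im + |c.im| < |a.re - c.re|} with hT
  have hTfin : T.Finite := hfin.inter_of_left _
  let sl : ℂ → ℝ := fun c => |a.re - c.re| - a.im - |c.im|
  by_cases hTe : T.Nonempty
  · obtain ⟨c₀, hc₀, hmin⟩ := Set.exists_min_image T sl hTfin hTe
    have hsl₀ : 0 < sl c₀ := by
      have h := hc₀.2
      simp only [Set.mem_setOf_eq] at h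
      show 0 < |a.re - c₀.re| - a.im - |c₀.im|
      linarith
    refine ⟨min (sl c₀) 1, lt_min hsl₀ one_pos, min_le_right _ _, ?_⟩
    intro c hGc hfar
    by_cases hbox : c ∈ Ioo (a.re - L) (a.re + L) ×ℂ Ioo (-(Hs + 1)) (Hs + 1)
    · have hcT : c ∈ T := ⟨⟨hGc, hbox⟩, hfar⟩
      have h1 : sl c₀ ≤ sl c := hmin c hcT
      have h2 : min (sl c₀) 1 ≤ sl c₀ := min_le_left _ _
      have h3 : sl c = |a.re - c.re| - a.im - |c.im| := rfl
      linarith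
    · have h1 := hout c hGc hbox
      have h2 : min (sl c₀) 1 ≤ 1 := min_le_right _ _
      linarith
  · refine ⟨1, one_pos, le_rfl, ?_⟩
    intro c hGc hfar
    by_cases hbox : c ∈ Ioo (a.re - L) (a.re + L) ×ℂ Ioo (-(Hs + 1)) (Hs + 1)
    · exact absurd ⟨c, ⟨hGc, hbox⟩, hfar⟩ hTe
    · exact hout c hGc hbox

/-- NL MARGIN: the NL events of level `j` near the base of `a` are finitely many (zeros of `f^{(j+1)} ≢ 0` in a box), so there is
`m ∈ (0, 1]` such that an NL event with `|x − Re a| < Im a + m` already has `|x − Re a| ≤ Im a`. -/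
theorem exists_nl_margin {f : ℂ → ℂ} (hf : RealEntireLt2 f) {j : ℕ} (hne : iteratedDeriv (j + 1) f ≠ 0) {a : ℂ} (ha : 0 < a.im) :
    ∃ m : ℝ, 0 < m ∧ m ≤ 1 ∧ ∀ x : ℝ, NLEventOf f j x → |x - a.re| < a.im + m → |x - a.re| ≤ a.im := by
  have hG'd : Differentiable ℂ (iteratedDeriv (j + 1) f) := differentiable_iteratedDeriv_of_entire hf.diff (j + 1)
  set L : ℝ := a.im + 1 with hL
  have hz₀ : ((a.re : ℂ)) ∈ Ioo (a.re - L) (a.re + L) ×ℂ Ioo (-((0 : ℝ) + 1)) ((0 : ℝ) + 1) :=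
    ofReal_mem_box (by rw [sub_self, abs_zero]; linarith) le_rfl
  have hfin := finite_zeros_box hG'd hne hz₀
  set N : Set ℝ := {x : ℝ | NLEventOf f j x ∧ |x - a.re| < a.im + 1 ∧ a.im < |x - a.re|} with hN
  have hNfin : N.Finite := by
    refine (hfin.preimage Complex.ofReal_injective.injOn).subset ?_
    intro x hx
    refine ⟨?_, ofReal_mem_box (by linarith [hx.2.1] : |x - a.re| < L) le_rfl⟩
    have hre : (iteratedDeriv (j + 1) f (x : ℂ)).re = 0 := hx.1.1
    have him : (iteratedDeriv (j + 1) f (x : ℂ)).im = 0 := im_iteratedDeriv_ofReal hf.diff hf.real (j + 1) x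
    exact Complex.ext (by simpa using hre) (by simpa using him)
  by_cases hNe : N.Nonempty
  · obtain ⟨x₁, hx₁, hmin⟩ := Set.exists_min_image N (fun x => |x - a.re| - a.im) hNfin hNe
    have hm₀ : 0 < |x₁ - a.re| - a.im := by linarith [hx₁.2.2]
    refine ⟨min (|x₁ - a.re| - a.im) 1, lt_min hm₀ one_pos, min_le_right _ _, ?_⟩
    intro x hNL hx
    by_contra hgt
    rw [not_le] at hgt
    have hxN : x ∈ N := ⟨hNL, by linarith [min_le_right (|x₁ - a.re| - a.im) 1], hgt⟩
    have h1 : |x₁ - a.re| - a.im ≤ |x - a.re| - a.im := hmin x hxN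
    linarith [min_le_left (|x₁ - a.re| - a.im) 1]
  · refine ⟨1, one_pos, le_rfl, ?_⟩
    intro x hNL hx
    by_contra hgt
    rw [not_le] at hgt
    exact hNe ⟨x, hNL, hx, hgt⟩

/-- Clearance of the SHIFTED foot lines `Re = Re a ± t`, `Im a ≤ t < Im a + g` (`g` a uniform far gap), from every non-real zero of
`f^{(j)}` of a JENSEN-ISOLATED `a` (strict except for the trivial `≤`). -/
theorem shifted_clear {f : ℂ → ℂ} {j : ℕ} {a : ℂ} (hGreal : ∀ z : ℂ, iteratedDeriv j f (conj z) = conj (iteratedDeriv j f z))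
    (hapos : 0 < a.im) (hJ : JensenIsolated f j a) {g t : ℝ}
    (hgap : ∀ c : ℂ, iteratedDeriv j f c = 0 → a.im + |c.im| < |a.re - c.re| → a.im + |c.im| + g ≤ |a.re - c.re|)
    (hat : a.im ≤ t) (htg : t < a.im + g) {σ : ℝ} (hσ : σ = 1 ∨ σ = -1) :
    ∀ c : ℂ, iteratedDeriv j f c = 0 → c.im ≠ 0 → |c.im| ≤ |(a.re + σ * t) - c.re| := by
  intro c hc hcim
  obtain ⟨c', hc', hc'pos, hc're, hc'im⟩ : ∃ c' : ℂ, iteratedDeriv j f c' = 0 ∧ 0 < c'.im ∧ c'.re = c.re ∧ c'.im = |c.im| := by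
    rcases lt_or_gt_of_ne hcim with hneg | hpos
    · refine ⟨conj c, by rw [hGreal, hc, map_zero], by simpa using hneg, by simp, ?_⟩
      rw [Complex.conj_im, abs_of_neg hneg]
    · exact ⟨c, hc, hpos, rfl, (abs_of_pos hpos).symm⟩
  have htpos : 0 < t := lt_of_lt_of_le hapos hat
  have hσabs : |σ * t| = t := by
    rcases hσ with h | h <;> simp [h, abs_of_pos htpos]
  by_cases hca : c' = a
  · have hre : c.re = a.re := by rw [← hc're, hca]
    have him : |c.im| = a.im := by rw [← hc'im, hca]
    rw [him, hre, show a.re + σ * t - a.re = σ * t by ring, hσabs]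
    exact hat
  · rcases hJ c' hc' hc'pos hca with hfar | hnest
    · -- strictly far ⇒ uniform gap `g`
      rw [hc're, hc'im] at hfar
      have hg' := hgap c hc hfar
      have htri : |a.re - c.re| ≤ |a.re + σ * t - c.re| + |σ * t| := by
        have h := abs_sub (a.re + σ * t - c.re) (σ * t)
        rwa [show a.re + σ * t - c.re - σ * t = a.re - c.re by ring] at h
      rw [hσabs] at htri
      linarith
    · -- strictly nested
      rw [hc're, hc'im] at hnest
      have htri : t ≤ |a.re + σ * t - c.re| + |a.re - c.re| := by
        have h := abs_add_le (a.re + σ * t - c.re) (-(a.re - c.re))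
        have e : a.re + σ * t - c.re + -(a.re - c.re) = σ * t := by ring
        rw [e, hσabs, abs_neg] at h
        exact h
      linarith

/-- ★★★ WALSH–JENSEN PINNING, DIRTY FEET ALLOWED (the literal `TopPinning` conclusion on the Jensen-isolated population, NO smallness,
NO cleanliness): a JENSEN-ISOLATED upper zero `a` of `f^{(j)}` on a legal frame has a non-real zero of `f^{(j+1)}` in its CLOSED Jensen disc
or an NL event of level `j` in the CLOSED base `|x − Re a| ≤ Im a`. -/
theorem pinning_of_jensenIsolated' {η : ℝ} {f : ℂ → ℂ} {x₀ s hmax R Hs : ℝ} {B : ℕ} (hE : EngineHyps5 2 η f x₀ s hmax R Hs B)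
    {j : ℕ} {a : ℂ} (ha : iteratedDeriv j f a = 0) (hapos : 0 < a.im) (hJ : JensenIsolated f j a) :
    (∃ w : ℂ, iteratedDeriv (j + 1) f w = 0 ∧ w.im ≠ 0 ∧ NestedStep a w) ∨ (∃ x : ℝ, |x - a.re| ≤ a.im ∧ NLEventOf f j x) := by
  classical
  have hf : RealEntireLt2 f := realEntireLt2_of_hyps hE
  have hnz : iteratedDeriv j f ≠ 0 := ne_zero_of_jensenIsolated hapos hJ
  set G : ℂ → ℂ := iteratedDeriv j f with hGdef
  have hG : RealEntireLt2 G :=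
    { diff := differentiable_iteratedDeriv_of_entire hf.diff j
      growth := by
        obtain ⟨ρ, C, hρ0, hρ, hgr⟩ := hf.growth
        obtain ⟨ρ', C', h1, h2, h3⟩ := exists_growth_iteratedDeriv hf.diff hρ0 hρ hgr j
        exact ⟨ρ', C', h1, h2, h3⟩
      real := im_iteratedDeriv_ofReal hf.diff hf.real j }
  have hGreal : ∀ z : ℂ, G (conj z) = conj (G z) := apply_conj_eq_conj hG.diff hG.real
  have e1 : deriv G = iteratedDeriv (j + 1) f := by rw [hGdef, ← iteratedDeriv_succ]
  have hHs : 0 ≤ Hs := hE.2.2.2.2.2.2.2.1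
  have hstrip : ∀ c : ℂ, G c = 0 → |c.im| ≤ Hs := fun c hc => abs_im_le_of_level hE hnz hc
  have haHs : a.im ≤ Hs := by have := hstrip a ha; rwa [abs_of_pos hapos] at this
  have hGd : Differentiable ℂ G := hG.diff
  have hG'ne : iteratedDeriv (j + 1) f ≠ 0 := iteratedDeriv_succ_ne_zero_of_zero hf.diff j hnz ha
  have hG'd : Differentiable ℂ (iteratedDeriv (j + 1) f) := differentiable_iteratedDeriv_of_entire hf.diff (j + 1)
  -- the uniform far gap `g` and the NL margin `m`
  obtain ⟨g, hg0, hg1, hgap⟩ := exists_uniform_far_gap hGd hnz hstrip hapos haHs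
  obtain ⟨m, hm0, hm1, hmarg⟩ := exists_nl_margin hf hG'ne hapos (a := a)
  set ε₀ : ℝ := min g m with hε₀
  have hε₀0 : 0 < ε₀ := lt_min hg0 hm0
  -- finitely many zeros of `G`, `G'` in the box ⇒ a GENERIC shift `ε ∈ (0, ε₀)` keeps the four corners clean
  set L : ℝ := a.im + Hs + 2 with hL
  have hz₀ : ((a.re : ℂ)) ∈ Ioo (a.re - L) (a.re + L) ×ℂ Ioo (-(Hs + 1)) (Hs + 1) :=
    ofReal_mem_box (by rw [sub_self, abs_zero]; linarith) hHs
  set Z : Set ℂ := {ρ : ℂ | G ρ = 0 ∧ ρ ∈ Ioo (a.re - L) (a.re + L) ×ℂ Ioo (-(Hs + 1)) (Hs + 1)} ∪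
    {ρ : ℂ | iteratedDeriv (j + 1) f ρ = 0 ∧ ρ ∈ Ioo (a.re - L) (a.re + L) ×ℂ Ioo (-(Hs + 1)) (Hs + 1)} with hZ
  have hZfin : Z.Finite := (finite_zeros_box hGd hnz hz₀).union (finite_zeros_box hG'd hG'ne hz₀)
  let cp : ℝ → ℂ := fun ε => ((a.re + (a.im + ε) : ℝ) : ℂ)
  let cm : ℝ → ℂ := fun ε => ((a.re - (a.im + ε) : ℝ) : ℂ)
  have hcp : Set.InjOn cp (cp ⁻¹' Z) := fun x _ y _ h => by
    have h' : a.re + (a.im + x) = a.re + (a.im + y) := Complex.ofReal_inj.mp h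
    linarith
  have hcm : Set.InjOn cm (cm ⁻¹' Z) := fun x _ y _ h => by
    have h' : a.re - (a.im + x) = a.re - (a.im + y) := Complex.ofReal_inj.mp h
    linarith
  have hbad : (cp ⁻¹' Z ∪ cm ⁻¹' Z).Finite := (hZfin.preimage hcp).union (hZfin.preimage hcm)
  obtain ⟨ε, hεI, hεbad⟩ := ((Set.Ioo_infinite hε₀0).sdiff hbad).nonempty
  obtain ⟨hε0, hε1⟩ := hεI
  have hεg : ε < g := lt_of_lt_of_le hε1 (min_le_left _ _)
  have hεm : ε < m := lt_of_lt_of_le hε1 (min_le_right _ _)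
  have hat : a.im ≤ a.im + ε := by linarith
  have htg : a.im + ε < a.im + g := by linarith
  have hβmem : cp ε ∈ Ioo (a.re - L) (a.re + L) ×ℂ Ioo (-(Hs + 1)) (Hs + 1) :=
    ofReal_mem_box (by rw [show a.re + (a.im + ε) - a.re = a.im + ε by ring, abs_of_pos (by linarith)]; linarith) hHs
  have hαmem : cm ε ∈ Ioo (a.re - L) (a.re + L) ×ℂ Ioo (-(Hs + 1)) (Hs + 1) :=
    ofReal_mem_box (by rw [show a.re - (a.im + ε) - a.re = -(a.im + ε) by ring, abs_neg, abs_of_pos (by linarith)]; linarith) hHs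
  have hGβ : G (cp ε) ≠ 0 := fun h0 => hεbad (Or.inl (Or.inl ⟨h0, hβmem⟩))
  have hG'β : iteratedDeriv (j + 1) f (cp ε) ≠ 0 := fun h0 => hεbad (Or.inl (Or.inr ⟨h0, hβmem⟩))
  have hGα : G (cm ε) ≠ 0 := fun h0 => hεbad (Or.inr (Or.inl ⟨h0, hαmem⟩))
  have hG'α : iteratedDeriv (j + 1) f (cm ε) ≠ 0 := fun h0 => hεbad (Or.inr (Or.inr ⟨h0, hαmem⟩))
  -- the shifted square window is a Jensen window
  have hclL : ∀ c : ℂ, G c = 0 → c.im ≠ 0 → |c.im| ≤ |(a.re - (a.im + ε)) - c.re| := by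
    have h := shifted_clear (f := f) (j := j) hGreal hapos hJ hgap hat htg (σ := -1) (Or.inr rfl)
    intro c hc hcim
    have h1 := h c hc hcim
    rwa [show a.re + -1 * (a.im + ε) = a.re - (a.im + ε) by ring] at h1
  have hclR : ∀ c : ℂ, G c = 0 → c.im ≠ 0 → |c.im| ≤ |(a.re + (a.im + ε)) - c.re| := by
    have h := shifted_clear (f := f) (j := j) hGreal hapos hJ hgap hat htg (σ := 1) (Or.inl rfl)
    intro c hc hcim
    have h1 := h c hc hcim
    rwa [show a.re + 1 * (a.im + ε) = a.re + (a.im + ε) by ring] at h1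
  have hW : Window G (a.re - (a.im + ε)) (a.re + (a.im + ε)) (Hs + 1) := by
    refine ⟨by linarith, by linarith, ?_, ?_, ?_, hGα, hGβ, ?_, ?_⟩
    · exact fun x _ => jensenClear_top (by linarith) (by linarith) hstrip
    · exact fun y _ hy0 => jensenClear_vline hy0 hclL
    · exact fun y _ hy0 => jensenClear_vline hy0 hclR
    · rw [e1]; exact hG'α
    · rw [e1]; exact hG'β
  have hamem : a ∈ Ioo (a.re - (a.im + ε)) (a.re + (a.im + ε)) ×ℂ Ioo (-(Hs + 1)) (Hs + 1) :=
    mem_reProdIm.2 ⟨⟨by linarith, by linarith⟩, ⟨by linarith, by linarith⟩⟩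
  by_cases hB : LocalB G (a.re - (a.im + ε)) (a.re + (a.im + ε))
  · by_cases hA : LocalA G (a.re - (a.im + ε)) (a.re + (a.im + ε)) (Hs + 1)
    · exact absurd (no_nonreal_zero_of_localA_localB hG hW hA hB a hamem ha) hapos.ne'
    · unfold LocalA at hA
      push Not at hA
      obtain ⟨ρ, hρ, hdρ, hρim⟩ := hA
      have hdreal : ∀ x : ℝ, (deriv G x).im = 0 := im_deriv_ofReal hG.diff hG.real
      obtain ⟨w, hw, hdw, hwpos⟩ : ∃ w ∈ Ioo (a.re - (a.im + ε)) (a.re + (a.im + ε)) ×ℂ Ioo (-(Hs + 1)) (Hs + 1),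
          deriv G w = 0 ∧ 0 < w.im := by
        rcases lt_or_gt_of_ne hρim with hneg | hpos
        · refine ⟨conj ρ, ?_, ?_, ?_⟩
          · rw [mem_reProdIm] at hρ ⊢
            obtain ⟨h1, h2, h3⟩ := hρ
            refine ⟨by simpa using h1, ?_, ?_⟩
            · simp only [Complex.conj_im]; linarith [h3]
            · simp only [Complex.conj_im]; linarith [h2]
          · rw [apply_conj_eq_conj hG.diff.deriv hdreal ρ, hdρ, map_zero]
          · simpa using hneg
        · exact ⟨ρ, hρ, hdρ, hpos⟩
      have hfw : iteratedDeriv (j + 1) f w = 0 := by rw [← e1]; exact hdw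
      have hwre : w.re ∈ Ioo (a.re - (a.im + ε)) (a.re + (a.im + ε)) := (mem_reProdIm.mp hw).1
      have hwa : |w.re - a.re| < a.im + ε := by rw [abs_lt]; constructor <;> linarith [hwre.1, hwre.2]
      obtain ⟨c, hc, hcpos, hdisc⟩ := jensen_host_levelj hf j hnz ha hwpos hfw
      refine Or.inl ⟨w, hfw, hwpos.ne', ?_⟩
      show (w.re - a.re) ^ 2 + w.im ^ 2 ≤ a.im ^ 2
      by_cases hca : c = a
      · rw [hca] at hdisc; exact hdisc
      · have hwc : |w.re - c.re| ≤ c.im := abs_le_of_sq_le_sq (by nlinarith [sq_nonneg w.im]) hcpos.le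
        rcases hJ c hc hcpos hca with hfar | hnest
        · -- far: impossible by the UNIFORM gap (`ε < g`)
          exfalso
          have hfar' : a.im + |c.im| < |a.re - c.re| := by rwa [abs_of_pos hcpos]
          have hg' := hgap c hc hfar'
          rw [abs_of_pos hcpos] at hg'
          have := abs_sub_le a.re w.re c.re
          rw [abs_sub_comm a.re w.re] at this
          linarith
        · -- nested: `D̄(c) ⊂ D(a)`
          have h1 : |w.re - a.re| ≤ |w.re - c.re| + |c.re - a.re| := abs_sub_le _ _ _
          have h2 : |c.re - a.re| = |a.re - c.re| := abs_sub_comm _ _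
          have h0 : 0 ≤ |w.re - c.re| := abs_nonneg _
          have h0' : 0 ≤ |a.re - c.re| := abs_nonneg _
          have h3 : (w.re - a.re) ^ 2 = |w.re - a.re| ^ 2 := (sq_abs _).symm
          have h3' : (w.re - c.re) ^ 2 = |w.re - c.re| ^ 2 := (sq_abs _).symm
          have h4 : |w.re - a.re| ^ 2 ≤ (|w.re - c.re| + |a.re - c.re|) ^ 2 := by
            rw [h2] at h1
            exact pow_le_pow_left₀ (abs_nonneg _) h1 2
          have h5 : (|w.re - c.re| + |a.re - c.re|) ^ 2 + w.im ^ 2 ≤ (c.im + |a.re - c.re|) ^ 2 := by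
            rw [h3'] at hdisc
            nlinarith [hdisc, hwc, h0, h0', hcpos.le]
          have h6pos : 0 < c.im + |a.re - c.re| := by positivity
          have h6 : (c.im + |a.re - c.re|) ^ 2 < a.im ^ 2 := by
            have hlt : c.im + |a.re - c.re| < a.im := by linarith
            nlinarith [hlt, h6pos, hapos]
          linarith [h3, h4, h5, h6, sq_nonneg w.im]
  · obtain ⟨x, hx, hNL⟩ := nlEventOf_of_not_localB hf j hB
    have hxa : |x - a.re| < a.im + m := by
      rw [abs_lt]; constructor <;> linarith [hx.1, hx.2]
    exact Or.inr ⟨x, hmarg x hNL hxa, hNL⟩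

/-- The CROSSING-MATE residual of the law: `TopPinning` restricted to NON-isolated zeros (under `NoTallerToucher` this means: some
lower-or-equal mate's circle crosses or touches `a`'s, `residual_of_not_jensenIsolated`).  OPEN statement. -/
def TopPinningCrossing : Prop :=
  ∀ (η : ℝ) (f : ℂ → ℂ) (x₀ s hmax R Hs : ℝ) (B : ℕ), EngineHyps5 2 η f x₀ s hmax R Hs B → ∀ (j : ℕ) (a : ℂ),
    iteratedDeriv j f a = 0 → 0 < a.im → NoTallerToucher f j a → ¬ JensenIsolated f j a →
    (∃ w : ℂ, iteratedDeriv (j + 1) f w = 0 ∧ w.im ≠ 0 ∧ NestedStep a w) ∨ (∃ x : ℝ, |x - a.re| ≤ a.im ∧ NLEventOf f j x)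

/-- ★ REDUCTION OF THE LAW TO ITS RESIDUAL (exact split): `TopPinning ⟸ TopPinningCrossing` — the Jensen-isolated population is a theorem. -/
theorem topPinning_of_crossing (hC : TopPinningCrossing) : TopPinning := by
  intro η f x₀ s hmax R Hs B hE j a ha hapos hN
  by_cases hJ : JensenIsolated f j a
  · exact pinning_of_jensenIsolated' hE ha hapos hJ
  · exact hC η f x₀ s hmax R Hs B hE j a ha hapos hN hJ

/-- Converse (bookkeeping): the split is exact. -/
theorem crossing_of_topPinning (hP : TopPinning) : TopPinningCrossing :=
  fun η f x₀ s hmax R Hs B hE j a ha hapos hN _ => hP η f x₀ s hmax R Hs B hE j a ha hapos hN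

end RhW08.Lens1PinningIso


-- ======== ArcSignA-v1 0cbfb41863f8f7cb (import lines stripped) ========

/-!
# TiltedLandingLaw421R3 — lens-1 (O6-a, director-rh g24): the ARC-SIGN census on a Jensen CIRCLE — part A (general pieces)

LENS-1 gen-6 module image `rh33346-cover/lens-1/ArcSignA-v1.lean` (landing target `…/Theorems/TiltedLandingLaw421R3Lens1ArcSignA.lean`;
imports the tree's `…Splittings.JensenWindowDeGuaCount` (`zeroCountC`, `sgn`, `SWindow`, `RolleIdentity`, `LocalB`, `order_pos`,
`rolleIdentity_of_localB_core`, `log_negI_mul_sub_log_I_mul`) and `Literature.Analysis.Complex.RoucheTheorem` (argument principle on a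
circle with the divisor kept: `Rouche.wind_circleLoop_eq_finsum_divisor`, `Rouche.finsum_divisor_eq_finsum_mem_analyticOrderNatAt`);
namespace `RhW08.Lens1ArcSign`; 0 `sorry`, no instances / notation, nothing inlined).

THE LENS (arc-sign pinning, `Cruxes/TiltedLandingLaw421R/Ideas/arc-sign-pinning.md`): Walsh's two-circle count done on `a`'s OWN Jensen
circle `|w − Re a| = Im a + δ` instead of a square window.  Part A is the hypothesis-free complex analysis, reusable by every rung:

§1 ★ `log_increment_eq` — THE ARC LEMMA («`G′/G` in one open half-plane along an arc ⇒ `|Δ arg| ≤ π`», in exact form): along an arc on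
   which the ROTATED path `c·Γ` (`c ≠ 0`, typically `c = ±i`) avoids the cut `(−∞,0]`, EVERY continuous logarithm of `Γ` has increment
   `log (c Γ(t₂)) − log (c Γ(t₁))` (uniqueness of logarithms on an interval, `Literature…exists_int_eq_add_of_exp_eq`).  For `c = i` the
   hypothesis reads «`Γ` never meets the closed positive imaginary axis» (in particular: `Im Γ < 0` inside, real non-zero ends).
§2 ★ `two_mul_wind_eq` — TWO-HALF-PLANE LOOP LEMMA: a loop on `[0,1]` whose first half avoids `i·[0,∞)` and whose second half avoids
   `−i·[0,∞)`, real at `t = 0, ½`, has `2·wind Γ = sgn Re Γ(½) − sgn Re Γ(0)` (so `wind Γ ∈ {0, ±1}`: the `m̃ = 0` case of the lens's `k`).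
§3 circle-loop geometry over a real centre (`Im`, the two feet `t = 0 ↦ c + r`, `t = ½ ↦ c − r`, real points of the circle = the feet).
§4 ★ `wind_circleLoop_eq_zeroCountC` — the argument principle in the tree's CENSUS CURRENCY: for an entire `g` zero-free on the circle,
   `wind (g ∘ circleLoop c r) = zeroCountC g (ball c r)` (orders identified through `analyticOrderNatAt`, not hidden behind `∃`).
§5 ★★ `disc_census` — KIM–WALSH CENSUS ON A DISC: `f` entire and real, `f, f′ ≠ 0` at the feet `c ± r`, and the Jensen–Nagy sign
   `Im w · Im (f′/f)(w) < 0` at every non-real point of the circle ⇒ `2 (N_D(f′) − N_D(f)) = sgn (f′/f)(c − r) − sgn (f′/f)(c + r)`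
   (the disc twin of `…JensenWindow.census_core`, whose square needs Jensen-clear SIDES — the obstruction on the crossing population).
§6 ★ `no_nonreal_zero_of_disc` — disc Rolle closure (twin of `…JensenWindow.no_nonreal_zero_of_rolle_core`): the census, «every zero of
   `f′` in the disc is real» and the real Rolle identity on the base force every zero of `f` in the disc to be real.

HONEST LABEL: tools only; `TopPinning` / `TopPinningCrossing` / `RegUmbrella11S` / 33346 / 33347 stay OPEN; nothing here bears on the truth
of RH; RH is not proved; checked ≠ proved.
-/

noncomputable section

namespace RhW08.Lens1ArcSign

open Complex Set Metric
open scoped Real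
open Literature.Topology.PlaneTopology Literature.Analysis.Complex
open Summit.RiemannHypothesis.RiemannHypothesis.Theorems.Splittings.JensenWindow

variable {f : ℂ → ℂ}

/-! ## §1 The arc lemma: log increments along an arc whose rotate avoids the cut -/

/-- ★ ARC LEMMA.  If `c ≠ 0` and `c · Γ t ∉ (−∞,0]` for `t ∈ [t₁,t₂]`, every continuous logarithm `l` of `Γ` on `[t₁,t₂]` has increment
`l t₂ − l t₁ = log (c Γ t₂) − log (c Γ t₁)`; with `c = i` (`Γ` off the closed positive imaginary axis, e.g. `Im Γ < 0` inside and real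
non-zero ends) resp. `c = −i` this is the exact form of «`|Δ arg Γ| ≤ π` along an arc kept in one half-plane». -/
theorem log_increment_eq {Γ l : ℝ → ℂ} {t₁ t₂ : ℝ} (ht : t₁ ≤ t₂) (hΓ : ContinuousOn Γ (Icc t₁ t₂))
    (hl : ContinuousOn l (Icc t₁ t₂)) (hexp : ∀ t ∈ Icc t₁ t₂, exp (l t) = Γ t) {c : ℂ} (hc : c ≠ 0)
    (hcut : ∀ t ∈ Icc t₁ t₂, c * Γ t ∈ slitPlane) :
    l t₂ - l t₁ = log (c * Γ t₂) - log (c * Γ t₁) := by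
  have hm : ContinuousOn (fun t => log (c * Γ t) - log c) (Icc t₁ t₂) :=
    ((continuousOn_const.mul hΓ).clog hcut).sub continuousOn_const
  have hme : ∀ t ∈ Icc t₁ t₂, exp (l t) = exp (log (c * Γ t) - log c) := by
    intro t ht
    rw [hexp t ht, exp_sub, exp_log (slitPlane_ne_zero (hcut t ht)), exp_log hc, mul_div_cancel_left₀ _ hc]
  obtain ⟨n, hn⟩ := exists_int_eq_add_of_exp_eq isPreconnected_Icc hl hm hme
  rw [hn t₂ (right_mem_Icc.2 ht), hn t₁ (left_mem_Icc.2 ht)]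
  ring

/-! ## §2 The two-half-plane loop lemma (`m̃ = 0`) -/

/-- ★ TWO-HALF-PLANE LOOP LEMMA.  A loop `Γ` on `[0,1]` with `i Γ ∉ (−∞,0]` on `[0,½]`, `−i Γ ∉ (−∞,0]` on `[½,1]`, real at `t = 0` and
`t = ½`, winds `wind Γ = (sgn Re Γ(½) − sgn Re Γ(0)) / 2` times about `0`. -/
theorem two_mul_wind_eq {Γ : ℝ → ℂ} (hΓ : ContinuousOn Γ (Icc 0 1)) (h01 : Γ 0 = Γ 1)
    (hlo : ∀ t ∈ Icc (0 : ℝ) (1 / 2), I * Γ t ∈ slitPlane) (hhi : ∀ t ∈ Icc (1 / 2 : ℝ) 1, -I * Γ t ∈ slitPlane)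
    (h0 : (Γ 0).im = 0) (hh : (Γ (1 / 2)).im = 0) :
    2 * (wind Γ : ℂ) = sgn (Γ (1 / 2)).re - sgn (Γ 0).re := by
  have hne : ∀ t ∈ Icc (0 : ℝ) 1, Γ t ≠ 0 := by
    intro t ht h0t
    by_cases h : t ≤ 1 / 2
    · exact slitPlane_ne_zero (hlo t ⟨ht.1, h⟩) (by rw [h0t, mul_zero])
    · exact slitPlane_ne_zero (hhi t ⟨(not_le.mp h).le, ht.2⟩) (by rw [h0t, mul_zero])
  obtain ⟨l, hl, hle⟩ := (IsNonvanishingLoop.mk hΓ hne h01).hasLogOn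
  have hw := wind_spec hl hle h01
  have hq0 : (0 : ℝ) ≤ 1 / 2 := by norm_num
  have hq1 : (1 / 2 : ℝ) ≤ 1 := by norm_num
  have e1 := log_increment_eq hq0 (hΓ.mono (Icc_subset_Icc_right hq1)) (hl.mono (Icc_subset_Icc_right hq1))
    (fun t ht => hle t ⟨ht.1, ht.2.trans hq1⟩) I_ne_zero hlo
  have e2 := log_increment_eq hq1 (hΓ.mono (Icc_subset_Icc_left hq0)) (hl.mono (Icc_subset_Icc_left hq0))
    (fun t ht => hle t ⟨hq0.trans ht.1, ht.2⟩) (neg_ne_zero.2 I_ne_zero) hhi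
  have hΓ0 : Γ 0 = ((Γ 0).re : ℂ) := Complex.ext (by rw [ofReal_re]) (by rw [ofReal_im, h0])
  have hΓ1 : Γ 1 = ((Γ 0).re : ℂ) := by rw [← h01]; exact hΓ0
  have hΓh : Γ (1 / 2) = ((Γ (1 / 2)).re : ℂ) := Complex.ext (by rw [ofReal_re]) (by rw [ofReal_im, hh])
  have hx0 : (Γ 0).re ≠ 0 := fun h => hne 0 ⟨le_rfl, zero_le_one⟩ (by rw [hΓ0, h, ofReal_zero])
  have hxh : (Γ (1 / 2)).re ≠ 0 := fun h => hne (1 / 2) ⟨hq0, hq1⟩ (by rw [hΓh, h, ofReal_zero])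
  have k0 := log_negI_mul_sub_log_I_mul hx0
  have kh := log_negI_mul_sub_log_I_mul hxh
  have htot : l 1 - l 0 = (l 1 - l (1 / 2)) + (l (1 / 2) - l 0) := by ring
  rw [htot, e1, e2, hΓ1, hΓh, hΓ0] at hw
  simp only [ofReal_re] at hw
  have key : (wind Γ : ℂ) * (2 * π * I) = (Real.pi * I) * (sgn (Γ (1 / 2)).re - sgn (Γ 0).re) := by
    rw [← hw]
    linear_combination k0 - kh
  have hπI : (Real.pi : ℂ) * I ≠ 0 := mul_ne_zero (ofReal_ne_zero.2 Real.pi_ne_zero) I_ne_zero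
  apply mul_right_cancel₀ hπI
  linear_combination key

/-! ## §3 Circle-loop geometry over a real centre -/

/-- `Im` along the circle loop of real centre `c`: `r sin 2πt`. -/
theorem circleLoop_ofReal_im (c r t : ℝ) : (circleLoop (c : ℂ) r t).im = r * Real.sin (2 * π * t) := by
  have e : (2 * ↑π * ↑t * I : ℂ) = ((2 * π * t : ℝ) : ℂ) * I := by push_cast; ring
  rw [circleLoop_apply, e, add_im, ofReal_im, im_ofReal_mul, exp_ofReal_mul_I_im, zero_add]

/-- The right foot: `t = 0 ↦ c + r`. -/
theorem circleLoop_ofReal_zero (c r : ℝ) : circleLoop (c : ℂ) r 0 = ((c + r : ℝ) : ℂ) := by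
  rw [circleLoop_apply]; push_cast; simp

/-- The left foot: `t = ½ ↦ c − r`. -/
theorem circleLoop_ofReal_half (c r : ℝ) : circleLoop (c : ℂ) r (1 / 2) = ((c - r : ℝ) : ℂ) := by
  have e : (2 * ↑π * ↑((1 : ℝ) / 2) * I : ℂ) = ↑π * I := by push_cast; ring
  rw [circleLoop_apply, e, Complex.exp_pi_mul_I]; push_cast; ring

/-- On the upper closed half-loop `t ∈ [0,½]` the imaginary part is `≥ 0` (`r ≥ 0`). -/
theorem circleLoop_im_nonneg {c r : ℝ} (hr : 0 ≤ r) {t : ℝ} (ht : t ∈ Icc (0 : ℝ) (1 / 2)) : 0 ≤ (circleLoop (c : ℂ) r t).im := by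
  rw [circleLoop_ofReal_im]
  exact mul_nonneg hr (Real.sin_nonneg_of_nonneg_of_le_pi (by nlinarith [Real.pi_pos, ht.1]) (by nlinarith [Real.pi_pos, ht.2]))

/-- On the lower closed half-loop `t ∈ [½,1]` the imaginary part is `≤ 0` (`r ≥ 0`). -/
theorem circleLoop_im_nonpos {c r : ℝ} (hr : 0 ≤ r) {t : ℝ} (ht : t ∈ Icc (1 / 2 : ℝ) 1) : (circleLoop (c : ℂ) r t).im ≤ 0 := by
  rw [circleLoop_ofReal_im, ← Real.sin_sub_two_pi]
  exact mul_nonpos_of_nonneg_of_nonpos hr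
    (Real.sin_nonpos_of_nonpos_of_neg_pi_le (by nlinarith [Real.pi_pos, ht.2]) (by nlinarith [Real.pi_pos, ht.1]))

/-- The real points of the circle `‖u − c‖ = r` (`c` real) are its two feet `c ± r`. -/
theorem eq_feet_of_sphere_real {c r : ℝ} {u : ℂ} (hu : ‖u - c‖ = r) (him : u.im = 0) :
    u = ((c + r : ℝ) : ℂ) ∨ u = ((c - r : ℝ) : ℂ) := by
  have e : u = ((u.re : ℝ) : ℂ) := Complex.ext (by simp) (by simp [him])
  rw [e, ← ofReal_sub, Complex.norm_real, Real.norm_eq_abs] at hu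
  have hr : 0 ≤ r := hu ▸ abs_nonneg _
  rcases (abs_eq hr).mp hu with h | h
  · left; rw [e, show u.re = c + r by linarith]
  · right; rw [e, show u.re = c - r by linarith]

/-- The open disc of real centre lies in the square box of the same centre and radius. -/
theorem ball_subset_box (c r : ℝ) : ball (c : ℂ) r ⊆ Ioo (c - r) (c + r) ×ℂ Ioo (-r) r := by
  intro z hz
  rw [mem_ball, dist_eq_norm] at hz
  have h1 := lt_of_le_of_lt (abs_re_le_norm (z - c)) hz
  have h2 := lt_of_le_of_lt (abs_im_le_norm (z - c)) hz
  rw [sub_re, ofReal_re, abs_lt] at h1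
  rw [sub_im, ofReal_im, sub_zero, abs_lt] at h2
  exact mem_reProdIm.2 ⟨⟨by linarith [h1.1], by linarith [h1.2]⟩, ⟨h2.1, h2.2⟩⟩

/-- A real point of the box `(c − r, c + r) × (−r, r)` lies in the disc. -/
theorem mem_ball_of_box_real {c r : ℝ} {ρ : ℂ} (hρ : ρ ∈ Ioo (c - r) (c + r) ×ℂ Ioo (-r) r) (him : ρ.im = 0) :
    ρ ∈ ball (c : ℂ) r := by
  have e : ρ - c = (((ρ.re - c : ℝ)) : ℂ) := Complex.ext (by simp) (by simp [him])
  have h := (mem_reProdIm.mp hρ).1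
  rw [mem_ball, dist_eq_norm, e, Complex.norm_real, Real.norm_eq_abs, abs_lt]
  exact ⟨by linarith [h.1], by linarith [h.2]⟩

/-- Real-axis counts agree: box ∩ ℝ and disc ∩ ℝ carry the same zeros. -/
theorem zeroCountC_box_real_eq (g : ℂ → ℂ) (c r : ℝ) :
    zeroCountC g ((Ioo (c - r) (c + r) ×ℂ Ioo (-r) r) ∩ {ρ | ρ.im = 0}) = zeroCountC g (ball (c : ℂ) r ∩ {ρ | ρ.im = 0}) := by
  have hset : {ρ : ℂ | g ρ = 0 ∧ ρ ∈ (Ioo (c - r) (c + r) ×ℂ Ioo (-r) r) ∩ {ρ | ρ.im = 0}} =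
      {ρ : ℂ | g ρ = 0 ∧ ρ ∈ ball (c : ℂ) r ∩ {ρ | ρ.im = 0}} := by
    ext ρ
    simp only [mem_setOf_eq, mem_inter_iff]
    constructor
    · rintro ⟨h0, hb, him⟩; exact ⟨h0, mem_ball_of_box_real hb him, him⟩
    · rintro ⟨h0, hb, him⟩; exact ⟨h0, ball_subset_box c r hb, him⟩
  unfold zeroCountC
  rw [hset]

/-! ## §4 The argument principle in census currency -/

/-- An entire function that is non-zero somewhere has finite order everywhere. -/
theorem analyticOrderAt_ne_top_of_entire {g : ℂ → ℂ} (hg : Differentiable ℂ g) {u₀ : ℂ} (h₀ : g u₀ ≠ 0) (z : ℂ) :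
    analyticOrderAt g z ≠ ⊤ := by
  intro htop
  have hgan : AnalyticOnNhd ℂ g univ := fun w _ => hg.analyticAt w
  exact h₀ (hgan.eqOn_zero_of_preconnected_of_eventuallyEq_zero isPreconnected_univ (mem_univ z)
    (analyticOrderAt_eq_top.mp htop) (mem_univ u₀))

/-- ★ ARGUMENT PRINCIPLE IN CENSUS CURRENCY: for an entire `g` zero-free on the circle `‖u − c‖ = r` (`r > 0`), the winding number of
`g ∘ circleLoop c r` about `0` is the tree's count `zeroCountC g (ball c r)` of the zeros inside, with multiplicity.
[Conway, Functions of One Complex Variable I, Ch. V §3 Thm 3.4, via `Literature…Rouche.wind_circleLoop_eq_finsum_divisor`.] -/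
theorem wind_circleLoop_eq_zeroCountC {g : ℂ → ℂ} (hg : Differentiable ℂ g) {c : ℂ} {r : ℝ} (hr : 0 < r)
    (hsph : ∀ u : ℂ, ‖u - c‖ = r → g u ≠ 0) :
    ((wind (fun t => g (circleLoop c r t)) : ℤ) : ℂ) = zeroCountC g (ball c r) := by
  classical
  have hrρ : r < r + 1 := by linarith
  have hgd : DifferentiableOn ℂ g (ball c (r + 1)) := hg.differentiableOn
  rw [Rouche.wind_circleLoop_eq_finsum_divisor g hr hrρ hgd hsph,
    Rouche.finsum_divisor_eq_finsum_mem_analyticOrderNatAt g hr hrρ hgd hsph]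
  have hcr : ‖c + (r : ℂ) - c‖ = r := by rw [add_sub_cancel_left, Complex.norm_of_nonneg hr.le]
  have hne_top : ∀ z, analyticOrderAt g z ≠ ⊤ := analyticOrderAt_ne_top_of_entire hg (hsph _ hcr)
  set Z : Set ℂ := {ρ : ℂ | g ρ = 0 ∧ ρ ∈ ball c r} with hZ
  have hZfin : Z.Finite := by
    refine (Rouche.finite_zeros g hr hrρ hgd hsph).subset ?_
    rintro ρ ⟨h0, hρ⟩
    exact ⟨ball_subset_closedBall hρ, h0⟩
  have hset : ball c r ∩ Function.support (analyticOrderNatAt g) = Z ∩ Function.support (analyticOrderNatAt g) := by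
    ext z
    simp only [mem_inter_iff, Function.mem_support, hZ, mem_setOf_eq]
    constructor
    · rintro ⟨hb, hs⟩; exact ⟨⟨apply_eq_zero_of_analyticOrderNatAt_ne_zero hs, hb⟩, hs⟩
    · rintro ⟨⟨-, hb⟩, hs⟩; exact ⟨hb, hs⟩
  rw [finsum_mem_inter_support_eq _ _ _ hset, finsum_mem_eq_finite_toFinset_sum _ hZfin]
  unfold zeroCountC
  rw [finsum_mem_eq_finite_toFinset_sum _ hZfin]
  push_cast
  refine Finset.sum_congr rfl fun z _ => ?_
  have hn : analyticOrderAt g z = (analyticOrderNatAt g z : ℕ∞) := (Nat.cast_analyticOrderNatAt (hne_top z)).symm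
  rw [(hg.analyticAt z).meromorphicOrderAt_eq, hn]
  simp

/-! ## §5 The Kim–Walsh census on a disc -/

/-- `f′/f` is real on the real axis for a real `f`. -/
theorem logDeriv_im_ofReal (hfd : Differentiable ℂ f) (hreal : ∀ x : ℝ, (f x).im = 0) (x : ℝ) :
    (deriv f x / f x).im = 0 := by
  rw [Complex.div_im, hreal x, im_deriv_ofReal hfd hreal x]; ring

/-- Under the circle sign hypothesis and non-vanishing at the feet, `f` has no zero on the circle. -/
theorem ne_zero_on_sphere {c r : ℝ} (hfl : f ((c - r : ℝ) : ℂ) ≠ 0) (hfr : f ((c + r : ℝ) : ℂ) ≠ 0)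
    (hsgn : ∀ w : ℂ, ‖w - c‖ = r → w.im ≠ 0 → w.im * (deriv f w / f w).im < 0) :
    ∀ u : ℂ, ‖u - c‖ = r → f u ≠ 0 := by
  intro u hu h0
  by_cases him : u.im = 0
  · rcases eq_feet_of_sphere_real hu him with e | e
    · exact hfr (e ▸ h0)
    · exact hfl (e ▸ h0)
  · have h := hsgn u hu him
    rw [h0, div_zero, Complex.zero_im, mul_zero] at h
    exact lt_irrefl _ h

/-- Under the circle sign hypothesis and non-vanishing at the feet, `f′` has no zero on the circle. -/
theorem deriv_ne_zero_on_sphere {c r : ℝ} (hdl : deriv f ((c - r : ℝ) : ℂ) ≠ 0) (hdr : deriv f ((c + r : ℝ) : ℂ) ≠ 0)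
    (hsgn : ∀ w : ℂ, ‖w - c‖ = r → w.im ≠ 0 → w.im * (deriv f w / f w).im < 0) :
    ∀ u : ℂ, ‖u - c‖ = r → deriv f u ≠ 0 := by
  intro u hu h0
  by_cases him : u.im = 0
  · rcases eq_feet_of_sphere_real hu him with e | e
    · exact hdr (e ▸ h0)
    · exact hdl (e ▸ h0)
  · have h := hsgn u hu him
    rw [h0, zero_div, Complex.zero_im, mul_zero] at h
    exact lt_irrefl _ h

/-- ★★ KIM–WALSH CENSUS ON A DISC.  `f` entire and real, `f, f′ ≠ 0` at the feet `c ± r` (`r > 0`), and `Im w · Im (f′/f)(w) < 0` at every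
non-real point of the circle `‖w − c‖ = r` ⇒ `2 (N_D(f′) − N_D(f)) = sgn (f′/f)(c − r) − sgn (f′/f)(c + r)` on the open disc `D`.
[Walsh, Ann. of Math. 22 (1920) §4; Kim, PAMS 124 (1996) Thm 1 — window form in the tree: `…JensenWindow.census_core`.] -/
theorem disc_census (hfd : Differentiable ℂ f) (hreal : ∀ x : ℝ, (f x).im = 0) {c r : ℝ} (hr : 0 < r)
    (hfl : f ((c - r : ℝ) : ℂ) ≠ 0) (hfr : f ((c + r : ℝ) : ℂ) ≠ 0)
    (hdl : deriv f ((c - r : ℝ) : ℂ) ≠ 0) (hdr : deriv f ((c + r : ℝ) : ℂ) ≠ 0)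
    (hsgn : ∀ w : ℂ, ‖w - c‖ = r → w.im ≠ 0 → w.im * (deriv f w / f w).im < 0) :
    2 * (zeroCountC (deriv f) (ball (c : ℂ) r) - zeroCountC f (ball (c : ℂ) r)) =
      sgn (deriv f ((c - r : ℝ) : ℂ) / f ((c - r : ℝ) : ℂ)).re - sgn (deriv f ((c + r : ℝ) : ℂ) / f ((c + r : ℝ) : ℂ)).re := by
  have hf0 := ne_zero_on_sphere hfl hfr hsgn
  have hd0 := deriv_ne_zero_on_sphere hdl hdr hsgn
  have hγr : ∀ t : ℝ, ‖circleLoop (c : ℂ) r t - c‖ = r := fun t => by rw [norm_circleLoop_sub_center, abs_of_pos hr]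
  have hcf : Continuous fun t : ℝ => f (circleLoop (c : ℂ) r t) := hfd.continuous.comp (continuous_circleLoop _ _)
  have hcd : Continuous fun t : ℝ => deriv f (circleLoop (c : ℂ) r t) := hfd.deriv.continuous.comp (continuous_circleLoop _ _)
  have hF : IsNonvanishingLoop (fun t => f (circleLoop (c : ℂ) r t)) :=
    ⟨hcf.continuousOn, fun t _ => hf0 _ (hγr t), by simp only [circleLoop_zero_eq]⟩
  have hF' : IsNonvanishingLoop (fun t => deriv f (circleLoop (c : ℂ) r t)) :=
    ⟨hcd.continuousOn, fun t _ => hd0 _ (hγr t), by simp only [circleLoop_zero_eq]⟩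
  have hdiv : wind (fun t => deriv f (circleLoop (c : ℂ) r t) / f (circleLoop (c : ℂ) r t)) =
      wind (fun t => deriv f (circleLoop (c : ℂ) r t)) - wind (fun t => f (circleLoop (c : ℂ) r t)) := wind_div hF' hF
  have hWf := wind_circleLoop_eq_zeroCountC hfd hr hf0
  have hWd := wind_circleLoop_eq_zeroCountC hfd.deriv hr hd0
  have him_real : ∀ x : ℝ, (deriv f x / f x).im = 0 := logDeriv_im_ofReal hfd hreal
  -- values of `f′/f` on the circle: real non-zero at the feet, lower half-plane above the axis, upper below
  have hreal_pt : ∀ u : ℂ, ‖u - c‖ = r → u.im = 0 → (deriv f u / f u).im = 0 ∧ (deriv f u / f u).re ≠ 0 := by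
    intro u hu him
    have hq : deriv f u / f u ≠ 0 := div_ne_zero (hd0 u hu) (hf0 u hu)
    have him' : (deriv f u / f u).im = 0 := by
      rcases eq_feet_of_sphere_real hu him with e | e <;> rw [e] <;> exact him_real _
    exact ⟨him', fun hre => hq (Complex.ext (by simpa using hre) (by simpa using him'))⟩
  have hup : ∀ u : ℂ, ‖u - c‖ = r → 0 < u.im → (deriv f u / f u).im < 0 := fun u hu hpos => by
    rcases mul_neg_iff.mp (hsgn u hu hpos.ne') with h | h
    · exact h.2
    · exact absurd h.1 (not_lt.mpr hpos.le)
  have hdn : ∀ u : ℂ, ‖u - c‖ = r → u.im < 0 → 0 < (deriv f u / f u).im := fun u hu hneg => by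
    rcases mul_neg_iff.mp (hsgn u hu hneg.ne) with h | h
    · exact absurd h.1 (not_lt.mpr hneg.le)
    · exact h.2
  have hlo : ∀ t ∈ Icc (0 : ℝ) (1 / 2), I * (deriv f (circleLoop (c : ℂ) r t) / f (circleLoop (c : ℂ) r t)) ∈ slitPlane := by
    intro t ht
    rcases (circleLoop_im_nonneg (c := c) hr.le ht).eq_or_lt with h0 | hpos
    · obtain ⟨-, hre⟩ := hreal_pt _ (hγr t) h0.symm
      rw [mem_slitPlane_iff]; right
      simpa [Complex.mul_im] using hre
    · have h := hup _ (hγr t) hpos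
      rw [mem_slitPlane_iff]; left
      have e : (I * (deriv f (circleLoop (c : ℂ) r t) / f (circleLoop (c : ℂ) r t))).re =
          -(deriv f (circleLoop (c : ℂ) r t) / f (circleLoop (c : ℂ) r t)).im := by simp [Complex.mul_re]
      rw [e]; linarith
  have hhi : ∀ t ∈ Icc (1 / 2 : ℝ) 1, -I * (deriv f (circleLoop (c : ℂ) r t) / f (circleLoop (c : ℂ) r t)) ∈ slitPlane := by
    intro t ht
    rcases (circleLoop_im_nonpos (c := c) hr.le ht).eq_or_lt with h0 | hneg
    · obtain ⟨-, hre⟩ := hreal_pt _ (hγr t) h0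
      rw [mem_slitPlane_iff]; right
      simpa [Complex.mul_im] using hre
    · have h := hdn _ (hγr t) hneg
      rw [mem_slitPlane_iff]; left
      have e : (-I * (deriv f (circleLoop (c : ℂ) r t) / f (circleLoop (c : ℂ) r t))).re =
          (deriv f (circleLoop (c : ℂ) r t) / f (circleLoop (c : ℂ) r t)).im := by simp [Complex.mul_re]
      rw [e]; exact h
  have hΓc : ContinuousOn (fun t => deriv f (circleLoop (c : ℂ) r t) / f (circleLoop (c : ℂ) r t)) (Icc 0 1) :=
    hcd.continuousOn.div hcf.continuousOn fun t _ => hf0 _ (hγr t)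
  have h01 : deriv f (circleLoop (c : ℂ) r 0) / f (circleLoop (c : ℂ) r 0) =
      deriv f (circleLoop (c : ℂ) r 1) / f (circleLoop (c : ℂ) r 1) := by rw [circleLoop_zero_eq]
  have hΓ0 : (deriv f (circleLoop (c : ℂ) r 0) / f (circleLoop (c : ℂ) r 0)).im = 0 := by
    rw [circleLoop_ofReal_zero]; exact him_real _
  have hΓh : (deriv f (circleLoop (c : ℂ) r (1 / 2)) / f (circleLoop (c : ℂ) r (1 / 2))).im = 0 := by
    rw [circleLoop_ofReal_half]; exact him_real _
  have key := two_mul_wind_eq hΓc h01 hlo hhi hΓ0 hΓh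
  rw [circleLoop_ofReal_half, circleLoop_ofReal_zero, hdiv, Int.cast_sub, hWd, hWf] at key
  exact key

/-! ## §6 Disc Rolle closure -/

/-- ★ DISC ROLLE CLOSURE (twin of `…JensenWindow.no_nonreal_zero_of_rolle_core`).  Under the disc census hypotheses, if every zero of `f′`
in the open disc is real and the real Rolle identity holds on the base `(c − r, c + r)`, then every zero of `f` in the disc is real. -/
theorem no_nonreal_zero_of_disc (hfd : Differentiable ℂ f) (hreal : ∀ x : ℝ, (f x).im = 0) {c r : ℝ} (hr : 0 < r)
    (hfl : f ((c - r : ℝ) : ℂ) ≠ 0) (hfr : f ((c + r : ℝ) : ℂ) ≠ 0)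
    (hdl : deriv f ((c - r : ℝ) : ℂ) ≠ 0) (hdr : deriv f ((c + r : ℝ) : ℂ) ≠ 0)
    (hsgn : ∀ w : ℂ, ‖w - c‖ = r → w.im ≠ 0 → w.im * (deriv f w / f w).im < 0)
    (hA : ∀ ρ ∈ ball (c : ℂ) r, deriv f ρ = 0 → ρ.im = 0) (hR : RolleIdentity f (c - r) (c + r) r) :
    ∀ ρ ∈ ball (c : ℂ) r, f ρ = 0 → ρ.im = 0 := by
  classical
  have hc := disc_census hfd hreal hr hfl hfr hdl hdr hsgn
  have hf0 := ne_zero_on_sphere hfl hfr hsgn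
  have hW : SWindow f (fun _ => True) (c - r) (c + r) r :=
    ⟨by linarith, hr, fun _ _ => trivial, fun _ _ => trivial, fun _ _ _ => trivial, fun _ _ _ => trivial, hfl, hfr, hdl, hdr⟩
  set K : Set ℂ := ball (c : ℂ) r with hKdef
  have hfin : {ρ : ℂ | f ρ = 0 ∧ ρ ∈ K}.Finite := by
    refine (Rouche.finite_zeros f hr (by linarith : r < r + 1) hfd.differentiableOn hf0).subset ?_
    rintro ρ ⟨h0, hρ⟩
    exact ⟨ball_subset_closedBall hρ, h0⟩
  have e1 : {ρ : ℂ | deriv f ρ = 0 ∧ ρ ∈ K} = {ρ : ℂ | deriv f ρ = 0 ∧ ρ ∈ K ∩ {ρ | ρ.im = 0}} := by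
    ext ρ
    simp only [mem_setOf_eq, mem_inter_iff]
    constructor
    · rintro ⟨h0, hK⟩; exact ⟨h0, hK, hA ρ hK h0⟩
    · rintro ⟨h0, hK, -⟩; exact ⟨h0, hK⟩
  have e1' : zeroCountC (deriv f) K = zeroCountC (deriv f) (K ∩ {ρ | ρ.im = 0}) := by
    unfold zeroCountC; rw [e1]
  set B : Set ℂ := {ρ : ℂ | f ρ = 0 ∧ ρ ∈ K ∧ ρ.im ≠ 0} with hBdef
  have e2 : {ρ : ℂ | f ρ = 0 ∧ ρ ∈ K} = {ρ : ℂ | f ρ = 0 ∧ ρ ∈ K ∩ {ρ | ρ.im = 0}} ∪ B := by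
    ext ρ
    simp only [mem_setOf_eq, mem_inter_iff, mem_union, hBdef]
    constructor
    · rintro ⟨h0, hK⟩
      by_cases him : ρ.im = 0
      · exact Or.inl ⟨h0, hK, him⟩
      · exact Or.inr ⟨h0, hK, him⟩
    · rintro (⟨h0, hK, -⟩ | ⟨h0, hK, -⟩) <;> exact ⟨h0, hK⟩
  have hdisj : Disjoint {ρ : ℂ | f ρ = 0 ∧ ρ ∈ K ∩ {ρ | ρ.im = 0}} B := by
    rw [Set.disjoint_left]
    rintro ρ ⟨-, -, him⟩ ⟨-, -, him'⟩
    exact him' him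
  have hAfin : {ρ : ℂ | f ρ = 0 ∧ ρ ∈ K ∩ {ρ | ρ.im = 0}}.Finite := hfin.subset fun ρ hρ => ⟨hρ.1, hρ.2.1⟩
  have hBfin : B.Finite := hfin.subset fun ρ hρ => ⟨hρ.1, hρ.2.1⟩
  have e2' : zeroCountC f K = zeroCountC f (K ∩ {ρ | ρ.im = 0}) + ∑ᶠ ρ ∈ B, ((meromorphicOrderAt f ρ).untop₀ : ℂ) := by
    unfold zeroCountC; rw [e2, finsum_mem_union hdisj hAfin hBfin]
  have hB0 : ∑ᶠ ρ ∈ B, ((meromorphicOrderAt f ρ).untop₀ : ℂ) = 0 := by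
    rw [e1', e2'] at hc
    unfold RolleIdentity at hR
    rw [zeroCountC_box_real_eq, zeroCountC_box_real_eq] at hR
    linear_combination (1 / 2 : ℂ) * hR - (1 / 2 : ℂ) * hc
  rw [finsum_mem_eq_finite_toFinset_sum _ hBfin, ← Int.cast_sum] at hB0
  have hB0' : ∑ ρ ∈ hBfin.toFinset, (meromorphicOrderAt f ρ).untop₀ = 0 := by exact_mod_cast hB0
  have hpos : ∀ ρ ∈ hBfin.toFinset, 0 < (meromorphicOrderAt f ρ).untop₀ := by
    intro ρ hρ
    rw [Set.Finite.mem_toFinset] at hρ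
    exact order_pos hfd hW (ball_subset_box c r hρ.2.1) hρ.1
  have hall := (Finset.sum_eq_zero_iff_of_nonneg fun ρ hρ => (hpos ρ hρ).le).mp hB0'
  intro ρ hρK hρ0
  by_contra him
  have hρB : ρ ∈ hBfin.toFinset := by
    rw [Set.Finite.mem_toFinset]; exact ⟨hρ0, hρK, him⟩
  have h1 := hall ρ hρB
  have h2 := hpos ρ hρB
  omega

end RhW08.Lens1ArcSign


-- ======== ArcSignB-v1 7122b4eed565c646 (import lines stripped) ========

/-!
# TiltedLandingLaw421R3 — lens-1 (O6-a, director-rh g24): RUNG 1 of the arc-sign ladder — `pinning_of_arcSignClear` PROVED (part B)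

LENS-1 gen-6 module image `rh33346-cover/lens-1/ArcSignB-v1.lean` (landing target `…/Theorems/TiltedLandingLaw421R3Lens1ArcSignB.lean`;
imports `…R3Lens1PinningIsoB` (`RhW08.Lens1PinningIso.exists_uniform_far_gap`, `exists_nl_margin`, `JensenIsolated`,
`pinning_of_jensenIsolated'`, `TopPinningCrossing`; image `lens-1/PinningIsoB-v1.lean` 830c0db8 until it is tree) and part A
`…R3Lens1ArcSignA` (`RhW08.Lens1ArcSign.disc_census`, `no_nonreal_zero_of_disc`); namespace `RhW08.Lens1ArcSign`; 0 `sorry`,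
no instances / notation, nothing inlined; checked BY CHAIN over those two images until both are tree).

CONTENT (the `m̃ = 0` rung of the arc-sign ladder for the OPEN law `RhW08.Lens1Pinning.TopPinning`):
§1 `exists_child_margin` — finitely many zeros of `f^{(j+1)}` near `a`'s closed disc (strip + box), so a non-real one within `Im a + m′`
   of `Re a` is already a `NestedStep` child (`m′ ∈ (0,1]`).
§2 ★★★ `pinning_of_arcSignClear` — RUNG 1: on a legal frame (`EngineHyps5 2 …`), an upper zero `a` of `f^{(j)}` whose small Jensen
   circles `|w − Re a| = Im a + δ` (`0 < δ < d₀`) carry `Im (f^{(j+1)}/f^{(j)}) < 0` on their UPPER half (ARC-SIGN CLEARANCE, `m̃(a) = 0`;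
   the lower half follows by conjugation) satisfies the LITERAL `TopPinning` disjunction: a non-real zero of `f^{(j+1)}` in the CLOSED
   Jensen disc (`NestedStep a w`) or an NL event of level `j` in the CLOSED base `|x − Re a| ≤ Im a`.  MECHANISM: pick a GENERIC
   `δ < min(d₀, NL margin, child margin)` whose feet `Re a ± (Im a + δ)` miss the finitely many zeros of `f^{(j)} f^{(j+1)}`
   (`RhW08.SuccB.finite_zeros_box`, `Set.Ioo_infinite`); the disc census `2 (N_D(G′) − N_D(G)) = sgn φ(left) − sgn φ(right)` (part A)
   and the real Rolle identity on the base (`…JensenWindow.rolleIdentity_of_localB_core`, from the local Laguerre law B — else an NL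
   event, `RhW08.QuadW.nlEventOf_of_not_localB`, within the margin) leave no room for a non-real zero of `G` in the disc once every
   critical point in the disc is real (else it is a `NestedStep` child) — but `a` itself is one.  NO isolation, NO clean feet, NO
   smallness: the hypothesis is exactly the sign of ONE function on ONE family of arcs.
§3 `ArcSignClear` (the hypothesis as a `Prop`), `topPinning_case_arcSignClear`; ★ `arcSignClear_of_jensenIsolated` — a JENSEN-ISOLATED
   zero is arc-sign clear (every point of a circle of radius `< Im a + g`, `g` the uniform far gap, is Jensen-clear for `f^{(j)}`, and
   the Jensen–Nagy sign `…JensenWindow.im_mul_im_logDeriv_neg` applies) — so RUNG 1 SUBSUMES (3p)″ `pinning_of_jensenIsolated'`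
   (`pinning_of_jensenIsolated_via_arcSign`) and reaches into the crossing population (`m̃ = 0` there: 11.1 % registry-facing,
   instr-1 `INSTRUMENT-v3-TCROSS.md` §5).
§4 `TopPinningArcResidual` — the typed residual of the law after RUNG 1 (crossing mates AND `¬ ArcSignClear`, i.e. `m̃ ≥ 1`), with the
   exact split `topPinningCrossing_of_arcResidual` / `topPinning_of_arcResidual` / `arcResidual_of_topPinning`.  OPEN.

HONEST LABEL: RUNG 1 is a special case PROVED ≠ the law; `TopPinning` / `TopPinningCrossing` / `TopPinningArcResidual` /
`RegUmbrella11S` / 33346 / 33347 stay OPEN; nothing here bears on the truth of RH; RH is not proved; checked ≠ proved.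
-/

noncomputable section

namespace RhW08.Lens1ArcSign

open Complex Set Metric
open scoped ComplexConjugate
open Literature.Analysis.Complex
open Summit.RiemannHypothesis.RiemannHypothesis.Theorems.Splittings.JensenWindow
open RhIdea6.G17.W07C7 RhIdea6.G17.W07C7.Rev6 RhIdea6.G18.W07C8.Law421BirthS RhIdea6.G19.W07C11.Seam
open RhIdea6.G20.W07C12.Frac RhIdea6.G20.W07C12.StColP RhW07.C12.FieldSplit RhIdea6.G21.W07C13.TentMax
open RhW07.C14.TwoSided RhW07.C14.Classes RhW07.C14.Lineage RhW07.C14.Booking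
open RhW07.C13.Heredity RhIdea6.G22.W07C15pre.Injection RhW07.E3.Cell RhW07.E3.Lit
open RhW08.Round1 RhW08.StSwap RhW08.Round2 RhW08.QuadW RhW08.SealSwapQ RhW08.SealSwap RhW08.SuccB RhW08.SuccSplit
open RhW08.SuccTheft RhW08.Column RhW08.Hurwitz RhW08.ClusterQ RhW08.ClusterQM RhW08.NewtonDoor RhW08.NewtonDoorGenusOne RhW08.PurseP
open RhW08.Lens1SignCut RhW08.Lens1Coverage RhW08.IsolatedTilt RhW08.Lens1Pinning RhW08.Lens1PinningIso

/-! ## §1 The child margin -/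

/-- CHILD MARGIN: on a legal frame with `f^{(j+1)} ≢ 0`, there is `m′ ∈ (0,1]` such that every NON-REAL zero `w` of `f^{(j+1)}` with
`‖w − Re a‖ < Im a + m′` lies in `a`'s CLOSED Jensen disc (`NestedStep a w`): finitely many zeros in the box (strip `|Im| ≤ Hs`). -/
theorem exists_child_margin {η : ℝ} {f : ℂ → ℂ} {x₀ s hmax R Hs : ℝ} {B : ℕ} (hE : EngineHyps5 2 η f x₀ s hmax R Hs B)
    {j : ℕ} (hne : iteratedDeriv (j + 1) f ≠ 0) {a : ℂ} (hapos : 0 < a.im) :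
    ∃ m : ℝ, 0 < m ∧ m ≤ 1 ∧ ∀ w : ℂ, iteratedDeriv (j + 1) f w = 0 → w.im ≠ 0 →
      ‖w - (a.re : ℂ)‖ < a.im + m → NestedStep a w := by
  have hf : RealEntireLt2 f := realEntireLt2_of_hyps hE
  have hG'd : Differentiable ℂ (iteratedDeriv (j + 1) f) := differentiable_iteratedDeriv_of_entire hf.diff (j + 1)
  have hHs : 0 ≤ Hs := hE.2.2.2.2.2.2.2.1
  have hstrip : ∀ c : ℂ, iteratedDeriv (j + 1) f c = 0 → |c.im| ≤ Hs := fun c hc => abs_im_le_of_level hE hne hc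
  set L : ℝ := a.im + 2 with hL
  have hz₀ : ((a.re : ℂ)) ∈ Ioo (a.re - L) (a.re + L) ×ℂ Ioo (-(Hs + 1)) (Hs + 1) :=
    ofReal_mem_box (by rw [sub_self, abs_zero]; linarith) hHs
  have hfin := finite_zeros_box hG'd hne hz₀
  set T : Set ℂ := {w : ℂ | iteratedDeriv (j + 1) f w = 0 ∧ w ∈ Ioo (a.re - L) (a.re + L) ×ℂ Ioo (-(Hs + 1)) (Hs + 1)} ∩
    {w : ℂ | a.im < ‖w - (a.re : ℂ)‖} with hT
  have hTfin : T.Finite := hfin.inter_of_left _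
  have key : ∀ m : ℝ, m ≤ 1 → (∀ w ∈ T, m ≤ ‖w - (a.re : ℂ)‖ - a.im) →
      ∀ w : ℂ, iteratedDeriv (j + 1) f w = 0 → w.im ≠ 0 → ‖w - (a.re : ℂ)‖ < a.im + m → NestedStep a w := by
    intro m hm1 hmT w hw _ hlt
    have hle : ‖w - (a.re : ℂ)‖ ≤ a.im := by
      by_contra hgt
      rw [not_le] at hgt
      have hbox : w ∈ Ioo (a.re - L) (a.re + L) ×ℂ Ioo (-(Hs + 1)) (Hs + 1) := by
        have h1 := lt_of_le_of_lt (abs_re_le_norm (w - a.re)) hlt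
        rw [sub_re, ofReal_re, abs_lt] at h1
        have h2 := hstrip w hw
        rw [abs_le] at h2
        exact mem_reProdIm.2 ⟨⟨by linarith [h1.1], by linarith [h1.2]⟩, ⟨by linarith [h2.1], by linarith [h2.2]⟩⟩
      have h3 := hmT w ⟨⟨hw, hbox⟩, hgt⟩
      linarith
    have hsq : (w.re - a.re) ^ 2 + w.im ^ 2 = ‖w - (a.re : ℂ)‖ ^ 2 := by
      rw [Complex.sq_norm, Complex.normSq_apply, sub_re, ofReal_re, sub_im, ofReal_im, sub_zero]; ring
    show (w.re - a.re) ^ 2 + w.im ^ 2 ≤ a.im ^ 2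
    rw [hsq]
    exact pow_le_pow_left₀ (norm_nonneg _) hle 2
  by_cases hTe : T.Nonempty
  · obtain ⟨w₀, hw₀, hmin⟩ := Set.exists_min_image T (fun w => ‖w - (a.re : ℂ)‖ - a.im) hTfin hTe
    have h0 : 0 < ‖w₀ - (a.re : ℂ)‖ - a.im := by
      have h := hw₀.2
      simp only [mem_setOf_eq] at h
      linarith
    refine ⟨min (‖w₀ - (a.re : ℂ)‖ - a.im) 1, lt_min h0 one_pos, min_le_right _ _, key _ (min_le_right _ _) ?_⟩
    intro w hw
    exact (min_le_left _ _).trans (hmin w hw)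
  · exact ⟨1, one_pos, le_rfl, key 1 le_rfl fun w hw => absurd ⟨w, hw⟩ hTe⟩

/-! ## §2 RUNG 1: pinning from arc-sign clearance -/

/-- ★★★ RUNG 1 — PINNING FROM ARC-SIGN CLEARANCE (`m̃(a) = 0`).  On a legal frame, an upper zero `a` of `f^{(j)}` such that
`Im (f^{(j+1)}/f^{(j)}) < 0` on the upper half of every circle `|w − Re a| = Im a + δ`, `0 < δ < d₀`, has a NON-REAL zero of `f^{(j+1)}`
in its CLOSED Jensen disc or an NL event of level `j` in the CLOSED base — the literal conclusion of `RhW08.Lens1Pinning.TopPinning`.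
[Walsh, Ann. of Math. 22 (1920) §4 on `a`'s own circle; Kim, PAMS 124 (1996) Thm 1; tree: `RhW08.Lens1ArcSign.disc_census`,
`…JensenWindow.rolleIdentity_of_localB_core`, `RhW08.QuadW.nlEventOf_of_not_localB`.] -/
theorem pinning_of_arcSignClear {η : ℝ} {f : ℂ → ℂ} {x₀ s hmax R Hs : ℝ} {B : ℕ} (hE : EngineHyps5 2 η f x₀ s hmax R Hs B)
    {j : ℕ} {a : ℂ} (ha : iteratedDeriv j f a = 0) (hapos : 0 < a.im)
    (hsign : ∃ d0 > 0, ∀ δ ∈ Ioo 0 d0, ∀ w : ℂ, ‖w - (a.re : ℂ)‖ = a.im + δ → 0 < w.im →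
      (deriv (iteratedDeriv j f) w / iteratedDeriv j f w).im < 0) :
    (∃ w : ℂ, iteratedDeriv (j + 1) f w = 0 ∧ w.im ≠ 0 ∧ NestedStep a w) ∨ (∃ x : ℝ, |x - a.re| ≤ a.im ∧ NLEventOf f j x) := by
  classical
  have hf : RealEntireLt2 f := realEntireLt2_of_hyps hE
  obtain ⟨d0, hd0, hsg⟩ := hsign
  -- `f^{(j)} ≢ 0`: else the sign hypothesis fails at the top of the circle of radius `Im a + d₀/2`
  have hnz : iteratedDeriv j f ≠ 0 := by
    intro h0
    have hw : ‖((a.re : ℂ) + ((a.im + d0 / 2 : ℝ) : ℂ) * I) - (a.re : ℂ)‖ = a.im + d0 / 2 := by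
      rw [add_sub_cancel_left, norm_mul, Complex.norm_real, Complex.norm_I, mul_one, Real.norm_eq_abs,
        abs_of_pos (by linarith)]
    have hwim : ((a.re : ℂ) + ((a.im + d0 / 2 : ℝ) : ℂ) * I).im = a.im + d0 / 2 := by simp
    have h := hsg (d0 / 2) ⟨by linarith, by linarith⟩ _ hw (by rw [hwim]; linarith)
    rw [h0] at h
    simp at h
  set G : ℂ → ℂ := iteratedDeriv j f with hGdef
  have hG : RealEntireLt2 G :=
    { diff := differentiable_iteratedDeriv_of_entire hf.diff j
      growth := by
        obtain ⟨ρ, C, hρ0, hρ, hgr⟩ := hf.growth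
        obtain ⟨ρ', C', h1, h2, h3⟩ := exists_growth_iteratedDeriv hf.diff hρ0 hρ hgr j
        exact ⟨ρ', C', h1, h2, h3⟩
      real := im_iteratedDeriv_ofReal hf.diff hf.real j }
  have hGreal : ∀ z : ℂ, G (conj z) = conj (G z) := apply_conj_eq_conj hG.diff hG.real
  have hdreal : ∀ x : ℝ, (deriv G x).im = 0 := im_deriv_ofReal hG.diff hG.real
  have e1 : deriv G = iteratedDeriv (j + 1) f := by rw [hGdef, ← iteratedDeriv_succ]
  have hHs : 0 ≤ Hs := hE.2.2.2.2.2.2.2.1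
  have hG'ne : iteratedDeriv (j + 1) f ≠ 0 := iteratedDeriv_succ_ne_zero_of_zero hf.diff j hnz ha
  have hG'd : Differentiable ℂ (iteratedDeriv (j + 1) f) := differentiable_iteratedDeriv_of_entire hf.diff (j + 1)
  by_contra hcon
  push Not at hcon
  obtain ⟨hnoC, hnoNL⟩ := hcon
  -- the NL margin `m` and the child margin `m′`
  obtain ⟨m, hm0, hm1, hmarg⟩ := exists_nl_margin hf hG'ne hapos (a := a)
  obtain ⟨m', hm'0, hm'1, hchild⟩ := exists_child_margin hE hG'ne hapos (a := a)
  set δ₀ : ℝ := min d0 (min m m') with hδ₀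
  have hδ₀0 : 0 < δ₀ := lt_min hd0 (lt_min hm0 hm'0)
  -- a GENERIC `δ ∈ (0, δ₀)`: the feet `Re a ± (Im a + δ)` miss the finitely many zeros of `G`, `G′` in the box
  set L : ℝ := a.im + Hs + 2 with hL
  have hz₀ : ((a.re : ℂ)) ∈ Ioo (a.re - L) (a.re + L) ×ℂ Ioo (-(Hs + 1)) (Hs + 1) :=
    ofReal_mem_box (by rw [sub_self, abs_zero]; linarith) hHs
  set Z : Set ℂ := {ρ : ℂ | G ρ = 0 ∧ ρ ∈ Ioo (a.re - L) (a.re + L) ×ℂ Ioo (-(Hs + 1)) (Hs + 1)} ∪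
    {ρ : ℂ | iteratedDeriv (j + 1) f ρ = 0 ∧ ρ ∈ Ioo (a.re - L) (a.re + L) ×ℂ Ioo (-(Hs + 1)) (Hs + 1)} with hZ
  have hZfin : Z.Finite := (finite_zeros_box hG.diff hnz hz₀).union (finite_zeros_box hG'd hG'ne hz₀)
  let cp : ℝ → ℂ := fun ε => ((a.re + (a.im + ε) : ℝ) : ℂ)
  let cm : ℝ → ℂ := fun ε => ((a.re - (a.im + ε) : ℝ) : ℂ)
  have hcp : Set.InjOn cp (cp ⁻¹' Z) := fun x _ y _ h => by
    have h' : a.re + (a.im + x) = a.re + (a.im + y) := Complex.ofReal_inj.mp h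
    linarith
  have hcm : Set.InjOn cm (cm ⁻¹' Z) := fun x _ y _ h => by
    have h' : a.re - (a.im + x) = a.re - (a.im + y) := Complex.ofReal_inj.mp h
    linarith
  have hbad : (cp ⁻¹' Z ∪ cm ⁻¹' Z).Finite := (hZfin.preimage hcp).union (hZfin.preimage hcm)
  obtain ⟨δ, hδI, hδbad⟩ := ((Set.Ioo_infinite hδ₀0).sdiff hbad).nonempty
  obtain ⟨hδ0, hδ1⟩ := hδI
  have hδd0 : δ < d0 := lt_of_lt_of_le hδ1 (min_le_left _ _)
  have hδm : δ < m := lt_of_lt_of_le hδ1 ((min_le_right _ _).trans (min_le_left _ _))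
  have hδm' : δ < m' := lt_of_lt_of_le hδ1 ((min_le_right _ _).trans (min_le_right _ _))
  have hr : 0 < a.im + δ := by linarith
  have hβmem : cp δ ∈ Ioo (a.re - L) (a.re + L) ×ℂ Ioo (-(Hs + 1)) (Hs + 1) :=
    ofReal_mem_box (by rw [show a.re + (a.im + δ) - a.re = a.im + δ by ring, abs_of_pos hr]; linarith) hHs
  have hαmem : cm δ ∈ Ioo (a.re - L) (a.re + L) ×ℂ Ioo (-(Hs + 1)) (Hs + 1) :=
    ofReal_mem_box (by rw [show a.re - (a.im + δ) - a.re = -(a.im + δ) by ring, abs_neg, abs_of_pos hr]; linarith) hHs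
  have hGβ : G (cp δ) ≠ 0 := fun h0 => hδbad (Or.inl (Or.inl ⟨h0, hβmem⟩))
  have hG'β : iteratedDeriv (j + 1) f (cp δ) ≠ 0 := fun h0 => hδbad (Or.inl (Or.inr ⟨h0, hβmem⟩))
  have hGα : G (cm δ) ≠ 0 := fun h0 => hδbad (Or.inr (Or.inl ⟨h0, hαmem⟩))
  have hG'α : iteratedDeriv (j + 1) f (cm δ) ≠ 0 := fun h0 => hδbad (Or.inr (Or.inr ⟨h0, hαmem⟩))
  -- the symmetric circle sign for `G` (lower half by conjugation)
  have hsgn : ∀ w : ℂ, ‖w - ((a.re : ℝ) : ℂ)‖ = a.im + δ → w.im ≠ 0 → w.im * (deriv G w / G w).im < 0 := by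
    intro w hw hwim
    rcases lt_or_gt_of_ne hwim with hneg | hpos
    · have hw' : ‖conj w - (a.re : ℂ)‖ = a.im + δ := by
        have e : conj w - (a.re : ℂ) = conj (w - (a.re : ℂ)) := by simp [map_sub]
        rw [e, Complex.norm_conj]; exact hw
      have hpos' : 0 < (conj w).im := by rw [Complex.conj_im]; linarith
      have h := hsg δ ⟨hδ0, hδd0⟩ (conj w) hw' hpos'
      rw [apply_conj_eq_conj hG.diff.deriv hdreal w, hGreal w, ← map_div₀, Complex.conj_im] at h
      exact mul_neg_of_neg_of_pos hneg (by linarith)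
    · exact mul_neg_of_pos_of_neg hpos (hsg δ ⟨hδ0, hδd0⟩ w hw hpos)
  -- the base: local Laguerre law B, or an NL event within the margin
  by_cases hB : LocalB G (a.re - (a.im + δ)) (a.re + (a.im + δ))
  swap
  · obtain ⟨x, hx, hNL⟩ := nlEventOf_of_not_localB hf j hB
    have hxa : |x - a.re| < a.im + m := by rw [abs_lt]; constructor <;> linarith [hx.1, hx.2]
    exact hnoNL x (hmarg x hNL hxa) hNL
  -- the real Rolle identity on the base (trivial sign window: only the feet data are used)
  have hW : SWindow G (fun _ => True) (a.re - (a.im + δ)) (a.re + (a.im + δ)) (a.im + δ) :=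
    ⟨by linarith, hr, fun _ _ => trivial, fun _ _ => trivial, fun _ _ _ => trivial, fun _ _ _ => trivial,
      hGα, hGβ, by rw [e1]; exact hG'α, by rw [e1]; exact hG'β⟩
  have hRolle : RolleIdentity G (a.re - (a.im + δ)) (a.re + (a.im + δ)) (a.im + δ) :=
    rolleIdentity_of_localB_core hG.diff hG.real hW hB
  -- every critical point in the open disc is real — else it is a `NestedStep` child (excluded)
  have hA : ∀ ρ ∈ ball ((a.re : ℝ) : ℂ) (a.im + δ), deriv G ρ = 0 → ρ.im = 0 := by
    intro ρ hρ hdρ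
    by_contra hρim
    have hρ' : ‖ρ - (a.re : ℂ)‖ < a.im + m' := by
      rw [mem_ball, dist_eq_norm] at hρ; linarith
    have hdρ' : iteratedDeriv (j + 1) f ρ = 0 := by rw [← e1]; exact hdρ
    exact hnoC ρ hdρ' hρim (hchild ρ hdρ' hρim hρ')
  -- the disc Rolle closure: every zero of `G` in the disc is real — but `a` is one
  have hall := no_nonreal_zero_of_disc hG.diff hG.real hr hGα hGβ (by rw [e1]; exact hG'α) (by rw [e1]; exact hG'β)
    hsgn hA hRolle
  have haball : a ∈ ball ((a.re : ℝ) : ℂ) (a.im + δ) := by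
    rw [mem_ball, dist_eq_norm]
    have e : a - (a.re : ℂ) = ((a.im : ℝ) : ℂ) * I := Complex.ext (by simp) (by simp)
    rw [e, norm_mul, Complex.norm_real, Complex.norm_I, mul_one, Real.norm_eq_abs, abs_of_pos hapos]
    linarith
  exact absurd (hall a haball ha) hapos.ne'

/-! ## §3 Arc-sign clearance as a `Prop`; Jensen isolation is a special case -/

/-- ARC-SIGN CLEARANCE of the upper zero `a` of `f^{(j)}` (`m̃(a) = 0`): for all small `δ > 0`, `Im (f^{(j+1)}/f^{(j)}) < 0` on the
upper half of the circle `|w − Re a| = Im a + δ`. -/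
def ArcSignClear (f : ℂ → ℂ) (j : ℕ) (a : ℂ) : Prop :=
  ∃ d0 > 0, ∀ δ ∈ Ioo 0 d0, ∀ w : ℂ, ‖w - (a.re : ℂ)‖ = a.im + δ → 0 < w.im →
    (deriv (iteratedDeriv j f) w / iteratedDeriv j f w).im < 0

/-- ★ `TopPinning` IN THE ARC-SIGN-CLEAR CASE (literal conclusion of the law; no `NoTallerToucher` needed). -/
theorem topPinning_case_arcSignClear {η : ℝ} {f : ℂ → ℂ} {x₀ s hmax R Hs : ℝ} {B : ℕ} (hE : EngineHyps5 2 η f x₀ s hmax R Hs B)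
    {j : ℕ} {a : ℂ} (ha : iteratedDeriv j f a = 0) (hapos : 0 < a.im) (hS : ArcSignClear f j a) :
    (∃ w : ℂ, iteratedDeriv (j + 1) f w = 0 ∧ w.im ≠ 0 ∧ NestedStep a w) ∨ (∃ x : ℝ, |x - a.re| ≤ a.im ∧ NLEventOf f j x) :=
  pinning_of_arcSignClear hE ha hapos hS

/-- ★ JENSEN-ISOLATED ⇒ ARC-SIGN CLEAR: every point of a circle `|w − Re a| = Im a + δ`, `0 < δ < g` (`g` the uniform far gap of
`RhW08.Lens1PinningIso.exists_uniform_far_gap`), is Jensen-clear for `f^{(j)}`, so the Jensen–Nagy sign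
`…JensenWindow.im_mul_im_logDeriv_neg` gives `Im (f^{(j+1)}/f^{(j)}) < 0` on its upper half. -/
theorem arcSignClear_of_jensenIsolated {η : ℝ} {f : ℂ → ℂ} {x₀ s hmax R Hs : ℝ} {B : ℕ} (hE : EngineHyps5 2 η f x₀ s hmax R Hs B)
    {j : ℕ} {a : ℂ} (ha : iteratedDeriv j f a = 0) (hapos : 0 < a.im) (hJ : JensenIsolated f j a) : ArcSignClear f j a := by
  classical
  have hf : RealEntireLt2 f := realEntireLt2_of_hyps hE
  have hnz : iteratedDeriv j f ≠ 0 := ne_zero_of_jensenIsolated hapos hJ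
  set G : ℂ → ℂ := iteratedDeriv j f with hGdef
  have hG : RealEntireLt2 G :=
    { diff := differentiable_iteratedDeriv_of_entire hf.diff j
      growth := by
        obtain ⟨ρ, C, hρ0, hρ, hgr⟩ := hf.growth
        obtain ⟨ρ', C', h1, h2, h3⟩ := exists_growth_iteratedDeriv hf.diff hρ0 hρ hgr j
        exact ⟨ρ', C', h1, h2, h3⟩
      real := im_iteratedDeriv_ofReal hf.diff hf.real j }
  have hGreal : ∀ z : ℂ, G (conj z) = conj (G z) := apply_conj_eq_conj hG.diff hG.real
  have hstrip : ∀ c : ℂ, G c = 0 → |c.im| ≤ Hs := fun c hc => abs_im_le_of_level hE hnz hc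
  have haHs : a.im ≤ Hs := by have h := hstrip a ha; rwa [abs_of_pos hapos] at h
  obtain ⟨g, hg0, -, hgap⟩ := exists_uniform_far_gap hG.diff hnz hstrip hapos haHs
  obtain ⟨ρ, C, hρ0, hρ, hgr⟩ := hG.growth
  refine ⟨g, hg0, fun δ hδ w hw hwpos => ?_⟩
  have hclear : JensenClear G w := by
    intro c hc hcim
    obtain ⟨c', hc', hc'pos, hc're, hc'im⟩ : ∃ c' : ℂ, G c' = 0 ∧ 0 < c'.im ∧ c'.re = c.re ∧ c'.im = |c.im| := by
      rcases lt_or_gt_of_ne hcim with hneg | hpos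
      · refine ⟨conj c, by rw [hGreal, hc, map_zero], by simpa using hneg, by simp, ?_⟩
        rw [Complex.conj_im, abs_of_neg hneg]
      · exact ⟨c, hc, hpos, rfl, (abs_of_pos hpos).symm⟩
    have htri1 : ‖w - (a.re : ℂ)‖ ≤ ‖w - (c.re : ℂ)‖ + |a.re - c.re| := by
      have h := norm_sub_le (w - (c.re : ℂ)) ((a.re : ℂ) - (c.re : ℂ))
      rw [sub_sub_sub_cancel_right, ← ofReal_sub, Complex.norm_real, Real.norm_eq_abs] at h
      exact h
    have htri2 : |a.re - c.re| ≤ ‖w - (c.re : ℂ)‖ + ‖w - (a.re : ℂ)‖ := by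
      have h := norm_sub_le (w - (c.re : ℂ)) (w - (a.re : ℂ))
      rw [sub_sub_sub_cancel_left, ← ofReal_sub, Complex.norm_real, Real.norm_eq_abs] at h
      exact h
    by_cases hca : c' = a
    · have hre : c.re = a.re := by rw [← hc're, hca]
      have him : |c.im| = a.im := by rw [← hc'im, hca]
      rw [him, hre, hw]
      linarith [hδ.1]
    · rcases hJ c' hc' hc'pos hca with hfar | hnest
      · rw [hc're, hc'im] at hfar
        have hg' := hgap c hc hfar
        rw [hw] at htri2
        linarith [hδ.2]
      · rw [hc're, hc'im] at hnest
        rw [hw] at htri1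
        linarith [hδ.1]
  have h := im_mul_im_logDeriv_neg hG.diff hρ0 hρ hgr hG.real ⟨a, ha⟩ hwpos.ne' hclear
  rcases mul_neg_iff.mp h with h' | h'
  · exact h'.2
  · exact absurd h'.1 (not_lt.mpr hwpos.le)

/-- SUBSUMPTION: the (3p)″ rung `RhW08.Lens1PinningIso.pinning_of_jensenIsolated'` is the Jensen-isolated instance of RUNG 1. -/
theorem pinning_of_jensenIsolated_via_arcSign {η : ℝ} {f : ℂ → ℂ} {x₀ s hmax R Hs : ℝ} {B : ℕ}
    (hE : EngineHyps5 2 η f x₀ s hmax R Hs B) {j : ℕ} {a : ℂ} (ha : iteratedDeriv j f a = 0) (hapos : 0 < a.im)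
    (hJ : JensenIsolated f j a) :
    (∃ w : ℂ, iteratedDeriv (j + 1) f w = 0 ∧ w.im ≠ 0 ∧ NestedStep a w) ∨ (∃ x : ℝ, |x - a.re| ≤ a.im ∧ NLEventOf f j x) :=
  pinning_of_arcSignClear hE ha hapos (arcSignClear_of_jensenIsolated hE ha hapos hJ)

/-! ## §4 The typed residual after RUNG 1 -/

/-- The ARC residual of the law: `TopPinning` restricted to zeros that are NEITHER Jensen-isolated NOR arc-sign clear (crossing
lower-or-equal mates with `m̃(a) ≥ 1`: `f^{(j+1)}/f^{(j)}` takes a real value on the upper half of arbitrarily small Jensen circles).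
OPEN statement. -/
def TopPinningArcResidual : Prop :=
  ∀ (η : ℝ) (f : ℂ → ℂ) (x₀ s hmax R Hs : ℝ) (B : ℕ), EngineHyps5 2 η f x₀ s hmax R Hs B → ∀ (j : ℕ) (a : ℂ),
    iteratedDeriv j f a = 0 → 0 < a.im → NoTallerToucher f j a → ¬ JensenIsolated f j a → ¬ ArcSignClear f j a →
    (∃ w : ℂ, iteratedDeriv (j + 1) f w = 0 ∧ w.im ≠ 0 ∧ NestedStep a w) ∨ (∃ x : ℝ, |x - a.re| ≤ a.im ∧ NLEventOf f j x)

/-- ★ EXACT SPLIT: the crossing residual follows from the arc residual (RUNG 1 discharges the arc-sign-clear crossing frames). -/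
theorem topPinningCrossing_of_arcResidual (hA : TopPinningArcResidual) : TopPinningCrossing := by
  intro η f x₀ s hmax R Hs B hE j a ha hapos hN hJ
  by_cases hS : ArcSignClear f j a
  · exact pinning_of_arcSignClear hE ha hapos hS
  · exact hA η f x₀ s hmax R Hs B hE j a ha hapos hN hJ hS

/-- ★ The law from the arc residual. -/
theorem topPinning_of_arcResidual (hA : TopPinningArcResidual) : TopPinning :=
  topPinning_of_crossing (topPinningCrossing_of_arcResidual hA)

/-- Converse (bookkeeping): the split is exact. -/
theorem arcResidual_of_topPinning (hP : TopPinning) : TopPinningArcResidual :=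
  fun η f x₀ s hmax R Hs B hE j a ha hapos hN _ _ => hP η f x₀ s hmax R Hs B hE j a ha hapos hN

end RhW08.Lens1ArcSign


-- ======== ArcSignC-v1 0d1440895792712f (import lines stripped) ========

/-!
# TiltedLandingLaw421R3 — lens-1 (O6-c, director-rh g24): RUNG 2 of the arc-sign ladder TYPED — `NoAscendingArc` (part C, statements + exact split)

LENS-1 gen-6 module image `rh33346-cover/lens-1/ArcSignC-v1.lean` (landing target `…/Theorems/TiltedLandingLaw421R3Lens1ArcSignC.lean`; single import =
part B `…R3Lens1ArcSignB`; namespace `RhW08.Lens1ArcSign`; 0 `sorry`, no instances / notation; checked BY CHAIN over the ArcSign A/B images until tree).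

WHY (memo `rh33346-cover/lens-1/O6b-MULTIARC-MEMO-v1.md` 85f61bb8): cut `a`ʼs upper Jensen semicircle of radius `Im a + δ` (ccw from the right foot)
at the points where `φ := f^{(j+1)}/f^{(j)}` is REAL.  With `s_0 = sgn φ(right foot)`, `s_i = sgn φ(w_i)`, `s_{m̃+1} = sgn φ(left foot)` and `ε_i = ±1`
the sign of `Im φ` on sub-arc `i`:  (ARC) `2k = Σ_i ε_i (s_i − s_{i+1})` (topological — `log_increment_eq` per sub-arc, conjugation for the lower half),
and with the argument principle and the real Rolle identity (PIN) `ch = 1 + pz − #asc + #desc`: the number of upper zeros of `f^{(j+1)}` in the disc is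
one, plus the foreign upper zeros of `f^{(j)}` inside, minus the ASCENDING bad arcs (`Im φ > 0` inside, `φ` from a negative to a positive real value),
plus the DESCENDING ones.  So the law holds whenever NO BAD ARC IS ASCENDING — for every `m̃` and any number of crossing mates.  That is RUNG 2.

CONTENT: §1 `arcPhi` (φ along the parametrised circle), `NoAscendingArc f j a δ`, `ArcNoAsc f j a` (:= for all small `δ`), ★ `PinningOfNoAscendingArc`
(RUNG 2 as a `Prop`; OPEN this image — its proof is part D: finiteness of the break points + the partition version of `two_mul_wind_eq` + the count),
`noAscendingArc_of_im_neg`, ★ `arcNoAsc_of_arcSignClear` (RUNG 1ʼs hypothesis ⇒ RUNG 2ʼs: no bad arc at all).  §2 the typed residual after RUNG 2,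
`TopPinningAscResidual` (crossing mates, not arc-sign clear, AND an ascending bad arc on arbitrarily small circles) with the exact split
`arcResidual_of_rung2` : `PinningOfNoAscendingArc → TopPinningAscResidual → TopPinningArcResidual`, hence `topPinning_of_rung2`; converse
`ascResidual_of_topPinning`.  Conjecture ASC-PAY (memo §3: every ascending arc is paid by an interior foreign upper zero) is NOT typed here.

HONEST LABEL: statements and bookkeeping only; `PinningOfNoAscendingArc` (RUNG 2), `TopPinningAscResidual`, `TopPinningArcResidual`, `TopPinning`,
`TopPinningCrossing`, `RegUmbrella11S`, 33346, 33347 are OPEN; nothing here bears on the truth of RH; RH is not proved; checked ≠ proved.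
-/

noncomputable section

namespace RhW08.Lens1ArcSign

open Complex Set Metric
open Literature.Topology.PlaneTopology Literature.Analysis.Complex
open Summit.RiemannHypothesis.RiemannHypothesis.Theorems.Splittings.JensenWindow
open RhIdea6.G17.W07C7 RhIdea6.G17.W07C7.Rev6 RhIdea6.G18.W07C8.Law421BirthS RhIdea6.G19.W07C11.Seam
open RhIdea6.G20.W07C12.Frac RhIdea6.G20.W07C12.StColP RhW07.C12.FieldSplit RhIdea6.G21.W07C13.TentMax
open RhW07.C14.TwoSided RhW07.C14.Classes RhW07.C14.Lineage RhW07.C14.Booking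
open RhW07.C13.Heredity RhIdea6.G22.W07C15pre.Injection RhW07.E3.Cell RhW07.E3.Lit
open RhW08.Round1 RhW08.StSwap RhW08.Round2 RhW08.QuadW RhW08.SealSwapQ RhW08.SealSwap RhW08.SuccB RhW08.SuccSplit
open RhW08.SuccTheft RhW08.Column RhW08.Hurwitz RhW08.ClusterQ RhW08.ClusterQM RhW08.NewtonDoor RhW08.NewtonDoorGenusOne RhW08.PurseP
open RhW08.Lens1SignCut RhW08.Lens1Coverage RhW08.IsolatedTilt RhW08.Lens1Pinning RhW08.Lens1PinningIso

/-! ## §1 RUNG 2 typed: no ascending bad arc -/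

/-- `φ = f^{(j+1)}/f^{(j)}` along `a`ʼs Jensen circle of radius `Im a + δ`, parametrised by `…PlaneTopology.circleLoop` (`t ∈ [0, ½]` = the upper
semicircle, counterclockwise from the right foot `t = 0` to the left foot `t = ½`). -/
def arcPhi (f : ℂ → ℂ) (j : ℕ) (a : ℂ) (δ t : ℝ) : ℂ :=
  deriv (iteratedDeriv j f) (circleLoop (a.re : ℂ) (a.im + δ) t) / iteratedDeriv j f (circleLoop (a.re : ℂ) (a.im + δ) t)

/-- NO ASCENDING BAD ARC on the circle of radius `Im a + δ`: on every sub-arc `(t₁, t₂) ⊆ [0, ½]` of the upper semicircle on which `Im φ > 0`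
(a BAD arc) and at whose ends `φ` is real, `φ` does NOT pass from a negative real value (at the earlier end `t₁`) to a positive one (at `t₂`). -/
def NoAscendingArc (f : ℂ → ℂ) (j : ℕ) (a : ℂ) (δ : ℝ) : Prop :=
  ∀ t₁ t₂ : ℝ, 0 ≤ t₁ → t₁ < t₂ → t₂ ≤ 1 / 2 →
    (∀ t ∈ Ioo t₁ t₂, 0 < (arcPhi f j a δ t).im) → (arcPhi f j a δ t₁).im = 0 → (arcPhi f j a δ t₂).im = 0 →
    ¬ ((arcPhi f j a δ t₁).re < 0 ∧ 0 < (arcPhi f j a δ t₂).re)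

/-- `ArcNoAsc f j a`: all small Jensen circles of `a` have no ascending bad arc. -/
def ArcNoAsc (f : ℂ → ℂ) (j : ℕ) (a : ℂ) : Prop :=
  ∃ d0 > 0, ∀ δ ∈ Ioo 0 d0, NoAscendingArc f j a δ

/-- ★ RUNG 2 (STATEMENT; OPEN in this image): on a legal frame, an upper zero `a` of `f^{(j)}` whose small Jensen circles carry no ascending bad arc
satisfies the literal `TopPinning` disjunction.  By (PIN) `ch = 1 + pz − #asc + #desc ≥ 1` this is argument-principle bookkeeping, not a conjecture;
its Lean proof (part D) needs the finiteness of the break points and the partition version of `two_mul_wind_eq`. -/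
def PinningOfNoAscendingArc : Prop :=
  ∀ (η : ℝ) (f : ℂ → ℂ) (x₀ s hmax R Hs : ℝ) (B : ℕ), EngineHyps5 2 η f x₀ s hmax R Hs B → ∀ (j : ℕ) (a : ℂ),
    iteratedDeriv j f a = 0 → 0 < a.im → ArcNoAsc f j a →
    (∃ w : ℂ, iteratedDeriv (j + 1) f w = 0 ∧ w.im ≠ 0 ∧ NestedStep a w) ∨ (∃ x : ℝ, |x - a.re| ≤ a.im ∧ NLEventOf f j x)

/-- No bad arc at all ⇒ no ascending bad arc. -/
theorem noAscendingArc_of_im_neg {f : ℂ → ℂ} {j : ℕ} {a : ℂ} {δ : ℝ} (h : ∀ t ∈ Ioo (0 : ℝ) (1 / 2), (arcPhi f j a δ t).im < 0) :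
    NoAscendingArc f j a δ := by
  intro t₁ t₂ h₁ h12 h₂ hbad _ _ _
  have hmid : (t₁ + t₂) / 2 ∈ Ioo t₁ t₂ := ⟨by linarith, by linarith⟩
  have h0 : (t₁ + t₂) / 2 ∈ Ioo (0 : ℝ) (1 / 2) := ⟨by linarith, by linarith⟩
  exact absurd (hbad _ hmid) (not_lt.mpr (h _ h0).le)

/-- ★ RUNG 1ʼs hypothesis implies RUNG 2ʼs: an arc-sign-clear zero has no bad arc, hence no ascending one. -/
theorem arcNoAsc_of_arcSignClear {f : ℂ → ℂ} {j : ℕ} {a : ℂ} (hapos : 0 < a.im) (hS : ArcSignClear f j a) : ArcNoAsc f j a := by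
  obtain ⟨d0, hd0, hsg⟩ := hS
  refine ⟨d0, hd0, fun δ hδ => noAscendingArc_of_im_neg fun t ht => ?_⟩
  have hr : 0 < a.im + δ := by linarith [hδ.1]
  have hw : ‖circleLoop ((a.re : ℝ) : ℂ) (a.im + δ) t - (a.re : ℂ)‖ = a.im + δ := by
    rw [norm_circleLoop_sub_center, abs_of_pos hr]
  have hwim : 0 < (circleLoop ((a.re : ℝ) : ℂ) (a.im + δ) t).im := by
    rw [circleLoop_ofReal_im]
    refine mul_pos hr (Real.sin_pos_of_pos_of_lt_pi ?_ ?_)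
    · have := ht.1; positivity
    · have h2 := ht.2
      nlinarith [Real.pi_pos]
  exact hsg δ hδ _ hw hwim

/-! ## §2 The typed residual after RUNG 2 and the exact split -/

/-- The ASCENDING residual of the law: `TopPinning` restricted to zeros with crossing mates that are not arc-sign clear AND whose Jensen circles of
arbitrarily small radius excess carry an ascending bad arc (`¬ ArcNoAsc`).  OPEN statement; conjecture ASC-PAY (memo §3) would discharge it. -/
def TopPinningAscResidual : Prop :=
  ∀ (η : ℝ) (f : ℂ → ℂ) (x₀ s hmax R Hs : ℝ) (B : ℕ), EngineHyps5 2 η f x₀ s hmax R Hs B → ∀ (j : ℕ) (a : ℂ),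
    iteratedDeriv j f a = 0 → 0 < a.im → NoTallerToucher f j a → ¬ JensenIsolated f j a → ¬ ArcSignClear f j a → ¬ ArcNoAsc f j a →
    (∃ w : ℂ, iteratedDeriv (j + 1) f w = 0 ∧ w.im ≠ 0 ∧ NestedStep a w) ∨ (∃ x : ℝ, |x - a.re| ≤ a.im ∧ NLEventOf f j x)

/-- ★ EXACT SPLIT: RUNG 2 and the ascending residual give the arc residual. -/
theorem arcResidual_of_rung2 (h2 : PinningOfNoAscendingArc) (h3 : TopPinningAscResidual) : TopPinningArcResidual := by
  intro η f x₀ s hmax R Hs B hE j a ha hapos hN hJ hS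
  by_cases hA : ArcNoAsc f j a
  · exact h2 η f x₀ s hmax R Hs B hE j a ha hapos hA
  · exact h3 η f x₀ s hmax R Hs B hE j a ha hapos hN hJ hS hA

/-- ★ The law from RUNG 2 and the ascending residual. -/
theorem topPinning_of_rung2 (h2 : PinningOfNoAscendingArc) (h3 : TopPinningAscResidual) : TopPinning :=
  topPinning_of_arcResidual (arcResidual_of_rung2 h2 h3)

/-- Converse (bookkeeping): the split is exact. -/
theorem ascResidual_of_topPinning (hP : TopPinning) : TopPinningAscResidual :=
  fun η f x₀ s hmax R Hs B hE j a ha hapos hN _ _ _ => hP η f x₀ s hmax R Hs B hE j a ha hapos hN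

/-- RUNG 2 alone already gives every RUNG-1 instance (no appeal to `pinning_of_arcSignClear`). -/
theorem rung1_of_rung2 (h2 : PinningOfNoAscendingArc) {η : ℝ} {f : ℂ → ℂ} {x₀ s hmax R Hs : ℝ} {B : ℕ}
    (hE : EngineHyps5 2 η f x₀ s hmax R Hs B) {j : ℕ} {a : ℂ} (ha : iteratedDeriv j f a = 0) (hapos : 0 < a.im) (hS : ArcSignClear f j a) :
    (∃ w : ℂ, iteratedDeriv (j + 1) f w = 0 ∧ w.im ≠ 0 ∧ NestedStep a w) ∨ (∃ x : ℝ, |x - a.re| ≤ a.im ∧ NLEventOf f j x) :=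
  h2 η f x₀ s hmax R Hs B hE j a ha hapos (arcNoAsc_of_arcSignClear hapos hS)

end RhW08.Lens1ArcSign


-- ======== ArcSignD-v1 dbe9788f3625ac65 (import lines stripped) ========

/-!
# TiltedLandingLaw421R3 — lens-1: RUNG 2 of the arc-sign ladder, part D — the partition loop inequality (multi-arc bookkeeping)

LENS-1 gen-6 module image `rh33346-cover/lens-1/ArcSignD-v1.lean` (landing target `…/Theorems/TiltedLandingLaw421R3Lens1ArcSignD.lean`; single import =
part C; namespace `RhW08.Lens1ArcSign`; 0 `sorry`, no instances / notation; checked BY CHAIN over the ArcSign A/B/C images until tree).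

THE MULTI-ARC IDENTITY AS AN INEQUALITY (memo `O6b-MULTIARC-MEMO-v1.md` §2, NODE v14 P8-R2).  Along the upper half `[0, ½]` of a loop `Γ` (later
`Γ = (f^{(j+1)}/f^{(j)}) ∘ circleLoop`), cut at the points where `Γ` is REAL, the POTENTIAL `Q(t) := Im l(t) − (π/2)·σ(t)` (`l` a continuous
logarithm, `σ = ±1` the sign of `Re Γ` at a real point) is CONSTANT across a good piece (`Im Γ ≤ 0`, rotate by `i`: `log_increment_eq`) and changes
by `π(σ_start − σ_end) ∈ {0, ±2π}` across a bad piece (`Im Γ ≥ 0`, rotate by `−i`) — negative exactly for an ASCENDING bad piece.  Hence, with no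
ascending bad piece, `Im (l(½) − l(0)) ≥ (π/2)(σ(½) − σ(0))` (§3, by induction along the finitely many real points), and for a conjugation-symmetric
loop `2·wind Γ = sgn Re Γ(½) − sgn Re Γ(0) + n`, `n ∈ ℕ` (§4) — the `m̃ = 0` lemma `two_mul_wind_eq` is the case of no bad piece.  §5 supplies the
finiteness of the real points for `Γ = (G′/G) ∘ circleLoop` (real-analytic in `t`; identity theorem: finitely many, or `Γ` real on the whole arc).

CONTENT: §1 `zsgn`, `sgn_eq_zsgn`, `im_log_I_mul`, `im_log_negI_mul` · §2 `im_incr_piece_down`, `im_incr_piece_up` · §3 `pos_or_neg_of_ne_zero`,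
★ `im_incr_ge_of_noAsc` · §4 ★ `two_mul_wind_ge` · §5 `circleLoop_one_sub`, `analyticAt_im_logDeriv_circleLoop`, ★ `breaks_finite_or_flat`.

HONEST LABEL: loop / analytic bookkeeping only; RUNG 2 (`PinningOfNoAscendingArc`) is proved in part E from these; `TopPinning`, 33346, 33347 OPEN;
nothing here bears on the truth of RH; RH is not proved; checked ≠ proved.
-/

noncomputable section

namespace RhW08.Lens1ArcSign

open Complex Set Metric Filter Topology
open scoped Real
open Literature.Topology.PlaneTopology Literature.Analysis.Complex
open Summit.RiemannHypothesis.RiemannHypothesis.Theorems.Splittings.JensenWindow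

/-! ## §1 Integer signs and `Im log (±i x)` -/

/-- Integer sign: `1` for `r > 0`, `−1` otherwise (used at `r ≠ 0`); the tree's `sgn r` is its cast. -/
def zsgn (r : ℝ) : ℤ := if 0 < r then 1 else -1

/-- `sgn = zsgn` in `ℂ`. -/
theorem sgn_eq_zsgn (r : ℝ) : sgn r = ((zsgn r : ℤ) : ℂ) := by
  unfold sgn zsgn
  split_ifs <;> simp

/-- `Im log (i x) = (π/2)·zsgn x` for real `x ≠ 0`. -/
theorem im_log_I_mul {r : ℝ} (hr : r ≠ 0) : (log (I * r)).im = π / 2 * (zsgn r : ℝ) := by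
  unfold zsgn
  split_ifs with h
  · rw [show I * (r : ℂ) = (r : ℂ) * I by ring, Complex.log_im, Complex.arg_real_mul I h, Complex.arg_I]
    push_cast; ring
  · have h' : 0 < -r := by
      rcases lt_or_gt_of_ne hr with h1 | h1
      · linarith
      · exact absurd h1 h
    rw [show I * (r : ℂ) = ((-r : ℝ) : ℂ) * (-I) by push_cast; ring, Complex.log_im, Complex.arg_real_mul (-I) h',
      Complex.arg_neg_I]
    push_cast; ring

/-- `Im log (−i x) = −(π/2)·zsgn x` for real `x ≠ 0`. -/
theorem im_log_negI_mul {r : ℝ} (hr : r ≠ 0) : (log (-I * r)).im = -(π / 2) * (zsgn r : ℝ) := by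
  unfold zsgn
  split_ifs with h
  · rw [show -I * (r : ℂ) = (r : ℂ) * (-I) by ring, Complex.log_im, Complex.arg_real_mul (-I) h, Complex.arg_neg_I]
    push_cast; ring
  · have h' : 0 < -r := by
      rcases lt_or_gt_of_ne hr with h1 | h1
      · linarith
      · exact absurd h1 h
    rw [show -I * (r : ℂ) = ((-r : ℝ) : ℂ) * I by push_cast; ring, Complex.log_im, Complex.arg_real_mul I h', Complex.arg_I]
    push_cast; ring

/-! ## §2 The two kinds of piece -/

/-- GOOD PIECE: `Im Γ ≤ 0` on `[u, v]`, real non-zero ends ⇒ every continuous logarithm gains `(π/2)(σ(v) − σ(u))` in imaginary part. -/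
theorem im_incr_piece_down {Γ l : ℝ → ℂ} {u v : ℝ} (huv : u ≤ v) (hΓ : ContinuousOn Γ (Icc u v)) (hl : ContinuousOn l (Icc u v))
    (hexp : ∀ t ∈ Icc u v, exp (l t) = Γ t) (hne : ∀ t ∈ Icc u v, Γ t ≠ 0) (hdown : ∀ t ∈ Icc u v, (Γ t).im ≤ 0)
    (hu : (Γ u).im = 0) (hv : (Γ v).im = 0) :
    (l v).im - (l u).im = π / 2 * ((zsgn (Γ v).re : ℝ) - (zsgn (Γ u).re : ℝ)) := by
  have hcut : ∀ t ∈ Icc u v, I * Γ t ∈ slitPlane := by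
    intro t ht
    rw [mem_slitPlane_iff]
    rcases (hdown t ht).lt_or_eq with hlt | heq
    · left
      have e : (I * Γ t).re = -(Γ t).im := by simp [Complex.mul_re]
      rw [e]; linarith
    · right
      have hre : (Γ t).re ≠ 0 := fun h => hne t ht (Complex.ext (by simpa using h) (by simpa using heq))
      simpa [Complex.mul_im] using hre
  have e := log_increment_eq huv hΓ hl hexp I_ne_zero hcut
  have hreU : (Γ u).re ≠ 0 := fun h => hne u (left_mem_Icc.2 huv) (Complex.ext (by simpa using h) (by simpa using hu))
  have hreV : (Γ v).re ≠ 0 := fun h => hne v (right_mem_Icc.2 huv) (Complex.ext (by simpa using h) (by simpa using hv))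
  have hΓu : Γ u = (((Γ u).re : ℝ) : ℂ) := Complex.ext (by simp) (by simp [hu])
  have hΓv : Γ v = (((Γ v).re : ℝ) : ℂ) := Complex.ext (by simp) (by simp [hv])
  have eu : (log (I * Γ u)).im = π / 2 * (zsgn (Γ u).re : ℝ) := by
    conv_lhs => rw [hΓu]
    exact im_log_I_mul hreU
  have ev : (log (I * Γ v)).im = π / 2 * (zsgn (Γ v).re : ℝ) := by
    conv_lhs => rw [hΓv]
    exact im_log_I_mul hreV
  have hi := congrArg Complex.im e
  simp only [Complex.sub_im] at hi
  rw [hi, eu, ev]; ring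

/-- BAD PIECE: `Im Γ ≥ 0` on `[u, v]`, real non-zero ends ⇒ every continuous logarithm gains `−(π/2)(σ(v) − σ(u))` in imaginary part. -/
theorem im_incr_piece_up {Γ l : ℝ → ℂ} {u v : ℝ} (huv : u ≤ v) (hΓ : ContinuousOn Γ (Icc u v)) (hl : ContinuousOn l (Icc u v))
    (hexp : ∀ t ∈ Icc u v, exp (l t) = Γ t) (hne : ∀ t ∈ Icc u v, Γ t ≠ 0) (hup : ∀ t ∈ Icc u v, 0 ≤ (Γ t).im)
    (hu : (Γ u).im = 0) (hv : (Γ v).im = 0) :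
    (l v).im - (l u).im = -(π / 2) * ((zsgn (Γ v).re : ℝ) - (zsgn (Γ u).re : ℝ)) := by
  have hcut : ∀ t ∈ Icc u v, -I * Γ t ∈ slitPlane := by
    intro t ht
    rw [mem_slitPlane_iff]
    rcases (hup t ht).lt_or_eq with hlt | heq
    · left
      have e : (-I * Γ t).re = (Γ t).im := by simp [Complex.mul_re]
      rw [e]; exact hlt
    · right
      have hre : (Γ t).re ≠ 0 := fun h => hne t ht (Complex.ext (by simpa using h) (by simpa using heq.symm))
      simpa [Complex.mul_im] using hre
  have e := log_increment_eq huv hΓ hl hexp (neg_ne_zero.2 I_ne_zero) hcut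
  have hreU : (Γ u).re ≠ 0 := fun h => hne u (left_mem_Icc.2 huv) (Complex.ext (by simpa using h) (by simpa using hu))
  have hreV : (Γ v).re ≠ 0 := fun h => hne v (right_mem_Icc.2 huv) (Complex.ext (by simpa using h) (by simpa using hv))
  have hΓu : Γ u = (((Γ u).re : ℝ) : ℂ) := Complex.ext (by simp) (by simp [hu])
  have hΓv : Γ v = (((Γ v).re : ℝ) : ℂ) := Complex.ext (by simp) (by simp [hv])
  have eu : (log (-I * Γ u)).im = -(π / 2) * (zsgn (Γ u).re : ℝ) := by
    conv_lhs => rw [hΓu]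
    exact im_log_negI_mul hreU
  have ev : (log (-I * Γ v)).im = -(π / 2) * (zsgn (Γ v).re : ℝ) := by
    conv_lhs => rw [hΓv]
    exact im_log_negI_mul hreV
  have hi := congrArg Complex.im e
  simp only [Complex.sub_im] at hi
  rw [hi, eu, ev]; ring

/-! ## §3 The potential argument along the finitely many real points -/

/-- A continuous real function without zeros on an open interval has constant sign there. -/
theorem pos_or_neg_of_ne_zero {g : ℝ → ℝ} {a b : ℝ} (hg : ContinuousOn g (Icc a b)) (hne : ∀ s ∈ Ioo a b, g s ≠ 0) :
    (∀ s ∈ Ioo a b, 0 < g s) ∨ (∀ s ∈ Ioo a b, g s < 0) := by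
  by_contra h
  rw [not_or] at h
  obtain ⟨h1, h2⟩ := h
  push Not at h1 h2
  obtain ⟨s₁, hs₁, hle₁⟩ := h1
  obtain ⟨s₂, hs₂, hle₂⟩ := h2
  have hlt₁ : g s₁ < 0 := lt_of_le_of_ne hle₁ (hne s₁ hs₁)
  have hlt₂ : 0 < g s₂ := lt_of_le_of_ne hle₂ (hne s₂ hs₂).symm
  rcases le_total s₁ s₂ with hle | hle
  · obtain ⟨s, hs, hs0⟩ := intermediate_value_Icc hle (hg.mono (Icc_subset_Icc hs₁.1.le hs₂.2.le)) ⟨hlt₁.le, hlt₂.le⟩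
    exact hne s ⟨lt_of_lt_of_le hs₁.1 hs.1, lt_of_le_of_lt hs.2 hs₂.2⟩ hs0
  · obtain ⟨s, hs, hs0⟩ := intermediate_value_Icc' hle (hg.mono (Icc_subset_Icc hs₂.1.le hs₁.2.le)) ⟨hlt₁.le, hlt₂.le⟩
    exact hne s ⟨lt_of_lt_of_le hs₂.1 hs.1, lt_of_le_of_lt hs.2 hs₁.2⟩ hs0

/-- ★ POTENTIAL MONOTONICITY (the partition form of `two_mul_wind_eq`, as an inequality).  `Γ` continuous and zero-free on `[0, ½]` with real
ends and finitely many real points, `l` a continuous logarithm; if no BAD piece (`Im Γ > 0` inside, real ends) is ASCENDING (`Re Γ` from negative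
to positive) then `Im (l(½) − l(0)) ≥ (π/2)(σ(½) − σ(0))`. -/
theorem im_incr_ge_of_noAsc {Γ l : ℝ → ℂ} (hΓ : ContinuousOn Γ (Icc 0 (1 / 2))) (hl : ContinuousOn l (Icc 0 (1 / 2)))
    (hexp : ∀ t ∈ Icc (0 : ℝ) (1 / 2), exp (l t) = Γ t) (hne : ∀ t ∈ Icc (0 : ℝ) (1 / 2), Γ t ≠ 0)
    (h0 : (Γ 0).im = 0) (hh : (Γ (1 / 2)).im = 0) (hfin : {t : ℝ | t ∈ Icc (0 : ℝ) (1 / 2) ∧ (Γ t).im = 0}.Finite)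
    (hna : ∀ t₁ t₂ : ℝ, 0 ≤ t₁ → t₁ < t₂ → t₂ ≤ 1 / 2 → (∀ t ∈ Ioo t₁ t₂, 0 < (Γ t).im) → (Γ t₁).im = 0 → (Γ t₂).im = 0 →
      ¬ ((Γ t₁).re < 0 ∧ 0 < (Γ t₂).re)) :
    π / 2 * ((zsgn (Γ (1 / 2)).re : ℝ) - (zsgn (Γ 0).re : ℝ)) ≤ (l (1 / 2)).im - (l 0).im := by
  classical
  set Z : Finset ℝ := hfin.toFinset with hZ
  have hmemZ : ∀ t, t ∈ Z ↔ t ∈ Icc (0 : ℝ) (1 / 2) ∧ (Γ t).im = 0 := fun t => by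
    rw [hZ, Set.Finite.mem_toFinset]; rfl
  have hhalf : (1 / 2 : ℝ) ∈ Z := (hmemZ _).2 ⟨⟨by norm_num, le_rfl⟩, hh⟩
  have hzero : (0 : ℝ) ∈ Z := (hmemZ _).2 ⟨⟨le_rfl, by norm_num⟩, h0⟩
  suffices H : ∀ n : ℕ, ∀ t ∈ Z, (Z.filter (fun s => t < s)).card = n →
      π / 2 * ((zsgn (Γ (1 / 2)).re : ℝ) - (zsgn (Γ t).re : ℝ)) ≤ (l (1 / 2)).im - (l t).im from H _ 0 hzero rfl
  intro n
  induction n using Nat.strong_induction_on with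
  | _ n ih =>
  intro t ht hcard
  obtain ⟨⟨ht0, hth⟩, htim⟩ := (hmemZ t).1 ht
  rcases hth.eq_or_lt with rfl | hlt
  · simp
  have hne' : (Z.filter (fun s => t < s)).Nonempty := ⟨1 / 2, Finset.mem_filter.2 ⟨hhalf, hlt⟩⟩
  obtain ⟨ht'Z, htt'⟩ := Finset.mem_filter.1 (Finset.min'_mem _ hne')
  set t' : ℝ := (Z.filter (fun s => t < s)).min' hne' with ht'
  obtain ⟨⟨-, ht'h⟩, ht'im⟩ := (hmemZ t').1 ht'Z
  have hmin : ∀ s ∈ Z, t < s → t' ≤ s := fun s hs hts => Finset.min'_le _ _ (Finset.mem_filter.2 ⟨hs, hts⟩)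
  have hsub : Icc t t' ⊆ Icc (0 : ℝ) (1 / 2) := Icc_subset_Icc ht0 ht'h
  have hgap : ∀ s ∈ Ioo t t', (Γ s).im ≠ 0 := by
    intro s hs h0s
    have hsZ : s ∈ Z := (hmemZ s).2 ⟨⟨ht0.trans hs.1.le, hs.2.le.trans ht'h⟩, h0s⟩
    exact absurd (hmin s hsZ hs.1) (not_le.2 hs.2)
  have hcard' : (Z.filter (fun s => t' < s)).card < n := by
    rw [← hcard]
    refine Finset.card_lt_card ⟨fun s hs => ?_, fun hss => ?_⟩
    · obtain ⟨hsZ, hs⟩ := Finset.mem_filter.1 hs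
      exact Finset.mem_filter.2 ⟨hsZ, htt'.trans hs⟩
    · exact lt_irrefl _ (Finset.mem_filter.1 (hss (Finset.min'_mem _ hne'))).2
  have IH := ih _ hcard' t' ht'Z rfl
  have hret : (Γ t).re ≠ 0 := fun h => hne t ⟨ht0, hth⟩ (Complex.ext (by simpa using h) (by simpa using htim))
  have hcont : ContinuousOn (fun s => (Γ s).im) (Icc t t') := Complex.continuous_im.comp_continuousOn (hΓ.mono hsub)
  have hpiece : π / 2 * ((zsgn (Γ t').re : ℝ) - (zsgn (Γ t).re : ℝ)) ≤ (l t').im - (l t).im := by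
    rcases pos_or_neg_of_ne_zero hcont hgap with hpos | hneg
    · -- a BAD piece: not ascending
      have hup : ∀ s ∈ Icc t t', 0 ≤ (Γ s).im := by
        intro s hs
        rcases hs.1.eq_or_lt with h1 | h1
        · rw [← h1, htim]
        · rcases hs.2.lt_or_eq with h2 | h2
          · exact (hpos s ⟨h1, h2⟩).le
          · rw [h2, ht'im]
      have e := im_incr_piece_up htt'.le (hΓ.mono hsub) (hl.mono hsub) (fun s hs => hexp s (hsub hs))
        (fun s hs => hne s (hsub hs)) hup htim ht'im
      have hn := hna t t' ht0 htt' ht'h hpos htim ht'im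
      have hσ : ((zsgn (Γ t').re : ℝ) - (zsgn (Γ t).re : ℝ)) ≤ 0 := by
        unfold zsgn
        by_cases h1 : 0 < (Γ t').re
        · by_cases h2 : 0 < (Γ t).re
          · rw [if_pos h1, if_pos h2]; push_cast; linarith
          · exact absurd ⟨lt_of_le_of_ne (not_lt.1 h2) hret, h1⟩ hn
        · rw [if_neg h1]
          split_ifs <;> push_cast <;> linarith
      rw [e]; nlinarith [Real.pi_pos]
    · -- a GOOD piece
      have hdown : ∀ s ∈ Icc t t', (Γ s).im ≤ 0 := by
        intro s hs
        rcases hs.1.eq_or_lt with h1 | h1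
        · rw [← h1, htim]
        · rcases hs.2.lt_or_eq with h2 | h2
          · exact (hneg s ⟨h1, h2⟩).le
          · rw [h2, ht'im]
      have e := im_incr_piece_down htt'.le (hΓ.mono hsub) (hl.mono hsub) (fun s hs => hexp s (hsub hs))
        (fun s hs => hne s (hsub hs)) hdown htim ht'im
      rw [e]
  linarith [hpiece, IH]

/-! ## §4 The loop inequality -/

/-- ★ LOOP INEQUALITY (partition form of `two_mul_wind_eq`).  A conjugation-symmetric (`Γ(1 − t) = conj Γ(t)`) zero-free loop whose upper half
`[0, ½]` has finitely many real points — or is real throughout — and no ascending bad piece satisfies `2·wind Γ = sgn Re Γ(½) − sgn Re Γ(0) + n`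
with `n ∈ ℕ`. -/
theorem two_mul_wind_ge {Γ : ℝ → ℂ} (hΓ : ContinuousOn Γ (Icc 0 1)) (h01 : Γ 0 = Γ 1) (hne : ∀ t ∈ Icc (0 : ℝ) 1, Γ t ≠ 0)
    (hsym : ∀ t ∈ Icc (0 : ℝ) 1, Γ (1 - t) = (starRingEnd ℂ) (Γ t))
    (hZ : {t : ℝ | t ∈ Icc (0 : ℝ) (1 / 2) ∧ (Γ t).im = 0}.Finite ∨ ∀ t ∈ Icc (0 : ℝ) (1 / 2), (Γ t).im = 0)
    (hna : ∀ t₁ t₂ : ℝ, 0 ≤ t₁ → t₁ < t₂ → t₂ ≤ 1 / 2 → (∀ t ∈ Ioo t₁ t₂, 0 < (Γ t).im) → (Γ t₁).im = 0 → (Γ t₂).im = 0 →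
      ¬ ((Γ t₁).re < 0 ∧ 0 < (Γ t₂).re)) :
    ∃ n : ℕ, 2 * (wind Γ : ℂ) = sgn (Γ (1 / 2)).re - sgn (Γ 0).re + n := by
  obtain ⟨l, hl, hle⟩ := (IsNonvanishingLoop.mk hΓ hne h01).hasLogOn
  have hw := wind_spec hl hle h01
  have hq0 : (0 : ℝ) ≤ 1 / 2 := by norm_num
  have hq1 : (1 / 2 : ℝ) ≤ 1 := by norm_num
  have h0 : (Γ 0).im = 0 := by
    have e := hsym 0 ⟨le_rfl, zero_le_one⟩
    rw [sub_zero, ← h01] at e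
    exact conj_eq_iff_im.1 e.symm
  have hh : (Γ (1 / 2)).im = 0 := by
    have e := hsym (1 / 2) ⟨hq0, hq1⟩
    rw [show (1 : ℝ) - 1 / 2 = 1 / 2 by norm_num] at e
    exact conj_eq_iff_im.1 e.symm
  -- symmetry of the logarithm: `conj l(1 − t)` is another logarithm of `Γ`
  have hI : ∀ t ∈ Icc (0 : ℝ) 1, 1 - t ∈ Icc (0 : ℝ) 1 := fun t ht => ⟨by linarith [ht.2], by linarith [ht.1]⟩
  have hl₂ : ContinuousOn (fun t => (starRingEnd ℂ) (l (1 - t))) (Icc 0 1) := by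
    refine Complex.continuous_conj.comp_continuousOn (hl.comp (continuousOn_const.sub continuousOn_id) fun t ht => hI t ht)
  have hle₂ : ∀ t ∈ Icc (0 : ℝ) 1, exp ((starRingEnd ℂ) (l (1 - t))) = exp (l t) := by
    intro t ht
    rw [Complex.exp_conj, hle (1 - t) (hI t ht), hsym t ht, Complex.conj_conj, hle t ht]
  obtain ⟨k, hk⟩ := exists_int_eq_add_of_exp_eq isPreconnected_Icc hl₂ hl hle₂
  have hk0 := congrArg Complex.im (hk 0 ⟨le_rfl, zero_le_one⟩)
  have hkh := congrArg Complex.im (hk (1 / 2) ⟨hq0, hq1⟩)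
  simp only [sub_zero, Complex.conj_im, Complex.add_im, show (1 : ℝ) - 1 / 2 = 1 / 2 by norm_num] at hk0 hkh
  have hkI : ((k : ℂ) * (2 * π * I)).im = 2 * π * k := by simp [Complex.mul_im]; ring
  rw [hkI] at hk0 hkh
  have hsymL : (l 1).im - (l (1 / 2)).im = (l (1 / 2)).im - (l 0).im := by linarith
  -- the upper half: the potential inequality (finite case) or one flat piece
  have hhalf : π / 2 * ((zsgn (Γ (1 / 2)).re : ℝ) - (zsgn (Γ 0).re : ℝ)) ≤ (l (1 / 2)).im - (l 0).im := by
    have hΓ' := hΓ.mono (Icc_subset_Icc_right hq1)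
    have hl' := hl.mono (Icc_subset_Icc_right hq1)
    have hle' : ∀ t ∈ Icc (0 : ℝ) (1 / 2), exp (l t) = Γ t := fun t ht => hle t ⟨ht.1, ht.2.trans hq1⟩
    have hne' : ∀ t ∈ Icc (0 : ℝ) (1 / 2), Γ t ≠ 0 := fun t ht => hne t ⟨ht.1, ht.2.trans hq1⟩
    rcases hZ with hfin | hflat
    · exact im_incr_ge_of_noAsc hΓ' hl' hle' hne' h0 hh hfin hna
    · exact (im_incr_piece_down hq0 hΓ' hl' hle' hne' (fun t ht => (hflat t ht).le) h0 hh).symm.le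
  -- the winding number
  have hwim := congrArg Complex.im hw
  have hwI : ((wind Γ : ℂ) * (2 * π * I)).im = 2 * π * (wind Γ : ℝ) := by simp [Complex.mul_im]; ring
  rw [Complex.sub_im, hwI] at hwim
  have hineq : ((zsgn (Γ (1 / 2)).re : ℝ) - (zsgn (Γ 0).re : ℝ)) ≤ 2 * (wind Γ : ℝ) := by nlinarith [Real.pi_pos]
  have hint : (0 : ℤ) ≤ 2 * wind Γ - (zsgn (Γ (1 / 2)).re - zsgn (Γ 0).re) := by
    have h : (0 : ℝ) ≤ ((2 * wind Γ - (zsgn (Γ (1 / 2)).re - zsgn (Γ 0).re) : ℤ) : ℝ) := by push_cast; linarith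
    exact_mod_cast h
  obtain ⟨n, hn⟩ := Int.eq_ofNat_of_zero_le hint
  refine ⟨n, ?_⟩
  rw [sgn_eq_zsgn, sgn_eq_zsgn]
  have hn' : ((2 * wind Γ - (zsgn (Γ (1 / 2)).re - zsgn (Γ 0).re) : ℤ) : ℂ) = ((n : ℤ) : ℂ) := by rw [hn]
  push_cast at hn'
  linear_combination hn'

/-! ## §5 Finiteness of the real points of `(G′/G) ∘ circleLoop` -/

/-- Conjugation symmetry of a circle loop with real centre: `circleLoop c r (1 − t) = conj (circleLoop c r t)`. -/
theorem circleLoop_one_sub (c r t : ℝ) : circleLoop (c : ℂ) r (1 - t) = (starRingEnd ℂ) (circleLoop (c : ℂ) r t) := by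
  rw [circleLoop_apply, circleLoop_apply, map_add, Complex.conj_ofReal, map_mul, Complex.conj_ofReal, ← Complex.exp_conj]
  congr 2
  have e1 : (2 * (π : ℂ) * ((1 - t : ℝ) : ℂ) * I) = 2 * π * I + -(2 * π * t * I) := by push_cast; ring
  rw [e1, Complex.exp_add, Complex.exp_two_pi_mul_I, one_mul, map_mul, map_mul, map_mul, Complex.conj_I, Complex.conj_ofReal,
    Complex.conj_ofReal, map_ofNat]
  congr 1; ring

/-- `t ↦ Im ((G′/G)(circleLoop c r t))` is real-analytic at every `t` when `G` is entire and zero-free on the circle. -/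
theorem analyticAt_im_logDeriv_circleLoop {G : ℂ → ℂ} (hG : Differentiable ℂ G) {c r : ℝ}
    (hG0 : ∀ t : ℝ, G (circleLoop (c : ℂ) r t) ≠ 0) (t : ℝ) :
    AnalyticAt ℝ (fun s : ℝ => (deriv G (circleLoop (c : ℂ) r s) / G (circleLoop (c : ℂ) r s)).im) t := by
  have hF : Differentiable ℂ fun z : ℂ => (c : ℂ) + r * exp (2 * π * z * I) := by fun_prop
  have hγ : AnalyticAt ℝ (fun s : ℝ => circleLoop (c : ℂ) r s) t := by
    have h1 : AnalyticAt ℝ (fun z : ℂ => (c : ℂ) + r * exp (2 * π * z * I)) (Complex.ofRealCLM t) :=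
      (hF.analyticAt _).restrictScalars
    have h2 := h1.comp (Complex.ofRealCLM.analyticAt t)
    refine h2.congr (Eventually.of_forall fun s => ?_)
    simp [Function.comp, circleLoop_apply]
  have hφ : AnalyticAt ℂ (fun w : ℂ => deriv G w / G w) (circleLoop (c : ℂ) r t) :=
    (hG.deriv.analyticAt _).div (hG.analyticAt _) (hG0 t)
  have h3 : AnalyticAt ℝ (fun s : ℝ => deriv G (circleLoop (c : ℂ) r s) / G (circleLoop (c : ℂ) r s)) t :=
    hφ.restrictScalars.comp hγ
  exact (Complex.imCLM.analyticAt _).comp h3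

/-- ★ FINITELY MANY REAL POINTS, OR ALL REAL: for `G` entire and zero-free on the circle, the set of `t ∈ [0, ½]` at which `(G′/G)(circleLoop c r t)`
is real is finite, unless it is all of `[0, ½]` (identity theorem for the real-analytic function `Im (G′/G) ∘ circleLoop`). -/
theorem breaks_finite_or_flat {G : ℂ → ℂ} (hG : Differentiable ℂ G) {c r : ℝ} (hG0 : ∀ t : ℝ, G (circleLoop (c : ℂ) r t) ≠ 0) :
    {t : ℝ | t ∈ Icc (0 : ℝ) (1 / 2) ∧ (deriv G (circleLoop (c : ℂ) r t) / G (circleLoop (c : ℂ) r t)).im = 0}.Finite ∨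
      ∀ t ∈ Icc (0 : ℝ) (1 / 2), (deriv G (circleLoop (c : ℂ) r t) / G (circleLoop (c : ℂ) r t)).im = 0 := by
  set h : ℝ → ℝ := fun s => (deriv G (circleLoop (c : ℂ) r s) / G (circleLoop (c : ℂ) r s)).im with hh
  have han : AnalyticOnNhd ℝ h univ := fun t _ => analyticAt_im_logDeriv_circleLoop hG hG0 t
  by_cases hfin : {t : ℝ | t ∈ Icc (0 : ℝ) (1 / 2) ∧ h t = 0}.Finite
  · exact Or.inl hfin
  right
  obtain ⟨z₀, -, hacc⟩ := Set.Infinite.exists_accPt_of_subset_isCompact hfin isCompact_Icc (fun t ht => ht.1)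
  have hfreq : ∃ᶠ s in 𝓝[≠] z₀, h s = 0 := (accPt_iff_frequently_nhdsNE.1 hacc).mono fun s hs => hs.2
  have hzero := han.eqOn_zero_of_preconnected_of_frequently_eq_zero isPreconnected_univ (mem_univ z₀) hfreq
  intro t _
  exact hzero (mem_univ t)

end RhW08.Lens1ArcSign


-- ======== ArcSignE-v1 b1b2d15f1b000e73 (import lines stripped) ========

/-!
# TiltedLandingLaw421R3 — lens-1: RUNG 2 of the arc-sign ladder PROVED — `pinning_of_noAscendingArc : PinningOfNoAscendingArc` (part E)

LENS-1 gen-6 module image `rh33346-cover/lens-1/ArcSignE-v1.lean` (landing target `…/Theorems/TiltedLandingLaw421R3Lens1ArcSignE.lean`; single import =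
part D; namespace `RhW08.Lens1ArcSign`; 0 `sorry`, no instances / notation; checked BY CHAIN over the ArcSign A–D images until tree).

RUNG 2 (memo `O6b-MULTIARC-MEMO-v1.md`, NODE v14 P8-R2, statement `PinningOfNoAscendingArc` of part C): on a legal frame, an upper zero `a` of
`f^{(j)}` whose small Jensen circles `|w − Re a| = Im a + δ` carry NO ASCENDING BAD ARC satisfies the literal `TopPinning` disjunction — a non-real
zero of `f^{(j+1)}` in the CLOSED Jensen disc (`NestedStep`) or an NL event of level `j` in the CLOSED base.  Any `m̃`, any number of crossing
mates; RUNG 1 (`pinning_of_arcSignClear`) is the case of no bad arc (`rung1_of_rung2`).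

PROOF.  §6 `disc_census_ge`: for `f` entire and real, zero-free with `f′` on the circle, and no ascending bad piece of `(f′/f) ∘ circleLoop` on
`[0, ½]`: `2 (N_D(f′) − N_D(f)) = sgn (f′/f)(c − r) − sgn (f′/f)(c + r) + n`, `n ∈ ℕ` (argument principle `wind_circleLoop_eq_zeroCountC` + the loop
inequality `two_mul_wind_ge` of part D; the conjugation symmetry of the loop from `apply_conj_eq_conj`, the finiteness of its real points from
`breaks_finite_or_flat`).  §7 `no_nonreal_zero_of_disc_ge`: with that census, all critical points in the disc real and the real Rolle identity
on the base, every zero of `f` in the disc is real (the surplus `n ≥ 0` only helps).  §8 ★★★ `pinning_of_noAscendingArc`: as RUNG 1 — NL margin,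
child margin, a GENERIC `δ` whose whole circle misses the finitely many zeros of `f^{(j)} f^{(j+1)}` in the box, `LocalB` or an NL event
(`nlEventOf_of_not_localB`), `rolleIdentity_of_localB_core`, and `a` itself is a non-real zero in the disc — contradiction.  The degenerate frame
`f^{(j)} ≡ 0` (not excluded by the hypothesis) is settled by the child `w = a`.  COROLLARY `topPinning_of_ascResidual : TopPinningAscResidual →
TopPinning` — after RUNG 2 the law's only open population is «an ascending bad arc on arbitrarily small circles».

HONEST LABEL: RUNG 2 is argument-principle bookkeeping on the hypothesis `ArcNoAsc`; it does NOT prove `TopPinning`: `TopPinningAscResidual`,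
`TopPinningArcResidual`, `TopPinning`, `TopPinningCrossing`, `RegUmbrella11S`, 33346, 33347 are OPEN; nothing here bears on the truth of RH; RH is
not proved; checked ≠ proved.
-/

noncomputable section

namespace RhW08.Lens1ArcSign

open Complex Set Metric Filter Topology
open scoped Real
open Literature.Topology.PlaneTopology Literature.Analysis.Complex
open Summit.RiemannHypothesis.RiemannHypothesis.Theorems.Splittings.JensenWindow
open RhIdea6.G17.W07C7 RhIdea6.G17.W07C7.Rev6 RhIdea6.G18.W07C8.Law421BirthS RhIdea6.G19.W07C11.Seam
open RhIdea6.G20.W07C12.Frac RhIdea6.G20.W07C12.StColP RhW07.C12.FieldSplit RhIdea6.G21.W07C13.TentMax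
open RhW07.C14.TwoSided RhW07.C14.Classes RhW07.C14.Lineage RhW07.C14.Booking
open RhW07.C13.Heredity RhIdea6.G22.W07C15pre.Injection RhW07.E3.Cell RhW07.E3.Lit
open RhW08.Round1 RhW08.StSwap RhW08.Round2 RhW08.QuadW RhW08.SealSwapQ RhW08.SealSwap RhW08.SuccB RhW08.SuccSplit
open RhW08.SuccTheft RhW08.Column RhW08.Hurwitz RhW08.ClusterQ RhW08.ClusterQM RhW08.NewtonDoor RhW08.NewtonDoorGenusOne RhW08.PurseP
open RhW08.Lens1SignCut RhW08.Lens1Coverage RhW08.IsolatedTilt RhW08.Lens1Pinning RhW08.Lens1PinningIso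

variable {f : ℂ → ℂ}

/-! ## §6 The census inequality on a disc -/

/-- ★★ CENSUS INEQUALITY ON A DISC.  `f` entire and real, `f f′ ≠ 0` on the circle `‖w − c‖ = r` (`r > 0`), and no ascending bad piece of
`(f′/f) ∘ circleLoop c r` on `[0, ½]` ⇒ `2 (N_D(f′) − N_D(f)) = sgn (f′/f)(c − r) − sgn (f′/f)(c + r) + n` with `n ∈ ℕ`.  (The `m̃ = 0` census
`disc_census` is the case of no bad piece; `n/2 = #desc − #asc`.) -/
theorem disc_census_ge (hfd : Differentiable ℂ f) (hreal : ∀ x : ℝ, (f x).im = 0) {c r : ℝ} (hr : 0 < r)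
    (hf0 : ∀ u : ℂ, ‖u - c‖ = r → f u ≠ 0) (hd0 : ∀ u : ℂ, ‖u - c‖ = r → deriv f u ≠ 0)
    (hna : ∀ t₁ t₂ : ℝ, 0 ≤ t₁ → t₁ < t₂ → t₂ ≤ 1 / 2 →
      (∀ t ∈ Ioo t₁ t₂, 0 < (deriv f (circleLoop (c : ℂ) r t) / f (circleLoop (c : ℂ) r t)).im) →
      (deriv f (circleLoop (c : ℂ) r t₁) / f (circleLoop (c : ℂ) r t₁)).im = 0 →
      (deriv f (circleLoop (c : ℂ) r t₂) / f (circleLoop (c : ℂ) r t₂)).im = 0 →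
      ¬ ((deriv f (circleLoop (c : ℂ) r t₁) / f (circleLoop (c : ℂ) r t₁)).re < 0 ∧
          0 < (deriv f (circleLoop (c : ℂ) r t₂) / f (circleLoop (c : ℂ) r t₂)).re)) :
    ∃ n : ℕ, 2 * (zeroCountC (deriv f) (ball (c : ℂ) r) - zeroCountC f (ball (c : ℂ) r)) =
      sgn (deriv f ((c - r : ℝ) : ℂ) / f ((c - r : ℝ) : ℂ)).re - sgn (deriv f ((c + r : ℝ) : ℂ) / f ((c + r : ℝ) : ℂ)).re + n := by
  have hγr : ∀ t : ℝ, ‖circleLoop (c : ℂ) r t - c‖ = r := fun t => by rw [norm_circleLoop_sub_center, abs_of_pos hr]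
  have hcf : Continuous fun t : ℝ => f (circleLoop (c : ℂ) r t) := hfd.continuous.comp (continuous_circleLoop _ _)
  have hcd : Continuous fun t : ℝ => deriv f (circleLoop (c : ℂ) r t) := hfd.deriv.continuous.comp (continuous_circleLoop _ _)
  have hF : IsNonvanishingLoop (fun t => f (circleLoop (c : ℂ) r t)) :=
    ⟨hcf.continuousOn, fun t _ => hf0 _ (hγr t), by simp only [circleLoop_zero_eq]⟩
  have hF' : IsNonvanishingLoop (fun t => deriv f (circleLoop (c : ℂ) r t)) :=
    ⟨hcd.continuousOn, fun t _ => hd0 _ (hγr t), by simp only [circleLoop_zero_eq]⟩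
  have hdiv : wind (fun t => deriv f (circleLoop (c : ℂ) r t) / f (circleLoop (c : ℂ) r t)) =
      wind (fun t => deriv f (circleLoop (c : ℂ) r t)) - wind (fun t => f (circleLoop (c : ℂ) r t)) := wind_div hF' hF
  have hWf := wind_circleLoop_eq_zeroCountC hfd hr hf0
  have hWd := wind_circleLoop_eq_zeroCountC hfd.deriv hr hd0
  have hΓc : ContinuousOn (fun t => deriv f (circleLoop (c : ℂ) r t) / f (circleLoop (c : ℂ) r t)) (Icc 0 1) :=
    hcd.continuousOn.div hcf.continuousOn fun t _ => hf0 _ (hγr t)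
  have h01 : deriv f (circleLoop (c : ℂ) r 0) / f (circleLoop (c : ℂ) r 0) =
      deriv f (circleLoop (c : ℂ) r 1) / f (circleLoop (c : ℂ) r 1) := by rw [circleLoop_zero_eq]
  have hne : ∀ t ∈ Icc (0 : ℝ) 1, deriv f (circleLoop (c : ℂ) r t) / f (circleLoop (c : ℂ) r t) ≠ 0 :=
    fun t _ => div_ne_zero (hd0 _ (hγr t)) (hf0 _ (hγr t))
  have hfreal : ∀ z : ℂ, f ((starRingEnd ℂ) z) = (starRingEnd ℂ) (f z) := apply_conj_eq_conj hfd hreal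
  have hdreal : ∀ x : ℝ, (deriv f x).im = 0 := im_deriv_ofReal hfd hreal
  have hd'real : ∀ z : ℂ, deriv f ((starRingEnd ℂ) z) = (starRingEnd ℂ) (deriv f z) := apply_conj_eq_conj hfd.deriv hdreal
  have hsym : ∀ t ∈ Icc (0 : ℝ) 1, deriv f (circleLoop (c : ℂ) r (1 - t)) / f (circleLoop (c : ℂ) r (1 - t)) =
      (starRingEnd ℂ) (deriv f (circleLoop (c : ℂ) r t) / f (circleLoop (c : ℂ) r t)) := by
    intro t _
    rw [circleLoop_one_sub, hd'real, hfreal, map_div₀]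
  have hZ := breaks_finite_or_flat hfd (c := c) (r := r) (fun t => hf0 _ (hγr t))
  obtain ⟨n, hn⟩ := two_mul_wind_ge hΓc h01 hne hsym hZ hna
  refine ⟨n, ?_⟩
  rw [circleLoop_ofReal_half, circleLoop_ofReal_zero, hdiv, Int.cast_sub, hWd, hWf] at hn
  exact hn

/-! ## §7 Disc Rolle closure with surplus -/

/-- ★ DISC ROLLE CLOSURE WITH SURPLUS (twin of `no_nonreal_zero_of_disc`).  If the disc census holds with a surplus `n ∈ ℕ`, every critical point
in the open disc is real and the real Rolle identity holds on the base, then every zero of `f` in the disc is real (and `n = 0`). -/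
theorem no_nonreal_zero_of_disc_ge (hfd : Differentiable ℂ f) {c r : ℝ} (hr : 0 < r)
    (hfl : f ((c - r : ℝ) : ℂ) ≠ 0) (hfr : f ((c + r : ℝ) : ℂ) ≠ 0)
    (hdl : deriv f ((c - r : ℝ) : ℂ) ≠ 0) (hdr : deriv f ((c + r : ℝ) : ℂ) ≠ 0)
    (hf0 : ∀ u : ℂ, ‖u - c‖ = r → f u ≠ 0) {n : ℕ}
    (hc : 2 * (zeroCountC (deriv f) (ball (c : ℂ) r) - zeroCountC f (ball (c : ℂ) r)) =
      sgn (deriv f ((c - r : ℝ) : ℂ) / f ((c - r : ℝ) : ℂ)).re - sgn (deriv f ((c + r : ℝ) : ℂ) / f ((c + r : ℝ) : ℂ)).re + n)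
    (hA : ∀ ρ ∈ ball (c : ℂ) r, deriv f ρ = 0 → ρ.im = 0) (hR : RolleIdentity f (c - r) (c + r) r) :
    ∀ ρ ∈ ball (c : ℂ) r, f ρ = 0 → ρ.im = 0 := by
  classical
  have hW : SWindow f (fun _ => True) (c - r) (c + r) r :=
    ⟨by linarith, hr, fun _ _ => trivial, fun _ _ => trivial, fun _ _ _ => trivial, fun _ _ _ => trivial, hfl, hfr, hdl, hdr⟩
  set K : Set ℂ := ball (c : ℂ) r with hKdef
  have hfin : {ρ : ℂ | f ρ = 0 ∧ ρ ∈ K}.Finite := by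
    refine (Rouche.finite_zeros f hr (by linarith : r < r + 1) hfd.differentiableOn hf0).subset ?_
    rintro ρ ⟨h0, hρ⟩
    exact ⟨ball_subset_closedBall hρ, h0⟩
  have e1 : {ρ : ℂ | deriv f ρ = 0 ∧ ρ ∈ K} = {ρ : ℂ | deriv f ρ = 0 ∧ ρ ∈ K ∩ {ρ | ρ.im = 0}} := by
    ext ρ
    simp only [mem_setOf_eq, mem_inter_iff]
    constructor
    · rintro ⟨h0, hK⟩; exact ⟨h0, hK, hA ρ hK h0⟩
    · rintro ⟨h0, hK, -⟩; exact ⟨h0, hK⟩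
  have e1' : zeroCountC (deriv f) K = zeroCountC (deriv f) (K ∩ {ρ | ρ.im = 0}) := by
    unfold zeroCountC; rw [e1]
  set B : Set ℂ := {ρ : ℂ | f ρ = 0 ∧ ρ ∈ K ∧ ρ.im ≠ 0} with hBdef
  have e2 : {ρ : ℂ | f ρ = 0 ∧ ρ ∈ K} = {ρ : ℂ | f ρ = 0 ∧ ρ ∈ K ∩ {ρ | ρ.im = 0}} ∪ B := by
    ext ρ
    simp only [mem_setOf_eq, mem_inter_iff, mem_union, hBdef]
    constructor
    · rintro ⟨h0, hK⟩
      by_cases him : ρ.im = 0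
      · exact Or.inl ⟨h0, hK, him⟩
      · exact Or.inr ⟨h0, hK, him⟩
    · rintro (⟨h0, hK, -⟩ | ⟨h0, hK, -⟩) <;> exact ⟨h0, hK⟩
  have hdisj : Disjoint {ρ : ℂ | f ρ = 0 ∧ ρ ∈ K ∩ {ρ | ρ.im = 0}} B := by
    rw [Set.disjoint_left]
    rintro ρ ⟨-, -, him⟩ ⟨-, -, him'⟩
    exact him' him
  have hAfin : {ρ : ℂ | f ρ = 0 ∧ ρ ∈ K ∩ {ρ | ρ.im = 0}}.Finite := hfin.subset fun ρ hρ => ⟨hρ.1, hρ.2.1⟩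
  have hBfin : B.Finite := hfin.subset fun ρ hρ => ⟨hρ.1, hρ.2.1⟩
  have e2' : zeroCountC f K = zeroCountC f (K ∩ {ρ | ρ.im = 0}) + ∑ᶠ ρ ∈ B, ((meromorphicOrderAt f ρ).untop₀ : ℂ) := by
    unfold zeroCountC; rw [e2, finsum_mem_union hdisj hAfin hBfin]
  have hB0 : 2 * ∑ᶠ ρ ∈ B, ((meromorphicOrderAt f ρ).untop₀ : ℂ) + n = 0 := by
    rw [e1', e2'] at hc
    unfold RolleIdentity at hR
    rw [zeroCountC_box_real_eq, zeroCountC_box_real_eq] at hR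
    linear_combination hR - hc
  rw [finsum_mem_eq_finite_toFinset_sum _ hBfin, ← Int.cast_sum] at hB0
  have hB0' : 2 * ∑ ρ ∈ hBfin.toFinset, (meromorphicOrderAt f ρ).untop₀ + (n : ℤ) = 0 := by exact_mod_cast hB0
  have hpos : ∀ ρ ∈ hBfin.toFinset, 0 < (meromorphicOrderAt f ρ).untop₀ := by
    intro ρ hρ
    rw [Set.Finite.mem_toFinset] at hρ
    exact order_pos hfd hW (ball_subset_box c r hρ.2.1) hρ.1
  intro ρ hρK hρ0
  by_contra him
  have hρB : ρ ∈ hBfin.toFinset := by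
    rw [Set.Finite.mem_toFinset]; exact ⟨hρ0, hρK, him⟩
  have h1 := Finset.single_le_sum (fun ρ hρ => (hpos ρ hρ).le) hρB
  have h2 := hpos ρ hρB
  omega

/-! ## §8 RUNG 2 -/

/-- `ArcNoAscCofinite f j a`: no ascending bad arc on the circles `|w − Re a| = Im a + δ` for all `δ ∈ (0, d₀)` outside a FINITE exceptional
set (tangencies, non-generic radii) — the form the instrument measures; it implies the same conclusion (the proof uses one generic `δ`). -/
def ArcNoAscCofinite (f : ℂ → ℂ) (j : ℕ) (a : ℂ) : Prop :=
  ∃ d0 > 0, ∃ E : Set ℝ, E.Finite ∧ ∀ δ ∈ Ioo 0 d0 \ E, NoAscendingArc f j a δ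

/-- `ArcNoAsc ⇒ ArcNoAscCofinite` (empty exceptional set). -/
theorem arcNoAscCofinite_of_arcNoAsc {f : ℂ → ℂ} {j : ℕ} {a : ℂ} (h : ArcNoAsc f j a) : ArcNoAscCofinite f j a := by
  obtain ⟨d0, hd0, hna⟩ := h
  exact ⟨d0, hd0, ∅, Set.finite_empty, fun δ hδ => hna δ hδ.1⟩

/-- ★★★ RUNG 2 — PINNING FROM «NO ASCENDING BAD ARC» (cofinite form; any `m̃`).  On a legal frame, an upper
zero `a` of `f^{(j)}` all of whose small Jensen circles `|w − Re a| = Im a + δ` (`0 < δ < d₀`) carry no ascending bad arc has a NON-REAL zero of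
`f^{(j+1)}` in its CLOSED Jensen disc or an NL event of level `j` in the CLOSED base.  [Walsh, Ann. of Math. 22 (1920) §4 on `a`ʼs own circle,
partitioned at the real points of `f^{(j+1)}/f^{(j)}`; memo O6b §2 (PIN) `ch = 1 + pz − #asc + #desc`.] -/
theorem pinning_of_noAscendingArc_cofinite {η : ℝ} {f : ℂ → ℂ} {x₀ s hmax R Hs : ℝ} {B : ℕ} (hE : EngineHyps5 2 η f x₀ s hmax R Hs B)
    {j : ℕ} {a : ℂ} (ha : iteratedDeriv j f a = 0) (hapos : 0 < a.im) (hNA : ArcNoAscCofinite f j a) :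
    (∃ w : ℂ, iteratedDeriv (j + 1) f w = 0 ∧ w.im ≠ 0 ∧ NestedStep a w) ∨ (∃ x : ℝ, |x - a.re| ≤ a.im ∧ NLEventOf f j x) := by
  classical
  have hf : RealEntireLt2 f := realEntireLt2_of_hyps hE
  -- degenerate frame `f^{(j)} ≡ 0`: `a` itself is a child
  by_cases hnz : iteratedDeriv j f = 0
  · left
    refine ⟨a, ?_, hapos.ne', ?_⟩
    · rw [iteratedDeriv_succ, hnz]; simp
    · show (a.re - a.re) ^ 2 + a.im ^ 2 ≤ a.im ^ 2
      simp
  set G : ℂ → ℂ := iteratedDeriv j f with hGdef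
  have hG : RealEntireLt2 G :=
    { diff := differentiable_iteratedDeriv_of_entire hf.diff j
      growth := by
        obtain ⟨ρ, C, hρ0, hρ, hgr⟩ := hf.growth
        obtain ⟨ρ', C', h1, h2, h3⟩ := exists_growth_iteratedDeriv hf.diff hρ0 hρ hgr j
        exact ⟨ρ', C', h1, h2, h3⟩
      real := im_iteratedDeriv_ofReal hf.diff hf.real j }
  have e1 : deriv G = iteratedDeriv (j + 1) f := by rw [hGdef, ← iteratedDeriv_succ]
  have hHs : 0 ≤ Hs := hE.2.2.2.2.2.2.2.1
  have hG'ne : iteratedDeriv (j + 1) f ≠ 0 := iteratedDeriv_succ_ne_zero_of_zero hf.diff j hnz ha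
  have hG'd : Differentiable ℂ (iteratedDeriv (j + 1) f) := differentiable_iteratedDeriv_of_entire hf.diff (j + 1)
  obtain ⟨d0, hd0, E, hEfin, hna⟩ := hNA
  by_contra hcon
  push Not at hcon
  obtain ⟨hnoC, hnoNL⟩ := hcon
  obtain ⟨m, hm0, hm1, hmarg⟩ := exists_nl_margin hf hG'ne hapos (a := a)
  obtain ⟨m', hm'0, hm'1, hchild⟩ := exists_child_margin hE hG'ne hapos (a := a)
  set δ₀ : ℝ := min d0 (min m m') with hδ₀
  have hδ₀0 : 0 < δ₀ := lt_min hd0 (lt_min hm0 hm'0)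
  -- a GENERIC `δ ∈ (0, δ₀)`: the whole circle of radius `Im a + δ` misses the finitely many zeros of `G`, `G′` in the box
  set L : ℝ := a.im + Hs + 2 with hL
  have hz₀ : ((a.re : ℂ)) ∈ Ioo (a.re - L) (a.re + L) ×ℂ Ioo (-(Hs + 1)) (Hs + 1) :=
    ofReal_mem_box (by rw [sub_self, abs_zero]; linarith) hHs
  set Z : Set ℂ := {ρ : ℂ | G ρ = 0 ∧ ρ ∈ Ioo (a.re - L) (a.re + L) ×ℂ Ioo (-(Hs + 1)) (Hs + 1)} ∪
    {ρ : ℂ | iteratedDeriv (j + 1) f ρ = 0 ∧ ρ ∈ Ioo (a.re - L) (a.re + L) ×ℂ Ioo (-(Hs + 1)) (Hs + 1)} with hZ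
  have hZfin : Z.Finite := (finite_zeros_box hG.diff hnz hz₀).union (finite_zeros_box hG'd hG'ne hz₀)
  have hbad : ((fun ρ : ℂ => ‖ρ - (a.re : ℂ)‖ - a.im) '' Z ∪ E).Finite := (hZfin.image _).union hEfin
  obtain ⟨δ, hδI, hδbad⟩ := ((Set.Ioo_infinite hδ₀0).sdiff hbad).nonempty
  obtain ⟨hδ0, hδ1⟩ := hδI
  have hδd0 : δ < d0 := lt_of_lt_of_le hδ1 (min_le_left _ _)
  have hδm : δ < m := lt_of_lt_of_le hδ1 ((min_le_right _ _).trans (min_le_left _ _))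
  have hδm' : δ < m' := lt_of_lt_of_le hδ1 ((min_le_right _ _).trans (min_le_right _ _))
  have hr : 0 < a.im + δ := by linarith
  have haHs : |a.im| ≤ Hs := abs_im_le_of_level hE hnz ha
  rw [abs_of_pos hapos] at haHs
  -- the circle lies in the box
  have hbox : ∀ u : ℂ, ‖u - (a.re : ℂ)‖ = a.im + δ → u ∈ Ioo (a.re - L) (a.re + L) ×ℂ Ioo (-(Hs + 1)) (Hs + 1) := by
    intro u hu
    have h1 := abs_re_le_norm (u - (a.re : ℂ))
    have h2 := abs_im_le_norm (u - (a.re : ℂ))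
    rw [hu] at h1 h2
    rw [sub_re, ofReal_re, abs_le] at h1
    rw [sub_im, ofReal_im, sub_zero, abs_le] at h2
    exact mem_reProdIm.2 ⟨⟨by linarith [h1.1], by linarith [h1.2]⟩, ⟨by linarith [h2.1], by linarith [h2.2]⟩⟩
  have hG0 : ∀ u : ℂ, ‖u - ((a.re : ℝ) : ℂ)‖ = a.im + δ → G u ≠ 0 := fun u hu h0 =>
    hδbad (Or.inl ⟨u, Or.inl ⟨h0, hbox u hu⟩, by simp only [hu]; ring⟩)
  have hG'0 : ∀ u : ℂ, ‖u - ((a.re : ℝ) : ℂ)‖ = a.im + δ → iteratedDeriv (j + 1) f u ≠ 0 := fun u hu h0 =>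
    hδbad (Or.inl ⟨u, Or.inr ⟨h0, hbox u hu⟩, by simp only [hu]; ring⟩)
  have hδE : δ ∉ E := fun h => hδbad (Or.inr h)
  have hdG0 : ∀ u : ℂ, ‖u - ((a.re : ℝ) : ℂ)‖ = a.im + δ → deriv G u ≠ 0 := by rw [e1]; exact hG'0
  -- the feet
  have hβ : ‖((a.re + (a.im + δ) : ℝ) : ℂ) - ((a.re : ℝ) : ℂ)‖ = a.im + δ := by
    rw [← ofReal_sub, show a.re + (a.im + δ) - a.re = a.im + δ by ring, Complex.norm_real, Real.norm_eq_abs, abs_of_pos hr]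
  have hα : ‖((a.re - (a.im + δ) : ℝ) : ℂ) - ((a.re : ℝ) : ℂ)‖ = a.im + δ := by
    rw [← ofReal_sub, show a.re - (a.im + δ) - a.re = -(a.im + δ) by ring, Complex.norm_real, Real.norm_eq_abs, abs_neg,
      abs_of_pos hr]
  have hGβ : G ((a.re + (a.im + δ) : ℝ) : ℂ) ≠ 0 := hG0 _ hβ
  have hGα : G ((a.re - (a.im + δ) : ℝ) : ℂ) ≠ 0 := hG0 _ hα
  have hdGβ : deriv G ((a.re + (a.im + δ) : ℝ) : ℂ) ≠ 0 := hdG0 _ hβ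
  have hdGα : deriv G ((a.re - (a.im + δ) : ℝ) : ℂ) ≠ 0 := hdG0 _ hα
  -- the base: local Laguerre law B, or an NL event within the margin
  by_cases hB : LocalB G (a.re - (a.im + δ)) (a.re + (a.im + δ))
  swap
  · obtain ⟨x, hx, hNL⟩ := nlEventOf_of_not_localB hf j hB
    have hxa : |x - a.re| < a.im + m := by rw [abs_lt]; constructor <;> linarith [hx.1, hx.2]
    exact hnoNL x (hmarg x hNL hxa) hNL
  have hW : SWindow G (fun _ => True) (a.re - (a.im + δ)) (a.re + (a.im + δ)) (a.im + δ) :=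
    ⟨by linarith, hr, fun _ _ => trivial, fun _ _ => trivial, fun _ _ _ => trivial, fun _ _ _ => trivial, hGα, hGβ, hdGα, hdGβ⟩
  have hRolle : RolleIdentity G (a.re - (a.im + δ)) (a.re + (a.im + δ)) (a.im + δ) :=
    rolleIdentity_of_localB_core hG.diff hG.real hW hB
  -- every critical point in the open disc is real — else it is a `NestedStep` child (excluded)
  have hA : ∀ ρ ∈ ball ((a.re : ℝ) : ℂ) (a.im + δ), deriv G ρ = 0 → ρ.im = 0 := by
    intro ρ hρ hdρ
    by_contra hρim
    have hρ' : ‖ρ - (a.re : ℂ)‖ < a.im + m' := by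
      rw [mem_ball, dist_eq_norm] at hρ; linarith
    have hdρ' : iteratedDeriv (j + 1) f ρ = 0 := by rw [← e1]; exact hdρ
    exact hnoC ρ hdρ' hρim (hchild ρ hdρ' hρim hρ')
  -- the census with surplus on the circle (no ascending bad arc at this `δ`), and the disc Rolle closure: `a` is a non-real zero
  obtain ⟨n, hc⟩ := disc_census_ge hG.diff hG.real hr hG0 hdG0 (hna δ ⟨⟨hδ0, hδd0⟩, hδE⟩)
  have hall := no_nonreal_zero_of_disc_ge hG.diff hr hGα hGβ hdGα hdGβ hG0 hc hA hRolle
  have haball : a ∈ ball ((a.re : ℝ) : ℂ) (a.im + δ) := by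
    rw [mem_ball, dist_eq_norm]
    have e : a - (a.re : ℂ) = ((a.im : ℝ) : ℂ) * I := Complex.ext (by simp) (by simp)
    rw [e, norm_mul, Complex.norm_real, Complex.norm_I, mul_one, Real.norm_eq_abs, abs_of_pos hapos]
    linarith
  exact absurd (hall a haball ha) hapos.ne'

/-- ★★★ RUNG 2 (`PinningOfNoAscendingArc`, the statement typed in part C): pinning from «no ascending bad arc on all small circles». -/
theorem pinning_of_noAscendingArc : PinningOfNoAscendingArc :=
  fun _ _ _ _ _ _ _ _ hE _ _ ha hapos hNA => pinning_of_noAscendingArc_cofinite hE ha hapos (arcNoAscCofinite_of_arcNoAsc hNA)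

/-- ★ After RUNG 2 the law reduces to its ascending residual: `TopPinningAscResidual → TopPinning`. -/
theorem topPinning_of_ascResidual (h3 : TopPinningAscResidual) : TopPinning :=
  topPinning_of_rung2 pinning_of_noAscendingArc h3

/-- ★ … and `TopPinningCrossing` likewise. -/
theorem topPinningCrossing_of_ascResidual (h3 : TopPinningAscResidual) : TopPinningCrossing :=
  topPinningCrossing_of_arcResidual (arcResidual_of_rung2 pinning_of_noAscendingArc h3)

/-- RUNG 1 recovered from RUNG 2 (consistency check; the tree keeps `pinning_of_arcSignClear` as the direct proof). -/
theorem pinning_of_arcSignClear' {η : ℝ} {f : ℂ → ℂ} {x₀ s hmax R Hs : ℝ} {B : ℕ} (hE : EngineHyps5 2 η f x₀ s hmax R Hs B)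
    {j : ℕ} {a : ℂ} (ha : iteratedDeriv j f a = 0) (hapos : 0 < a.im) (hS : ArcSignClear f j a) :
    (∃ w : ℂ, iteratedDeriv (j + 1) f w = 0 ∧ w.im ≠ 0 ∧ NestedStep a w) ∨ (∃ x : ℝ, |x - a.re| ≤ a.im ∧ NLEventOf f j x) :=
  rung1_of_rung2 pinning_of_noAscendingArc hE ha hapos hS

end RhW08.Lens1ArcSign


-- ======== ArcSignF-v2 393449573115a643 (import lines stripped) ========

/-!
# TiltedLandingLaw421R3 — lens-1: RUNG 3 of the arc-sign ladder TYPED in COUNT currency (part F, statements first)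

LENS-1 gen-6 module image `rh33346-cover/lens-1/ArcSignF-v2.lean` (v2 = v1 with the count law over the NON-REAL zero count) (landing target `…/Theorems/TiltedLandingLaw421R3Lens1ArcSignF.lean`; single import =
part E; namespace `RhW08.Lens1ArcSign`; 0 `sorry`, no instances / notation).  Memo `O6d-RUNG3-COUNT-MEMO-v1.md` (O6-d, (CA569)).

THE WORD OF A CIRCLE.  On `C_δ : |w − Re a| = Im a + δ` the upper semicircle `t ∈ [0, ½]` (`arcPhi`, part C) is cut at the real points of
`φ = f^{(j+1)}/f^{(j)}` into GOOD pieces (`Im φ < 0`) and BAD pieces (`Im φ > 0`); a bad piece from `Re φ < 0` to `Re φ > 0` is ASCENDING, from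
`Re φ > 0` to `Re φ < 0` DESCENDING (`ascStarts`, `descStarts` = their earlier end points).  Part Dʼs potential argument gives the EXACT identity
`ch = U − #asc + #desc` on `LocalB` frames (`U` = upper zeros of `f^{(j)}` in the open disc with multiplicity = `1 + pz`; memo O6b (PIN)), of which
RUNG 2 used only `#asc = 0 ⇒ ch ≥ U ≥ 1`.

RUNG 3 (NET, `PinningOfNetNonAscending`): hypothesis `ArcNetNonAsc` = on all small circles outside a finite set of radii, `#asc ≤ #desc` — a statement
about the cyclic sign word of `φ` on `C_δ` alone (no children, no events, no components); conclusion = the `TopPinning` disjunction.  It contains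
RUNG 2 (`arcNetNonAsc_of_arcNoAscCofinite`) and pays the balanced class (T-ARC: the 35 `(asc, desc) = (1, 1)` cases of the 59).  CONVERSION
(`PinningOfArcCount`): hypothesis `ArcCountLaw` = `2(#asc − #desc) ≤ N − 2`, `N = nonrealZeroMult` = the non-real zeros of `f^{(j)}` in the open disc with
multiplicity (`= 2U` by conjugation), the census form of the law itself — typed as the FRAME in
which every pay rule (component currency, memo §3) is an inequality on the word; `rung3_of_arcCount`, `rung2_of_rung3` order the ladder.  Both are
OPEN in this image (proof = part G: the exact piece identity); the residual after RUNG 3 is `TopPinningNetAscResidual` with the exact split.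

HONEST LABEL: statements and bookkeeping only; `PinningOfNetNonAscending`, `PinningOfArcCount`, `TopPinningNetAscResidual`, `TopPinning`, 33346, 33347
are OPEN; nothing here bears on the truth of RH; RH is not proved; typed ≠ proved.
-/

noncomputable section

namespace RhW08.Lens1ArcSign

open Complex Set Metric Filter Topology
open scoped Real
open Literature.Topology.PlaneTopology Literature.Analysis.Complex
open Summit.RiemannHypothesis.RiemannHypothesis.Theorems.Splittings.JensenWindow
open RhIdea6.G17.W07C7 RhIdea6.G17.W07C7.Rev6 RhIdea6.G18.W07C8.Law421BirthS RhIdea6.G19.W07C11.Seam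
open RhIdea6.G20.W07C12.Frac RhIdea6.G20.W07C12.StColP RhW07.C12.FieldSplit RhIdea6.G21.W07C13.TentMax
open RhW07.C14.TwoSided RhW07.C14.Classes RhW07.C14.Lineage RhW07.C14.Booking
open RhW07.C13.Heredity RhIdea6.G22.W07C15pre.Injection RhW07.E3.Cell RhW07.E3.Lit
open RhW08.Round1 RhW08.StSwap RhW08.Round2 RhW08.QuadW RhW08.SealSwapQ RhW08.SealSwap RhW08.SuccB RhW08.SuccSplit
open RhW08.SuccTheft RhW08.Column RhW08.Hurwitz RhW08.ClusterQ RhW08.ClusterQM RhW08.NewtonDoor RhW08.NewtonDoorGenusOne RhW08.PurseP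
open RhW08.Lens1SignCut RhW08.Lens1Coverage RhW08.IsolatedTilt RhW08.Lens1Pinning RhW08.Lens1PinningIso

/-! ## §1 The pieces of the upper semicircle and their counts -/

/-- A BAD PIECE `(t₁, t₂) ⊆ [0, ½]` of the circle of radius `Im a + δ`: `Im φ > 0` strictly inside, `φ` real at both ends (consecutive real points of
`φ`, touching zeros of `Im φ` included — the counts below are partition-invariant). -/
def BadPiece (f : ℂ → ℂ) (j : ℕ) (a : ℂ) (δ t₁ t₂ : ℝ) : Prop :=
  0 ≤ t₁ ∧ t₁ < t₂ ∧ t₂ ≤ 1 / 2 ∧ (∀ t ∈ Ioo t₁ t₂, 0 < (arcPhi f j a δ t).im) ∧ (arcPhi f j a δ t₁).im = 0 ∧ (arcPhi f j a δ t₂).im = 0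

/-- Earlier end points of the ASCENDING bad pieces (`Re φ < 0` at `t₁`, `Re φ > 0` at `t₂`). -/
def ascStarts (f : ℂ → ℂ) (j : ℕ) (a : ℂ) (δ : ℝ) : Set ℝ :=
  {t₁ | ∃ t₂, BadPiece f j a δ t₁ t₂ ∧ (arcPhi f j a δ t₁).re < 0 ∧ 0 < (arcPhi f j a δ t₂).re}

/-- Earlier end points of the DESCENDING bad pieces (`Re φ > 0` at `t₁`, `Re φ < 0` at `t₂`). -/
def descStarts (f : ℂ → ℂ) (j : ℕ) (a : ℂ) (δ : ℝ) : Set ℝ :=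
  {t₁ | ∃ t₂, BadPiece f j a δ t₁ t₂ ∧ 0 < (arcPhi f j a δ t₁).re ∧ (arcPhi f j a δ t₂).re < 0}

/-- Non-real zeros of `G` in the open disc `|w − c| < r`, with multiplicity — the censusʼs `N_D(G) − N_D^ℝ(G)`; for real `G = f^{(j)}`, `c = Re a`,
`r = Im a + δ` small it is `2U = 2(1 + pz)` (`a`, the interior foreign upper zeros, and their conjugates). -/
def nonrealZeroMult (G : ℂ → ℂ) (c r : ℝ) : ℤ :=
  ∑ᶠ ρ ∈ {ρ : ℂ | G ρ = 0 ∧ ρ ∈ ball (c : ℂ) r ∧ ρ.im ≠ 0}, (meromorphicOrderAt G ρ).untop₀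

/-- RUNG-3 HYPOTHESIS at radius excess `δ` (NET NON-ASCENT): finitely many ascending bad pieces, and at most as many as descending ones. -/
def NetNonAscending (f : ℂ → ℂ) (j : ℕ) (a : ℂ) (δ : ℝ) : Prop :=
  (ascStarts f j a δ).Finite ∧ (ascStarts f j a δ).ncard ≤ (descStarts f j a δ).ncard

/-- `ArcNetNonAsc f j a`: net non-ascent on every small circle outside a finite set of radii. -/
def ArcNetNonAsc (f : ℂ → ℂ) (j : ℕ) (a : ℂ) : Prop :=
  ∃ d0 > 0, ∃ E : Set ℝ, E.Finite ∧ ∀ δ ∈ Ioo 0 d0 \ E, NetNonAscending f j a δ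

/-- COUNT-LAW HYPOTHESIS at `δ`: `2(#asc − #desc) ≤ N − 2` (`N = nonrealZeroMult`, i.e. `#asc − #desc ≤ pz`), the census form of `ch ≥ 1`. -/
def ArcCountIneq (f : ℂ → ℂ) (j : ℕ) (a : ℂ) (δ : ℝ) : Prop :=
  (ascStarts f j a δ).Finite ∧
    2 * (((ascStarts f j a δ).ncard : ℤ) - (descStarts f j a δ).ncard) ≤ nonrealZeroMult (iteratedDeriv j f) a.re (a.im + δ) - 2

/-- `ArcCountLaw f j a`: the count inequality on every small circle outside a finite set of radii. -/
def ArcCountLaw (f : ℂ → ℂ) (j : ℕ) (a : ℂ) : Prop :=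
  ∃ d0 > 0, ∃ E : Set ℝ, E.Finite ∧ ∀ δ ∈ Ioo 0 d0 \ E, ArcCountIneq f j a δ

/-- ★ RUNG 3 (STATEMENT; OPEN in this image): net non-ascent on the small circles ⇒ the `TopPinning` disjunction. -/
def PinningOfNetNonAscending : Prop :=
  ∀ (η : ℝ) (f : ℂ → ℂ) (x₀ s hmax R Hs : ℝ) (B : ℕ), EngineHyps5 2 η f x₀ s hmax R Hs B → ∀ (j : ℕ) (a : ℂ),
    iteratedDeriv j f a = 0 → 0 < a.im → ArcNetNonAsc f j a →
    (∃ w : ℂ, iteratedDeriv (j + 1) f w = 0 ∧ w.im ≠ 0 ∧ NestedStep a w) ∨ (∃ x : ℝ, |x - a.re| ≤ a.im ∧ NLEventOf f j x)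

/-- ★ CONVERSION (STATEMENT; OPEN in this image): the count law on the small circles ⇒ the `TopPinning` disjunction. -/
def PinningOfArcCount : Prop :=
  ∀ (η : ℝ) (f : ℂ → ℂ) (x₀ s hmax R Hs : ℝ) (B : ℕ), EngineHyps5 2 η f x₀ s hmax R Hs B → ∀ (j : ℕ) (a : ℂ),
    iteratedDeriv j f a = 0 → 0 < a.im → ArcCountLaw f j a →
    (∃ w : ℂ, iteratedDeriv (j + 1) f w = 0 ∧ w.im ≠ 0 ∧ NestedStep a w) ∨ (∃ x : ℝ, |x - a.re| ≤ a.im ∧ NLEventOf f j x)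

/-! ## §2 The ladder is ordered: RUNG 2 ⊆ RUNG 3 ⊆ CONVERSION -/

/-- No ascending bad arc ⇒ no ascending piece. -/
theorem ascStarts_eq_empty_of_noAscendingArc {f : ℂ → ℂ} {j : ℕ} {a : ℂ} {δ : ℝ} (h : NoAscendingArc f j a δ) : ascStarts f j a δ = ∅ := by
  ext t₁
  simp only [ascStarts, mem_setOf_eq, mem_empty_iff_false, iff_false, not_exists, not_and]
  intro t₂ hB hre₁ hre₂
  obtain ⟨h₁, h12, h₂, hpos, him₁, him₂⟩ := hB
  exact h t₁ t₂ h₁ h12 h₂ hpos him₁ him₂ ⟨hre₁, hre₂⟩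

/-- RUNG 2ʼs hypothesis at `δ` ⇒ RUNG 3ʼs. -/
theorem netNonAscending_of_noAscendingArc {f : ℂ → ℂ} {j : ℕ} {a : ℂ} {δ : ℝ} (h : NoAscendingArc f j a δ) : NetNonAscending f j a δ := by
  refine ⟨?_, ?_⟩ <;> rw [ascStarts_eq_empty_of_noAscendingArc h]
  · exact Set.finite_empty
  · simp

/-- `ArcNoAscCofinite ⇒ ArcNetNonAsc` (hence `ArcNoAsc ⇒ ArcNetNonAsc`). -/
theorem arcNetNonAsc_of_arcNoAscCofinite {f : ℂ → ℂ} {j : ℕ} {a : ℂ} (h : ArcNoAscCofinite f j a) : ArcNetNonAsc f j a := by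
  obtain ⟨d0, hd0, E, hE, hna⟩ := h
  exact ⟨d0, hd0, E, hE, fun δ hδ => netNonAscending_of_noAscendingArc (hna δ hδ)⟩

/-- ★ RUNG 3 ⇒ RUNG 2 (cofinite form, hence `PinningOfNoAscendingArc`). -/
theorem rung2_of_rung3 (h3 : PinningOfNetNonAscending) : PinningOfNoAscendingArc :=
  fun η f x₀ s hmax R Hs B hE j a ha hapos hNA =>
    h3 η f x₀ s hmax R Hs B hE j a ha hapos (arcNetNonAsc_of_arcNoAscCofinite (arcNoAscCofinite_of_arcNoAsc hNA))

/-- Net non-ascent ⇒ the count inequality, as soon as `N ≥ 2`. -/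
theorem arcCountIneq_of_netNonAscending {f : ℂ → ℂ} {j : ℕ} {a : ℂ} {δ : ℝ} (hU : 2 ≤ nonrealZeroMult (iteratedDeriv j f) a.re (a.im + δ))
    (h : NetNonAscending f j a δ) : ArcCountIneq f j a δ := by
  refine ⟨h.1, ?_⟩
  have h2 : ((ascStarts f j a δ).ncard : ℤ) ≤ (descStarts f j a δ).ncard := by exact_mod_cast h.2
  linarith

/-- For an entire `G ≢ 0`, orders are non-negative and positive at zeros. -/
theorem untop₀_order_pos {G : ℂ → ℂ} (hG : Differentiable ℂ G) (hne : G ≠ 0) {ρ : ℂ} (h0 : G ρ = 0) :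
    0 < (meromorphicOrderAt G ρ).untop₀ := by
  have han : AnalyticAt ℂ G ρ := hG.analyticAt ρ
  have hnot : analyticOrderAt G ρ ≠ ⊤ := by
    intro htop
    rw [analyticOrderAt_eq_top] at htop
    apply hne
    funext w
    exact (hG.differentiableOn.analyticOnNhd isOpen_univ).eqOn_zero_of_preconnected_of_eventuallyEq_zero isPreconnected_univ (mem_univ ρ) htop
      (mem_univ w)
  rw [han.meromorphicOrderAt_eq]
  cases hq : analyticOrderAt G ρ with
  | top => exact absurd hq hnot
  | coe n =>
    have hn : n ≠ 0 := by
      intro hn0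
      rw [hn0] at hq
      exact ((han.analyticOrderAt_eq_zero).mp (by exact_mod_cast hq)) h0
    have : 0 < n := Nat.pos_of_ne_zero hn
    simpa using this

/-- `N ≥ 2` on every disc containing the upper zero `a` of a real `G ≢ 0` (`a` and `conj a`). -/
theorem two_le_nonrealZeroMult {G : ℂ → ℂ} (hG : Differentiable ℂ G) (hne : G ≠ 0) (hreal : ∀ x : ℝ, (G x).im = 0) {a : ℂ} (ha : G a = 0)
    (hapos : 0 < a.im) {δ : ℝ} (hδ : 0 < δ) : 2 ≤ nonrealZeroMult G a.re (a.im + δ) := by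
  classical
  have hr : 0 < a.im + δ := by linarith
  set L : ℝ := a.im + δ + 1 with hL
  have hz₀ : ((a.re : ℂ)) ∈ Ioo (a.re - L) (a.re + L) ×ℂ Ioo (-((a.im + δ) + 1)) ((a.im + δ) + 1) :=
    ofReal_mem_box (by rw [sub_self, abs_zero]; linarith) hr.le
  have hfin : {ρ : ℂ | G ρ = 0 ∧ ρ ∈ ball (a.re : ℂ) (a.im + δ) ∧ ρ.im ≠ 0}.Finite := by
    refine (finite_zeros_box hG hne hz₀).subset ?_
    rintro ρ ⟨h0, hρ, -⟩
    refine ⟨h0, ?_⟩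
    rw [mem_ball, dist_eq_norm] at hρ
    have h1 := abs_re_le_norm (ρ - (a.re : ℂ))
    have h2 := abs_im_le_norm (ρ - (a.re : ℂ))
    rw [sub_re, ofReal_re, abs_le] at h1
    rw [sub_im, ofReal_im, sub_zero, abs_le] at h2
    exact mem_reProdIm.2 ⟨⟨by linarith [h1.1], by linarith [h1.2]⟩, ⟨by linarith [h2.1], by linarith [h2.2]⟩⟩
  have hnorm : ∀ w : ℂ, w.re = a.re → |w.im| = a.im → w ∈ ball ((a.re : ℝ) : ℂ) (a.im + δ) := by
    intro w hre him
    rw [mem_ball, dist_eq_norm]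
    have e : w - (a.re : ℂ) = ((w.im : ℝ) : ℂ) * I := Complex.ext (by simp [hre]) (by simp)
    rw [e, norm_mul, Complex.norm_real, Complex.norm_I, mul_one, Real.norm_eq_abs, him]
    linarith
  have haS : a ∈ hfin.toFinset := by
    rw [Set.Finite.mem_toFinset]
    exact ⟨ha, hnorm a rfl (abs_of_pos hapos), hapos.ne'⟩
  have hbS : (starRingEnd ℂ) a ∈ hfin.toFinset := by
    rw [Set.Finite.mem_toFinset]
    refine ⟨by rw [apply_conj_eq_conj hG hreal, ha, map_zero], hnorm _ (by simp) (by simp [abs_of_pos hapos]), ?_⟩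
    simpa using hapos.ne'
  have hab : a ≠ (starRingEnd ℂ) a := fun h => by
    have := congrArg Complex.im h
    simp at this; linarith
  unfold nonrealZeroMult
  rw [finsum_mem_eq_finite_toFinset_sum _ hfin]
  have hpos : ∀ ρ ∈ hfin.toFinset, 0 < (meromorphicOrderAt G ρ).untop₀ := by
    intro ρ hρ
    rw [Set.Finite.mem_toFinset] at hρ
    exact untop₀_order_pos hG hne hρ.1
  have hsub : ({a, (starRingEnd ℂ) a} : Finset ℂ) ⊆ hfin.toFinset := by
    intro ρ hρ
    rcases Finset.mem_insert.1 hρ with rfl | hρ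
    · exact haS
    · rw [Finset.mem_singleton.1 hρ]; exact hbS
  have h1 := Finset.sum_le_sum_of_subset_of_nonneg hsub (fun ρ hρ _ => (hpos ρ hρ).le)
  rw [Finset.sum_pair hab] at h1
  have h2 := hpos a haS
  have h3 := hpos _ hbS
  omega

/-- ★ CONVERSION ⇒ RUNG 3 (the degenerate frame `f^{(j)} ≡ 0` is settled by the child `w = a`). -/
theorem rung3_of_arcCount (hC : PinningOfArcCount) : PinningOfNetNonAscending := by
  intro η f x₀ s hmax R Hs B hE j a ha hapos hN
  classical
  by_cases hnz : iteratedDeriv j f = 0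
  · left
    refine ⟨a, ?_, hapos.ne', ?_⟩
    · rw [iteratedDeriv_succ, hnz]; simp
    · show (a.re - a.re) ^ 2 + a.im ^ 2 ≤ a.im ^ 2
      simp
  have hf : RealEntireLt2 f := realEntireLt2_of_hyps hE
  have hGd : Differentiable ℂ (iteratedDeriv j f) := differentiable_iteratedDeriv_of_entire hf.diff j
  have hGreal : ∀ x : ℝ, (iteratedDeriv j f x).im = 0 := im_iteratedDeriv_ofReal hf.diff hf.real j
  obtain ⟨d0, hd0, E, hEfin, hna⟩ := hN
  refine hC η f x₀ s hmax R Hs B hE j a ha hapos ⟨d0, hd0, E, hEfin, fun δ hδ => ?_⟩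
  exact arcCountIneq_of_netNonAscending (two_le_nonrealZeroMult hGd hnz hGreal ha hapos hδ.1.1) (hna δ hδ)

/-! ## §3 The typed residual after RUNG 3 and the exact split -/

/-- The NET-ASCENDING residual of the law: zeros with crossing mates, not arc-sign clear, with an ascending arc on arbitrarily small circles, and
NOT net non-ascending (`¬ ArcNetNonAsc`).  OPEN; in component currency (memo §3) its pay is «a net-ascending `Ω_a` borders an interior zero». -/
def TopPinningNetAscResidual : Prop :=
  ∀ (η : ℝ) (f : ℂ → ℂ) (x₀ s hmax R Hs : ℝ) (B : ℕ), EngineHyps5 2 η f x₀ s hmax R Hs B → ∀ (j : ℕ) (a : ℂ),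
    iteratedDeriv j f a = 0 → 0 < a.im → NoTallerToucher f j a → ¬ JensenIsolated f j a → ¬ ArcSignClear f j a → ¬ ArcNoAsc f j a →
    ¬ ArcNetNonAsc f j a →
    (∃ w : ℂ, iteratedDeriv (j + 1) f w = 0 ∧ w.im ≠ 0 ∧ NestedStep a w) ∨ (∃ x : ℝ, |x - a.re| ≤ a.im ∧ NLEventOf f j x)

/-- ★ EXACT SPLIT: RUNG 3 and the net-ascending residual give the ascending residual (hence, with RUNG 2, the law). -/
theorem ascResidual_of_rung3 (h3 : PinningOfNetNonAscending) (h4 : TopPinningNetAscResidual) : TopPinningAscResidual := by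
  intro η f x₀ s hmax R Hs B hE j a ha hapos hN hJ hS hA
  by_cases hM : ArcNetNonAsc f j a
  · exact h3 η f x₀ s hmax R Hs B hE j a ha hapos hM
  · exact h4 η f x₀ s hmax R Hs B hE j a ha hapos hN hJ hS hA hM

/-- ★ The law from RUNG 3 and the net-ascending residual (RUNG 2 is implied). -/
theorem topPinning_of_rung3 (h3 : PinningOfNetNonAscending) (h4 : TopPinningNetAscResidual) : TopPinning :=
  topPinning_of_rung2 (rung2_of_rung3 h3) (ascResidual_of_rung3 h3 h4)

/-- Converse (bookkeeping): the split is exact. -/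
theorem netAscResidual_of_topPinning (hP : TopPinning) : TopPinningNetAscResidual :=
  fun η f x₀ s hmax R Hs B hE j a ha hapos hN _ _ _ _ => hP η f x₀ s hmax R Hs B hE j a ha hapos hN

/-- The conversion closes the ladder: `PinningOfArcCount` and the net-ascending residual give the law. -/
theorem topPinning_of_arcCount (hC : PinningOfArcCount) (h4 : TopPinningNetAscResidual) : TopPinning :=
  topPinning_of_rung3 (rung3_of_arcCount hC) h4

end RhW08.Lens1ArcSign


-- ======== ArcSignG-v1 1e2e6be04c38cd8d (import lines stripped) ========

/-!
# TiltedLandingLaw421R3 — lens-1: the EXACT word identity of a loop (part G: `2·wind Γ = σ(½) − σ(0) + 4(#desc − #asc)`)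

LENS-1 gen-6 module image `rh33346-cover/lens-1/ArcSignG-v1.lean` (landing target `…/Theorems/TiltedLandingLaw421R3Lens1ArcSignG.lean`; single import =
part F; namespace `RhW08.Lens1ArcSign`; 0 `sorry`, no instances / notation; checked BY CHAIN over the ArcSign A–F images until tree).

Part D proved the potential INEQUALITY (no ascending piece ⇒ surplus `n ≥ 0`).  Here the same strong induction along the finitely many real points of
the upper half `[0, ½]` of a loop `Γ` is run with EQUALITY and a signed count (memo O6d §1 (WORD)):
  `Im (l(½) − l(0)) = (π/2)(σ(½) − σ(0)) + 2π(#desc − #asc)`,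
where `#asc` / `#desc` (`ascSet Γ`, `descSet Γ` — generic in `Γ`; for `Γ = arcPhi f j a δ` they ARE part Fʼs `ascStarts` / `descStarts`, by `rfl`) count
the bad pieces between CONSECUTIVE real points of `Γ` that go from `Re Γ < 0` to `Re Γ > 0` / the other way.  For a conjugation-symmetric zero-free
loop this gives `2·wind Γ = sgn Re Γ(½) − sgn Re Γ(0) + 4(#desc − #asc)` exactly (`two_mul_wind_eq_count`; the flat case has no pieces).

CONTENT: §1 `ascSet`, `descSet`, `ascStarts_eq_ascSet`, `descStarts_eq_descSet`, `ascSet_subset`, `descSet_subset` · §2 `card_filter_le_step` ·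
§3 ★ `im_incr_eq_count` · §4 ★ `two_mul_wind_eq_count`.  Part H turns it into the disc census with count and proves RUNG 3 and the CONVERSION.

HONEST LABEL: loop bookkeeping only; `PinningOfNetNonAscending` / `PinningOfArcCount` are proved in part H; `TopPinning`, 33346, 33347 OPEN; nothing
here bears on the truth of RH; RH is not proved; checked ≠ proved.
-/

noncomputable section

namespace RhW08.Lens1ArcSign

open Complex Set Metric Filter Topology
open scoped Real
open Literature.Topology.PlaneTopology Literature.Analysis.Complex
open Summit.RiemannHypothesis.RiemannHypothesis.Theorems.Splittings.JensenWindow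

/-! ## §1 Ascending / descending pieces of a loop -/

/-- Earlier end points of the ASCENDING bad pieces of the upper half of a loop `Γ` (generic form of part Fʼs `ascStarts`). -/
def ascSet (Γ : ℝ → ℂ) : Set ℝ :=
  {t₁ | ∃ t₂, (0 ≤ t₁ ∧ t₁ < t₂ ∧ t₂ ≤ 1 / 2 ∧ (∀ t ∈ Ioo t₁ t₂, 0 < (Γ t).im) ∧ (Γ t₁).im = 0 ∧ (Γ t₂).im = 0) ∧
    (Γ t₁).re < 0 ∧ 0 < (Γ t₂).re}

/-- Earlier end points of the DESCENDING bad pieces of the upper half of a loop `Γ`. -/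
def descSet (Γ : ℝ → ℂ) : Set ℝ :=
  {t₁ | ∃ t₂, (0 ≤ t₁ ∧ t₁ < t₂ ∧ t₂ ≤ 1 / 2 ∧ (∀ t ∈ Ioo t₁ t₂, 0 < (Γ t).im) ∧ (Γ t₁).im = 0 ∧ (Γ t₂).im = 0) ∧
    0 < (Γ t₁).re ∧ (Γ t₂).re < 0}

/-- Part Fʼs `ascStarts` is `ascSet` of `arcPhi` (definitionally). -/
theorem ascStarts_eq_ascSet (f : ℂ → ℂ) (j : ℕ) (a : ℂ) (δ : ℝ) : ascStarts f j a δ = ascSet (arcPhi f j a δ) := rfl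

/-- Part Fʼs `descStarts` is `descSet` of `arcPhi` (definitionally). -/
theorem descStarts_eq_descSet (f : ℂ → ℂ) (j : ℕ) (a : ℂ) (δ : ℝ) : descStarts f j a δ = descSet (arcPhi f j a δ) := rfl

/-- Ascending starts are real points of `Γ` in `[0, ½]`. -/
theorem ascSet_subset (Γ : ℝ → ℂ) : ascSet Γ ⊆ {t : ℝ | t ∈ Icc (0 : ℝ) (1 / 2) ∧ (Γ t).im = 0} := by
  rintro t₁ ⟨t₂, ⟨h₁, h12, h₂, -, him, -⟩, -, -⟩
  exact ⟨⟨h₁, by linarith⟩, him⟩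

/-- Descending starts are real points of `Γ` in `[0, ½]`. -/
theorem descSet_subset (Γ : ℝ → ℂ) : descSet Γ ⊆ {t : ℝ | t ∈ Icc (0 : ℝ) (1 / 2) ∧ (Γ t).im = 0} := by
  rintro t₁ ⟨t₂, ⟨h₁, h12, h₂, -, him, -⟩, -, -⟩
  exact ⟨⟨h₁, by linarith⟩, him⟩

/-! ## §2 Counting along consecutive points -/

/-- One step of the count along a finite set `Z ⊇ S`: if `t'` is the first point of `Z` after `t`, the members of `S` from `t` on are those from
`t'` on, plus `t` itself when `t ∈ S`. -/
theorem card_filter_le_step {S Z : Finset ℝ} (hSZ : S ⊆ Z) {t t' : ℝ} (htt' : t < t') (hmin : ∀ s ∈ Z, t < s → t' ≤ s) :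
    ((S.filter (fun u => t ≤ u)).card : ℝ) = (S.filter (fun u => t' ≤ u)).card + (if t ∈ S then 1 else 0) := by
  classical
  by_cases ht : t ∈ S
  · have e : S.filter (fun u => t ≤ u) = insert t (S.filter (fun u => t' ≤ u)) := by
      ext u
      simp only [Finset.mem_filter, Finset.mem_insert]
      constructor
      · rintro ⟨huS, htu⟩
        rcases htu.eq_or_lt with h | h
        · exact Or.inl h.symm
        · exact Or.inr ⟨huS, hmin u (hSZ huS) h⟩
      · rintro (rfl | ⟨huS, h⟩)
        · exact ⟨ht, le_rfl⟩
        · exact ⟨huS, htt'.le.trans h⟩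
    have hnot : t ∉ S.filter (fun u => t' ≤ u) := by
      simp only [Finset.mem_filter, not_and, not_le]
      exact fun _ => htt'
    rw [e, Finset.card_insert_of_notMem hnot, if_pos ht]
    push_cast; ring
  · have e : S.filter (fun u => t ≤ u) = S.filter (fun u => t' ≤ u) := by
      ext u
      simp only [Finset.mem_filter]
      constructor
      · rintro ⟨huS, htu⟩
        have hneq : t ≠ u := fun h => ht (h ▸ huS)
        exact ⟨huS, hmin u (hSZ huS) (lt_of_le_of_ne htu hneq)⟩
      · rintro ⟨huS, h⟩
        exact ⟨huS, htt'.le.trans h⟩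
    rw [e, if_neg ht, add_zero]

/-! ## §3 The exact potential identity -/

/-- ★ EXACT WORD IDENTITY (partition form of `two_mul_wind_eq`, with equality).  `Γ` continuous and zero-free on `[0, ½]` with real ends and
finitely many real points, `l` a continuous logarithm ⇒ `Im (l(½) − l(0)) = (π/2)(σ(½) − σ(0)) + 2π(#desc − #asc)`, both counts finite. -/
theorem im_incr_eq_count {Γ l : ℝ → ℂ} (hΓ : ContinuousOn Γ (Icc 0 (1 / 2))) (hl : ContinuousOn l (Icc 0 (1 / 2)))
    (hexp : ∀ t ∈ Icc (0 : ℝ) (1 / 2), exp (l t) = Γ t) (hne : ∀ t ∈ Icc (0 : ℝ) (1 / 2), Γ t ≠ 0)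
    (h0 : (Γ 0).im = 0) (hh : (Γ (1 / 2)).im = 0) (hfin : {t : ℝ | t ∈ Icc (0 : ℝ) (1 / 2) ∧ (Γ t).im = 0}.Finite) :
    (ascSet Γ).Finite ∧ (descSet Γ).Finite ∧
      (l (1 / 2)).im - (l 0).im = π / 2 * ((zsgn (Γ (1 / 2)).re : ℝ) - (zsgn (Γ 0).re : ℝ)) +
        2 * π * (((descSet Γ).ncard : ℝ) - ((ascSet Γ).ncard : ℝ)) := by
  classical
  have hAfin : (ascSet Γ).Finite := hfin.subset (ascSet_subset Γ)
  have hDfin : (descSet Γ).Finite := hfin.subset (descSet_subset Γ)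
  refine ⟨hAfin, hDfin, ?_⟩
  set Z : Finset ℝ := hfin.toFinset with hZ
  have hmemZ : ∀ t, t ∈ Z ↔ t ∈ Icc (0 : ℝ) (1 / 2) ∧ (Γ t).im = 0 := fun t => by
    rw [hZ, Set.Finite.mem_toFinset]; rfl
  set A : Finset ℝ := hAfin.toFinset with hA
  set D : Finset ℝ := hDfin.toFinset with hD
  have hmemA : ∀ t, t ∈ A ↔ t ∈ ascSet Γ := fun t => by rw [hA, Set.Finite.mem_toFinset]
  have hmemD : ∀ t, t ∈ D ↔ t ∈ descSet Γ := fun t => by rw [hD, Set.Finite.mem_toFinset]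
  have hAZ : A ⊆ Z := fun t ht => (hmemZ t).2 (ascSet_subset Γ ((hmemA t).1 ht))
  have hDZ : D ⊆ Z := fun t ht => (hmemZ t).2 (descSet_subset Γ ((hmemD t).1 ht))
  have hcardA : ((ascSet Γ).ncard : ℝ) = (A.filter (fun u => (0 : ℝ) ≤ u)).card := by
    have e : A.filter (fun u => (0 : ℝ) ≤ u) = A := Finset.filter_true_of_mem fun u hu => ((hmemZ u).1 (hAZ hu)).1.1
    rw [e, hA, ← Set.ncard_eq_toFinset_card _ hAfin]
  have hcardD : ((descSet Γ).ncard : ℝ) = (D.filter (fun u => (0 : ℝ) ≤ u)).card := by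
    have e : D.filter (fun u => (0 : ℝ) ≤ u) = D := Finset.filter_true_of_mem fun u hu => ((hmemZ u).1 (hDZ hu)).1.1
    rw [e, hD, ← Set.ncard_eq_toFinset_card _ hDfin]
  have hhalf : (1 / 2 : ℝ) ∈ Z := (hmemZ _).2 ⟨⟨by norm_num, le_rfl⟩, hh⟩
  have hzero : (0 : ℝ) ∈ Z := (hmemZ _).2 ⟨⟨le_rfl, by norm_num⟩, h0⟩
  suffices H : ∀ n : ℕ, ∀ t ∈ Z, (Z.filter (fun s => t < s)).card = n →
      (l (1 / 2)).im - (l t).im = π / 2 * ((zsgn (Γ (1 / 2)).re : ℝ) - (zsgn (Γ t).re : ℝ)) +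
        2 * π * (((D.filter (fun u => t ≤ u)).card : ℝ) - ((A.filter (fun u => t ≤ u)).card : ℝ)) by
    rw [hcardA, hcardD]; exact H _ 0 hzero rfl
  intro n
  induction n using Nat.strong_induction_on with
  | _ n ih =>
  intro t ht hcard
  obtain ⟨⟨ht0, hth⟩, htim⟩ := (hmemZ t).1 ht
  -- no piece starts at or after `½`
  have hlate : ∀ S : Finset ℝ, (∀ u, u ∈ S ↔ u ∈ ascSet Γ) ∨ (∀ u, u ∈ S ↔ u ∈ descSet Γ) →
      S.filter (fun u => (1 / 2 : ℝ) ≤ u) = ∅ := by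
    intro S hS
    refine Finset.filter_false_of_mem fun u hu => ?_
    rcases hS with hS | hS
    · obtain ⟨t₂, ⟨-, h12, h₂, -⟩, -⟩ := (hS u).1 hu
      push Not; linarith
    · obtain ⟨t₂, ⟨-, h12, h₂, -⟩, -⟩ := (hS u).1 hu
      push Not; linarith
  rcases hth.eq_or_lt with rfl | hlt
  · rw [hlate A (Or.inl hmemA), hlate D (Or.inr hmemD)]
    simp
  have hne' : (Z.filter (fun s => t < s)).Nonempty := ⟨1 / 2, Finset.mem_filter.2 ⟨hhalf, hlt⟩⟩
  obtain ⟨ht'Z, htt'⟩ := Finset.mem_filter.1 (Finset.min'_mem _ hne')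
  set t' : ℝ := (Z.filter (fun s => t < s)).min' hne' with ht'
  obtain ⟨⟨-, ht'h⟩, ht'im⟩ := (hmemZ t').1 ht'Z
  have hmin : ∀ s ∈ Z, t < s → t' ≤ s := fun s hs hts => Finset.min'_le _ _ (Finset.mem_filter.2 ⟨hs, hts⟩)
  have hsub : Icc t t' ⊆ Icc (0 : ℝ) (1 / 2) := Icc_subset_Icc ht0 ht'h
  have hgap : ∀ s ∈ Ioo t t', (Γ s).im ≠ 0 := by
    intro s hs h0s
    have hsZ : s ∈ Z := (hmemZ s).2 ⟨⟨ht0.trans hs.1.le, hs.2.le.trans ht'h⟩, h0s⟩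
    exact absurd (hmin s hsZ hs.1) (not_le.2 hs.2)
  have hcard' : (Z.filter (fun s => t' < s)).card < n := by
    rw [← hcard]
    refine Finset.card_lt_card ⟨fun s hs => ?_, fun hss => ?_⟩
    · obtain ⟨hsZ, hs⟩ := Finset.mem_filter.1 hs
      exact Finset.mem_filter.2 ⟨hsZ, htt'.trans hs⟩
    · exact lt_irrefl _ (Finset.mem_filter.1 (hss (Finset.min'_mem _ hne'))).2
  have IH := ih _ hcard' t' ht'Z rfl
  have hstepA := card_filter_le_step hAZ htt' hmin
  have hstepD := card_filter_le_step hDZ htt' hmin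
  have hret : (Γ t).re ≠ 0 := fun h => hne t ⟨ht0, hth⟩ (Complex.ext (by simpa using h) (by simpa using htim))
  have hret' : (Γ t').re ≠ 0 := fun h => hne t' ⟨ht0.trans htt'.le, ht'h⟩ (Complex.ext (by simpa using h) (by simpa using ht'im))
  have hcont : ContinuousOn (fun s => (Γ s).im) (Icc t t') := Complex.continuous_im.comp_continuousOn (hΓ.mono hsub)
  -- the end of any bad piece starting at `t` is `t'`
  have huniq : ∀ t₂, t < t₂ → t₂ ≤ 1 / 2 → (∀ s ∈ Ioo t t₂, 0 < (Γ s).im) → (Γ t₂).im = 0 → t₂ = t' := by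
    intro t₂ h12 h₂ hpos him₂
    have h2Z : t₂ ∈ Z := (hmemZ t₂).2 ⟨⟨ht0.trans h12.le, h₂⟩, him₂⟩
    have hle : t' ≤ t₂ := hmin t₂ h2Z h12
    rcases hle.lt_or_eq with hlt₂ | heq
    · exact absurd ht'im (hpos t' ⟨htt', hlt₂⟩).ne'
    · exact heq.symm
  rcases pos_or_neg_of_ne_zero hcont hgap with hpos | hneg
  · -- a BAD piece
    have hup : ∀ s ∈ Icc t t', 0 ≤ (Γ s).im := by
      intro s hs
      rcases hs.1.eq_or_lt with h1 | h1
      · rw [← h1, htim]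
      · rcases hs.2.lt_or_eq with h2 | h2
        · exact (hpos s ⟨h1, h2⟩).le
        · rw [h2, ht'im]
    have e := im_incr_piece_up htt'.le (hΓ.mono hsub) (hl.mono hsub) (fun s hs => hexp s (hsub hs))
      (fun s hs => hne s (hsub hs)) hup htim ht'im
    have hpiece : 0 ≤ t ∧ t < t' ∧ t' ≤ 1 / 2 ∧ (∀ s ∈ Ioo t t', 0 < (Γ s).im) ∧ (Γ t).im = 0 ∧ (Γ t').im = 0 :=
      ⟨ht0, htt', ht'h, hpos, htim, ht'im⟩
    have hAiff : t ∈ A ↔ (Γ t).re < 0 ∧ 0 < (Γ t').re := by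
      rw [hmemA]
      constructor
      · rintro ⟨t₂, ⟨-, h12, h₂, hp, -, him₂⟩, hre, hre₂⟩
        rw [huniq t₂ h12 h₂ hp him₂] at hre₂
        exact ⟨hre, hre₂⟩
      · rintro ⟨hre, hre'⟩
        exact ⟨t', hpiece, hre, hre'⟩
    have hDiff : t ∈ D ↔ 0 < (Γ t).re ∧ (Γ t').re < 0 := by
      rw [hmemD]
      constructor
      · rintro ⟨t₂, ⟨-, h12, h₂, hp, -, him₂⟩, hre, hre₂⟩
        rw [huniq t₂ h12 h₂ hp him₂] at hre₂
        exact ⟨hre, hre₂⟩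
      · rintro ⟨hre, hre'⟩
        exact ⟨t', hpiece, hre, hre'⟩
    have hσ : ((zsgn (Γ t').re : ℝ) - (zsgn (Γ t).re : ℝ)) =
        2 * ((if t ∈ A then (1 : ℝ) else 0) - (if t ∈ D then (1 : ℝ) else 0)) := by
      unfold zsgn
      by_cases h1 : 0 < (Γ t).re
      · by_cases h2 : 0 < (Γ t').re
        · rw [if_pos h1, if_pos h2, if_neg (fun h => (not_lt.2 (hAiff.1 h).1.le) h1), if_neg (fun h => (not_lt.2 (hDiff.1 h).2.le) h2)]
          push_cast; ring
        · rw [if_pos h1, if_neg h2, if_neg (fun h => (not_lt.2 (hAiff.1 h).1.le) h1),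
            if_pos (hDiff.2 ⟨h1, lt_of_le_of_ne (not_lt.1 h2) hret'⟩)]
          push_cast; ring
      · have h1' : (Γ t).re < 0 := lt_of_le_of_ne (not_lt.1 h1) hret
        by_cases h2 : 0 < (Γ t').re
        · rw [if_neg h1, if_pos h2, if_pos (hAiff.2 ⟨h1', h2⟩), if_neg (fun h => h1 (hDiff.1 h).1)]
          push_cast; ring
        · rw [if_neg h1, if_neg h2, if_neg (fun h => h2 (hAiff.1 h).2), if_neg (fun h => h1 (hDiff.1 h).1)]
          push_cast; ring
    rw [hstepA, hstepD]
    linear_combination IH + e - π * hσ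
  · -- a GOOD piece: no piece starts at `t`
    have hdown : ∀ s ∈ Icc t t', (Γ s).im ≤ 0 := by
      intro s hs
      rcases hs.1.eq_or_lt with h1 | h1
      · rw [← h1, htim]
      · rcases hs.2.lt_or_eq with h2 | h2
        · exact (hneg s ⟨h1, h2⟩).le
        · rw [h2, ht'im]
    have e := im_incr_piece_down htt'.le (hΓ.mono hsub) (hl.mono hsub) (fun s hs => hexp s (hsub hs))
      (fun s hs => hne s (hsub hs)) hdown htim ht'im
    have hnostart : ∀ t₂, ¬ (t < t₂ ∧ t₂ ≤ 1 / 2 ∧ (∀ s ∈ Ioo t t₂, 0 < (Γ s).im) ∧ (Γ t₂).im = 0) := by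
      rintro t₂ ⟨h12, h₂, hp, him₂⟩
      have h := huniq t₂ h12 h₂ hp him₂
      subst h
      have hm : (t + t') / 2 ∈ Ioo t t' := ⟨by linarith, by linarith⟩
      exact absurd (hp _ hm) (not_lt.2 (hneg _ hm).le)
    have htA : t ∉ A := by
      rw [hmemA]
      rintro ⟨t₂, ⟨-, h12, h₂, hp, -, him₂⟩, -, -⟩
      exact hnostart t₂ ⟨h12, h₂, hp, him₂⟩
    have htD : t ∉ D := by
      rw [hmemD]
      rintro ⟨t₂, ⟨-, h12, h₂, hp, -, him₂⟩, -, -⟩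
      exact hnostart t₂ ⟨h12, h₂, hp, him₂⟩
    rw [hstepA, hstepD, if_neg htA, if_neg htD]
    linear_combination IH + e

/-! ## §4 The exact loop identity -/

/-- On a flat upper half there are no pieces. -/
theorem ascSet_eq_empty_of_flat {Γ : ℝ → ℂ} (hflat : ∀ t ∈ Icc (0 : ℝ) (1 / 2), (Γ t).im = 0) : ascSet Γ = ∅ := by
  ext t₁
  simp only [mem_empty_iff_false, iff_false]
  rintro ⟨t₂, ⟨h₁, h12, h₂, hp, -, -⟩, -, -⟩
  have hm : (t₁ + t₂) / 2 ∈ Ioo t₁ t₂ := ⟨by linarith, by linarith⟩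
  exact absurd (hflat _ ⟨by linarith, by linarith⟩) (hp _ hm).ne'

/-- On a flat upper half there are no pieces. -/
theorem descSet_eq_empty_of_flat {Γ : ℝ → ℂ} (hflat : ∀ t ∈ Icc (0 : ℝ) (1 / 2), (Γ t).im = 0) : descSet Γ = ∅ := by
  ext t₁
  simp only [mem_empty_iff_false, iff_false]
  rintro ⟨t₂, ⟨h₁, h12, h₂, hp, -, -⟩, -, -⟩
  have hm : (t₁ + t₂) / 2 ∈ Ioo t₁ t₂ := ⟨by linarith, by linarith⟩
  exact absurd (hflat _ ⟨by linarith, by linarith⟩) (hp _ hm).ne'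

/-- ★ EXACT LOOP IDENTITY.  A conjugation-symmetric zero-free loop whose upper half has finitely many real points — or is real throughout —
satisfies `2·wind Γ = sgn Re Γ(½) − sgn Re Γ(0) + 4(#desc − #asc)`. -/
theorem two_mul_wind_eq_count {Γ : ℝ → ℂ} (hΓ : ContinuousOn Γ (Icc 0 1)) (h01 : Γ 0 = Γ 1) (hne : ∀ t ∈ Icc (0 : ℝ) 1, Γ t ≠ 0)
    (hsym : ∀ t ∈ Icc (0 : ℝ) 1, Γ (1 - t) = (starRingEnd ℂ) (Γ t))
    (hZ : {t : ℝ | t ∈ Icc (0 : ℝ) (1 / 2) ∧ (Γ t).im = 0}.Finite ∨ ∀ t ∈ Icc (0 : ℝ) (1 / 2), (Γ t).im = 0) :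
    (ascSet Γ).Finite ∧ (descSet Γ).Finite ∧
      2 * (wind Γ : ℂ) = sgn (Γ (1 / 2)).re - sgn (Γ 0).re + 4 * (((descSet Γ).ncard : ℂ) - ((ascSet Γ).ncard : ℂ)) := by
  obtain ⟨l, hl, hle⟩ := (IsNonvanishingLoop.mk hΓ hne h01).hasLogOn
  have hw := wind_spec hl hle h01
  have hq0 : (0 : ℝ) ≤ 1 / 2 := by norm_num
  have hq1 : (1 / 2 : ℝ) ≤ 1 := by norm_num
  have h0 : (Γ 0).im = 0 := by
    have e := hsym 0 ⟨le_rfl, zero_le_one⟩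
    rw [sub_zero, ← h01] at e
    exact conj_eq_iff_im.1 e.symm
  have hh : (Γ (1 / 2)).im = 0 := by
    have e := hsym (1 / 2) ⟨hq0, hq1⟩
    rw [show (1 : ℝ) - 1 / 2 = 1 / 2 by norm_num] at e
    exact conj_eq_iff_im.1 e.symm
  have hI : ∀ t ∈ Icc (0 : ℝ) 1, 1 - t ∈ Icc (0 : ℝ) 1 := fun t ht => ⟨by linarith [ht.2], by linarith [ht.1]⟩
  have hl₂ : ContinuousOn (fun t => (starRingEnd ℂ) (l (1 - t))) (Icc 0 1) := by
    refine Complex.continuous_conj.comp_continuousOn (hl.comp (continuousOn_const.sub continuousOn_id) fun t ht => hI t ht)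
  have hle₂ : ∀ t ∈ Icc (0 : ℝ) 1, exp ((starRingEnd ℂ) (l (1 - t))) = exp (l t) := by
    intro t ht
    rw [Complex.exp_conj, hle (1 - t) (hI t ht), hsym t ht, Complex.conj_conj, hle t ht]
  obtain ⟨k, hk⟩ := exists_int_eq_add_of_exp_eq isPreconnected_Icc hl₂ hl hle₂
  have hk0 := congrArg Complex.im (hk 0 ⟨le_rfl, zero_le_one⟩)
  have hkh := congrArg Complex.im (hk (1 / 2) ⟨hq0, hq1⟩)
  simp only [sub_zero, Complex.conj_im, Complex.add_im, show (1 : ℝ) - 1 / 2 = 1 / 2 by norm_num] at hk0 hkh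
  have hkI : ((k : ℂ) * (2 * π * I)).im = 2 * π * k := by simp [Complex.mul_im]; ring
  rw [hkI] at hk0 hkh
  have hsymL : (l 1).im - (l (1 / 2)).im = (l (1 / 2)).im - (l 0).im := by linarith
  have hΓ' := hΓ.mono (Icc_subset_Icc_right hq1)
  have hl' := hl.mono (Icc_subset_Icc_right hq1)
  have hle' : ∀ t ∈ Icc (0 : ℝ) (1 / 2), exp (l t) = Γ t := fun t ht => hle t ⟨ht.1, ht.2.trans hq1⟩
  have hne' : ∀ t ∈ Icc (0 : ℝ) (1 / 2), Γ t ≠ 0 := fun t ht => hne t ⟨ht.1, ht.2.trans hq1⟩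
  -- the upper half: the exact identity (finite case) or one flat piece with no pieces
  have hhalf : (ascSet Γ).Finite ∧ (descSet Γ).Finite ∧
      (l (1 / 2)).im - (l 0).im = π / 2 * ((zsgn (Γ (1 / 2)).re : ℝ) - (zsgn (Γ 0).re : ℝ)) +
        2 * π * (((descSet Γ).ncard : ℝ) - ((ascSet Γ).ncard : ℝ)) := by
    rcases hZ with hfin | hflat
    · exact im_incr_eq_count hΓ' hl' hle' hne' h0 hh hfin
    · rw [ascSet_eq_empty_of_flat hflat, descSet_eq_empty_of_flat hflat]
      refine ⟨Set.finite_empty, Set.finite_empty, ?_⟩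
      rw [im_incr_piece_down hq0 hΓ' hl' hle' hne' (fun t ht => (hflat t ht).le) h0 hh]
      simp
  obtain ⟨hAfin, hDfin, hid⟩ := hhalf
  refine ⟨hAfin, hDfin, ?_⟩
  have hwim := congrArg Complex.im hw
  have hwI : ((wind Γ : ℂ) * (2 * π * I)).im = 2 * π * (wind Γ : ℝ) := by simp [Complex.mul_im]; ring
  rw [Complex.sub_im, hwI] at hwim
  have key : π * (2 * (wind Γ : ℝ)) = π * (((zsgn (Γ (1 / 2)).re : ℝ) - (zsgn (Γ 0).re : ℝ)) +
      4 * (((descSet Γ).ncard : ℝ) - ((ascSet Γ).ncard : ℝ))) := by linarith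
  have hR := mul_left_cancel₀ Real.pi_ne_zero key
  have hZeq : 2 * wind Γ = zsgn (Γ (1 / 2)).re - zsgn (Γ 0).re + 4 * (((descSet Γ).ncard : ℤ) - ((ascSet Γ).ncard : ℤ)) := by
    exact_mod_cast hR
  rw [sgn_eq_zsgn, sgn_eq_zsgn]
  exact_mod_cast hZeq

end RhW08.Lens1ArcSign


-- ======== ArcSignH-v1 258fbb1784a6d947 (import lines stripped) ========

/-!
# TiltedLandingLaw421R3 — lens-1: RUNG 3 and the CONVERSION proved (part H: `PinningOfNetNonAscending`, `PinningOfArcCount`)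

LENS-1 gen-6 module image `rh33346-cover/lens-1/ArcSignH-v1.lean` (landing target `…/Theorems/TiltedLandingLaw421R3Lens1ArcSignH.lean`; single import =
part G; namespace `RhW08.Lens1ArcSign`; 0 `sorry`, no instances / notation; checked BY CHAIN over the ArcSign A–G images until tree).

THE ARGUMENT (memo O6d §1–§4).  On `a`ʼs own Jensen circle `C_δ : |w − Re a| = Im a + δ` (generic small `δ`: zero-free for `G = f^{(j)}` and `G′`,
outside the hypothesisʼs finite exceptional set) part Gʼs exact loop identity and the argument principle give the DISC CENSUS WITH COUNT
  `2(N_D(G′) − N_D(G)) = sgn φ(left foot) − sgn φ(right foot) + 4(#desc − #asc)`            (`disc_census_count`),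
and on a `LocalB` base (else an NL event in the closed base) with every critical point in the open disc real (else a `NestedStep` child) the real Rolle
identity turns it into  `N = nonrealZeroMult G = 2(#asc − #desc)`  (`nonrealZeroMult_eq_of_count`).  The count law `2(#asc − #desc) ≤ N − 2` is then
absurd: ★ `pinning_of_arcCount : PinningOfArcCount`; RUNG 3 ★ `pinning_of_netNonAscending : PinningOfNetNonAscending` follows by part Fʼs
`rung3_of_arcCount` (`N ≥ 2`: `a` and `conj a`), and RUNG 2 / RUNG 1 are recovered through `rung2_of_rung3` / `rung1_of_rung2`.

CONTENT: §1 `disc_census_count` · §2 `nonrealZeroMult_eq_of_count` · §3 ★ `pinning_of_arcCount_cofinite`, ★ `pinning_of_arcCount`,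
★ `pinning_of_netNonAscending`, `pinning_of_noAscendingArc'` · §4 the law ⟺ its net-ascending residual: `topPinning_of_netAscResidual`,
`topPinning_iff_netAscResidual`, `topPinningCrossing_of_netAscResidual`.

HONEST LABEL: after this part the OPEN content of `TopPinning` is exactly `TopPinningNetAscResidual` (tops one of whose small circles carries MORE
ascending than descending bad arcs; instrument: ≤ 24 / 6 386 legal crossing tops, the right-foot `K = −2` family).  `TopPinning`, `TopPinningCrossing`,
`RegUmbrella11S`, 33346, 33347 remain OPEN; nothing here bears on the truth of RH; RH is not proved; checked ≠ proved.
-/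

noncomputable section

namespace RhW08.Lens1ArcSign

open Complex Set Metric Filter Topology
open scoped Real
open Literature.Topology.PlaneTopology Literature.Analysis.Complex
open Summit.RiemannHypothesis.RiemannHypothesis.Theorems.Splittings.JensenWindow
open RhIdea6.G17.W07C7 RhIdea6.G17.W07C7.Rev6 RhIdea6.G18.W07C8.Law421BirthS RhIdea6.G19.W07C11.Seam
open RhIdea6.G20.W07C12.Frac RhIdea6.G20.W07C12.StColP RhW07.C12.FieldSplit RhIdea6.G21.W07C13.TentMax
open RhW07.C14.TwoSided RhW07.C14.Classes RhW07.C14.Lineage RhW07.C14.Booking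
open RhW07.C13.Heredity RhIdea6.G22.W07C15pre.Injection RhW07.E3.Cell RhW07.E3.Lit
open RhW08.Round1 RhW08.StSwap RhW08.Round2 RhW08.QuadW RhW08.SealSwapQ RhW08.SealSwap RhW08.SuccB RhW08.SuccSplit
open RhW08.SuccTheft RhW08.Column RhW08.Hurwitz RhW08.ClusterQ RhW08.ClusterQM RhW08.NewtonDoor RhW08.NewtonDoorGenusOne RhW08.PurseP
open RhW08.Lens1SignCut RhW08.Lens1Coverage RhW08.IsolatedTilt RhW08.Lens1Pinning RhW08.Lens1PinningIso

variable {f : ℂ → ℂ}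

/-! ## §1 The disc census with count -/

/-- ★ DISC CENSUS WITH COUNT.  `f` real entire, the circle `|u − c| = r` free of zeros of `f` and `f′` ⇒
`2(N_D(f′) − N_D(f)) = sgn Re φ(c − r) − sgn Re φ(c + r) + 4(#desc − #asc)` (`φ = f′/f` along `circleLoop c r`; both counts finite). -/
theorem disc_census_count {f : ℂ → ℂ} (hfd : Differentiable ℂ f) (hreal : ∀ x : ℝ, (f x).im = 0) {c r : ℝ} (hr : 0 < r)
    (hf0 : ∀ u : ℂ, ‖u - c‖ = r → f u ≠ 0) (hd0 : ∀ u : ℂ, ‖u - c‖ = r → deriv f u ≠ 0) :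
    (ascSet (fun t => deriv f (circleLoop (c : ℂ) r t) / f (circleLoop (c : ℂ) r t))).Finite ∧
    (descSet (fun t => deriv f (circleLoop (c : ℂ) r t) / f (circleLoop (c : ℂ) r t))).Finite ∧
    2 * (zeroCountC (deriv f) (ball (c : ℂ) r) - zeroCountC f (ball (c : ℂ) r)) =
      sgn (deriv f ((c - r : ℝ) : ℂ) / f ((c - r : ℝ) : ℂ)).re - sgn (deriv f ((c + r : ℝ) : ℂ) / f ((c + r : ℝ) : ℂ)).re +
        4 * (((descSet (fun t => deriv f (circleLoop (c : ℂ) r t) / f (circleLoop (c : ℂ) r t))).ncard : ℂ) -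
          ((ascSet (fun t => deriv f (circleLoop (c : ℂ) r t) / f (circleLoop (c : ℂ) r t))).ncard : ℂ)) := by
  have hγr : ∀ t : ℝ, ‖circleLoop (c : ℂ) r t - c‖ = r := fun t => by rw [norm_circleLoop_sub_center, abs_of_pos hr]
  have hcf : Continuous fun t : ℝ => f (circleLoop (c : ℂ) r t) := hfd.continuous.comp (continuous_circleLoop _ _)
  have hcd : Continuous fun t : ℝ => deriv f (circleLoop (c : ℂ) r t) := hfd.deriv.continuous.comp (continuous_circleLoop _ _)
  have hF : IsNonvanishingLoop (fun t => f (circleLoop (c : ℂ) r t)) :=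
    ⟨hcf.continuousOn, fun t _ => hf0 _ (hγr t), by simp only [circleLoop_zero_eq]⟩
  have hF' : IsNonvanishingLoop (fun t => deriv f (circleLoop (c : ℂ) r t)) :=
    ⟨hcd.continuousOn, fun t _ => hd0 _ (hγr t), by simp only [circleLoop_zero_eq]⟩
  have hdiv : wind (fun t => deriv f (circleLoop (c : ℂ) r t) / f (circleLoop (c : ℂ) r t)) =
      wind (fun t => deriv f (circleLoop (c : ℂ) r t)) - wind (fun t => f (circleLoop (c : ℂ) r t)) := wind_div hF' hF
  have hWf := wind_circleLoop_eq_zeroCountC hfd hr hf0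
  have hWd := wind_circleLoop_eq_zeroCountC hfd.deriv hr hd0
  have hΓc : ContinuousOn (fun t => deriv f (circleLoop (c : ℂ) r t) / f (circleLoop (c : ℂ) r t)) (Icc 0 1) :=
    hcd.continuousOn.div hcf.continuousOn fun t _ => hf0 _ (hγr t)
  have h01 : deriv f (circleLoop (c : ℂ) r 0) / f (circleLoop (c : ℂ) r 0) =
      deriv f (circleLoop (c : ℂ) r 1) / f (circleLoop (c : ℂ) r 1) := by rw [circleLoop_zero_eq]
  have hne : ∀ t ∈ Icc (0 : ℝ) 1, deriv f (circleLoop (c : ℂ) r t) / f (circleLoop (c : ℂ) r t) ≠ 0 :=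
    fun t _ => div_ne_zero (hd0 _ (hγr t)) (hf0 _ (hγr t))
  have hfreal : ∀ z : ℂ, f ((starRingEnd ℂ) z) = (starRingEnd ℂ) (f z) := apply_conj_eq_conj hfd hreal
  have hdreal : ∀ x : ℝ, (deriv f x).im = 0 := im_deriv_ofReal hfd hreal
  have hd'real : ∀ z : ℂ, deriv f ((starRingEnd ℂ) z) = (starRingEnd ℂ) (deriv f z) := apply_conj_eq_conj hfd.deriv hdreal
  have hsym : ∀ t ∈ Icc (0 : ℝ) 1, deriv f (circleLoop (c : ℂ) r (1 - t)) / f (circleLoop (c : ℂ) r (1 - t)) =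
      (starRingEnd ℂ) (deriv f (circleLoop (c : ℂ) r t) / f (circleLoop (c : ℂ) r t)) := by
    intro t _
    rw [circleLoop_one_sub, hd'real, hfreal, map_div₀]
  have hZ := breaks_finite_or_flat hfd (c := c) (r := r) (fun t => hf0 _ (hγr t))
  obtain ⟨hA, hD, hn⟩ := two_mul_wind_eq_count hΓc h01 hne hsym hZ
  refine ⟨hA, hD, ?_⟩
  rw [circleLoop_ofReal_half, circleLoop_ofReal_zero, hdiv, Int.cast_sub, hWd, hWf] at hn
  exact hn

/-! ## §2 Disc Rolle closure with count -/

/-- ★ DISC ROLLE CLOSURE WITH COUNT (twin of `no_nonreal_zero_of_disc_ge`).  If the disc census holds with counts `#asc = A`, `#desc = D`, every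
critical point in the open disc is real and the real Rolle identity holds on the base, then the non-real zeros of `f` in the disc number
`N = 2(A − D)` with multiplicity. -/
theorem nonrealZeroMult_eq_of_count {f : ℂ → ℂ} (hfd : Differentiable ℂ f) {c r : ℝ} (hr : 0 < r)
    (hf0 : ∀ u : ℂ, ‖u - c‖ = r → f u ≠ 0) {A D : ℕ}
    (hc : 2 * (zeroCountC (deriv f) (ball (c : ℂ) r) - zeroCountC f (ball (c : ℂ) r)) =
      sgn (deriv f ((c - r : ℝ) : ℂ) / f ((c - r : ℝ) : ℂ)).re - sgn (deriv f ((c + r : ℝ) : ℂ) / f ((c + r : ℝ) : ℂ)).re +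
        4 * ((D : ℂ) - (A : ℂ)))
    (hA : ∀ ρ ∈ ball (c : ℂ) r, deriv f ρ = 0 → ρ.im = 0) (hR : RolleIdentity f (c - r) (c + r) r) :
    nonrealZeroMult f c r = 2 * ((A : ℤ) - D) := by
  classical
  unfold nonrealZeroMult
  set K : Set ℂ := ball (c : ℂ) r with hKdef
  have hfin : {ρ : ℂ | f ρ = 0 ∧ ρ ∈ K}.Finite := by
    refine (Rouche.finite_zeros f hr (by linarith : r < r + 1) hfd.differentiableOn hf0).subset ?_
    rintro ρ ⟨h0, hρ⟩
    exact ⟨ball_subset_closedBall hρ, h0⟩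
  have e1 : {ρ : ℂ | deriv f ρ = 0 ∧ ρ ∈ K} = {ρ : ℂ | deriv f ρ = 0 ∧ ρ ∈ K ∩ {ρ | ρ.im = 0}} := by
    ext ρ
    simp only [mem_setOf_eq, mem_inter_iff]
    constructor
    · rintro ⟨h0, hK⟩; exact ⟨h0, hK, hA ρ hK h0⟩
    · rintro ⟨h0, hK, -⟩; exact ⟨h0, hK⟩
  have e1' : zeroCountC (deriv f) K = zeroCountC (deriv f) (K ∩ {ρ | ρ.im = 0}) := by
    unfold zeroCountC; rw [e1]
  set B : Set ℂ := {ρ : ℂ | f ρ = 0 ∧ ρ ∈ K ∧ ρ.im ≠ 0} with hBdef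
  have e2 : {ρ : ℂ | f ρ = 0 ∧ ρ ∈ K} = {ρ : ℂ | f ρ = 0 ∧ ρ ∈ K ∩ {ρ | ρ.im = 0}} ∪ B := by
    ext ρ
    simp only [mem_setOf_eq, mem_inter_iff, mem_union, hBdef]
    constructor
    · rintro ⟨h0, hK⟩
      by_cases him : ρ.im = 0
      · exact Or.inl ⟨h0, hK, him⟩
      · exact Or.inr ⟨h0, hK, him⟩
    · rintro (⟨h0, hK, -⟩ | ⟨h0, hK, -⟩) <;> exact ⟨h0, hK⟩
  have hdisj : Disjoint {ρ : ℂ | f ρ = 0 ∧ ρ ∈ K ∩ {ρ | ρ.im = 0}} B := by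
    rw [Set.disjoint_left]
    rintro ρ ⟨-, -, him⟩ ⟨-, -, him'⟩
    exact him' him
  have hAfin : {ρ : ℂ | f ρ = 0 ∧ ρ ∈ K ∩ {ρ | ρ.im = 0}}.Finite := hfin.subset fun ρ hρ => ⟨hρ.1, hρ.2.1⟩
  have hBfin : B.Finite := hfin.subset fun ρ hρ => ⟨hρ.1, hρ.2.1⟩
  have e2' : zeroCountC f K = zeroCountC f (K ∩ {ρ | ρ.im = 0}) + ∑ᶠ ρ ∈ B, ((meromorphicOrderAt f ρ).untop₀ : ℂ) := by
    unfold zeroCountC; rw [e2, finsum_mem_union hdisj hAfin hBfin]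
  have hB0 : 2 * ∑ᶠ ρ ∈ B, ((meromorphicOrderAt f ρ).untop₀ : ℂ) + 4 * ((D : ℂ) - (A : ℂ)) = 0 := by
    rw [e1', e2'] at hc
    unfold RolleIdentity at hR
    rw [zeroCountC_box_real_eq, zeroCountC_box_real_eq] at hR
    linear_combination hR - hc
  rw [finsum_mem_eq_finite_toFinset_sum _ hBfin, ← Int.cast_sum] at hB0
  have hB0' : 2 * ∑ ρ ∈ hBfin.toFinset, (meromorphicOrderAt f ρ).untop₀ + 4 * ((D : ℤ) - A) = 0 := by exact_mod_cast hB0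
  rw [finsum_mem_eq_finite_toFinset_sum _ hBfin]
  linarith

/-! ## §3 RUNG 3 and the CONVERSION -/

/-- ★★★ THE CONVERSION, frame form.  On a legal frame, an upper zero `a` of `f^{(j)}` whose small Jensen circles `|w − Re a| = Im a + δ`
(`0 < δ < d₀`, `δ` outside a finite set) satisfy the count law `2(#asc − #desc) ≤ N − 2` has a NON-REAL zero of `f^{(j+1)}` in its CLOSED Jensen disc
or an NL event of level `j` in the CLOSED base.  [Walsh, Ann. of Math. 22 (1920) §4 on `a`ʼs own circle; memo O6d (WORD)/(PIN).] -/
theorem pinning_of_arcCount_cofinite {η : ℝ} {f : ℂ → ℂ} {x₀ s hmax R Hs : ℝ} {B : ℕ} (hE : EngineHyps5 2 η f x₀ s hmax R Hs B)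
    {j : ℕ} {a : ℂ} (ha : iteratedDeriv j f a = 0) (hapos : 0 < a.im) (hAC : ArcCountLaw f j a) :
    (∃ w : ℂ, iteratedDeriv (j + 1) f w = 0 ∧ w.im ≠ 0 ∧ NestedStep a w) ∨ (∃ x : ℝ, |x - a.re| ≤ a.im ∧ NLEventOf f j x) := by
  classical
  have hf : RealEntireLt2 f := realEntireLt2_of_hyps hE
  -- degenerate frame `f^{(j)} ≡ 0`: `a` itself is a child
  by_cases hnz : iteratedDeriv j f = 0
  · left
    refine ⟨a, ?_, hapos.ne', ?_⟩
    · rw [iteratedDeriv_succ, hnz]; simp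
    · show (a.re - a.re) ^ 2 + a.im ^ 2 ≤ a.im ^ 2
      simp
  set G : ℂ → ℂ := iteratedDeriv j f with hGdef
  have hG : RealEntireLt2 G :=
    { diff := differentiable_iteratedDeriv_of_entire hf.diff j
      growth := by
        obtain ⟨ρ, C, hρ0, hρ, hgr⟩ := hf.growth
        obtain ⟨ρ', C', h1, h2, h3⟩ := exists_growth_iteratedDeriv hf.diff hρ0 hρ hgr j
        exact ⟨ρ', C', h1, h2, h3⟩
      real := im_iteratedDeriv_ofReal hf.diff hf.real j }
  have e1 : deriv G = iteratedDeriv (j + 1) f := by rw [hGdef, ← iteratedDeriv_succ]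
  have hHs : 0 ≤ Hs := hE.2.2.2.2.2.2.2.1
  have hG'ne : iteratedDeriv (j + 1) f ≠ 0 := iteratedDeriv_succ_ne_zero_of_zero hf.diff j hnz ha
  have hG'd : Differentiable ℂ (iteratedDeriv (j + 1) f) := differentiable_iteratedDeriv_of_entire hf.diff (j + 1)
  obtain ⟨d0, hd0, E, hEfin, hcount⟩ := hAC
  by_contra hcon
  push Not at hcon
  obtain ⟨hnoC, hnoNL⟩ := hcon
  obtain ⟨m, hm0, hm1, hmarg⟩ := exists_nl_margin hf hG'ne hapos (a := a)
  obtain ⟨m', hm'0, hm'1, hchild⟩ := exists_child_margin hE hG'ne hapos (a := a)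
  set δ₀ : ℝ := min d0 (min m m') with hδ₀
  have hδ₀0 : 0 < δ₀ := lt_min hd0 (lt_min hm0 hm'0)
  -- a GENERIC `δ ∈ (0, δ₀)`: the whole circle of radius `Im a + δ` misses the finitely many zeros of `G`, `G′` in the box, and `δ ∉ E`
  set L : ℝ := a.im + Hs + 2 with hL
  have hz₀ : ((a.re : ℂ)) ∈ Ioo (a.re - L) (a.re + L) ×ℂ Ioo (-(Hs + 1)) (Hs + 1) :=
    ofReal_mem_box (by rw [sub_self, abs_zero]; linarith) hHs
  set Z : Set ℂ := {ρ : ℂ | G ρ = 0 ∧ ρ ∈ Ioo (a.re - L) (a.re + L) ×ℂ Ioo (-(Hs + 1)) (Hs + 1)} ∪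
    {ρ : ℂ | iteratedDeriv (j + 1) f ρ = 0 ∧ ρ ∈ Ioo (a.re - L) (a.re + L) ×ℂ Ioo (-(Hs + 1)) (Hs + 1)} with hZ
  have hZfin : Z.Finite := (finite_zeros_box hG.diff hnz hz₀).union (finite_zeros_box hG'd hG'ne hz₀)
  have hbad : ((fun ρ : ℂ => ‖ρ - (a.re : ℂ)‖ - a.im) '' Z ∪ E).Finite := (hZfin.image _).union hEfin
  obtain ⟨δ, hδI, hδbad⟩ := ((Set.Ioo_infinite hδ₀0).sdiff hbad).nonempty
  obtain ⟨hδ0, hδ1⟩ := hδI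
  have hδd0 : δ < d0 := lt_of_lt_of_le hδ1 (min_le_left _ _)
  have hδm : δ < m := lt_of_lt_of_le hδ1 ((min_le_right _ _).trans (min_le_left _ _))
  have hδm' : δ < m' := lt_of_lt_of_le hδ1 ((min_le_right _ _).trans (min_le_right _ _))
  have hr : 0 < a.im + δ := by linarith
  -- the circle lies in the box
  have hbox : ∀ u : ℂ, ‖u - (a.re : ℂ)‖ = a.im + δ → u ∈ Ioo (a.re - L) (a.re + L) ×ℂ Ioo (-(Hs + 1)) (Hs + 1) := by
    intro u hu
    have haHs : |a.im| ≤ Hs := abs_im_le_of_level hE hnz ha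
    rw [abs_of_pos hapos] at haHs
    have h1 := abs_re_le_norm (u - (a.re : ℂ))
    have h2 := abs_im_le_norm (u - (a.re : ℂ))
    rw [hu] at h1 h2
    rw [sub_re, ofReal_re, abs_le] at h1
    rw [sub_im, ofReal_im, sub_zero, abs_le] at h2
    exact mem_reProdIm.2 ⟨⟨by linarith [h1.1], by linarith [h1.2]⟩, ⟨by linarith [h2.1], by linarith [h2.2]⟩⟩
  have hG0 : ∀ u : ℂ, ‖u - ((a.re : ℝ) : ℂ)‖ = a.im + δ → G u ≠ 0 := fun u hu h0 =>
    hδbad (Or.inl ⟨u, Or.inl ⟨h0, hbox u hu⟩, by simp only [hu]; ring⟩)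
  have hG'0 : ∀ u : ℂ, ‖u - ((a.re : ℝ) : ℂ)‖ = a.im + δ → iteratedDeriv (j + 1) f u ≠ 0 := fun u hu h0 =>
    hδbad (Or.inl ⟨u, Or.inr ⟨h0, hbox u hu⟩, by simp only [hu]; ring⟩)
  have hδE : δ ∉ E := fun h => hδbad (Or.inr h)
  have hdG0 : ∀ u : ℂ, ‖u - ((a.re : ℝ) : ℂ)‖ = a.im + δ → deriv G u ≠ 0 := by rw [e1]; exact hG'0
  -- the count law at this `δ`
  obtain ⟨-, hineq⟩ := hcount δ ⟨⟨hδ0, hδd0⟩, hδE⟩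
  have hineq' : 2 * (((ascStarts f j a δ).ncard : ℤ) - (descStarts f j a δ).ncard) ≤ nonrealZeroMult G a.re (a.im + δ) - 2 := hineq
  -- the feet
  have hβ : ‖((a.re + (a.im + δ) : ℝ) : ℂ) - ((a.re : ℝ) : ℂ)‖ = a.im + δ := by
    rw [← ofReal_sub, show a.re + (a.im + δ) - a.re = a.im + δ by ring, Complex.norm_real, Real.norm_eq_abs, abs_of_pos hr]
  have hα : ‖((a.re - (a.im + δ) : ℝ) : ℂ) - ((a.re : ℝ) : ℂ)‖ = a.im + δ := by
    rw [← ofReal_sub, show a.re - (a.im + δ) - a.re = -(a.im + δ) by ring, Complex.norm_real, Real.norm_eq_abs, abs_neg,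
      abs_of_pos hr]
  have hGβ : G ((a.re + (a.im + δ) : ℝ) : ℂ) ≠ 0 := hG0 _ hβ
  have hGα : G ((a.re - (a.im + δ) : ℝ) : ℂ) ≠ 0 := hG0 _ hα
  have hdGβ : deriv G ((a.re + (a.im + δ) : ℝ) : ℂ) ≠ 0 := hdG0 _ hβ
  have hdGα : deriv G ((a.re - (a.im + δ) : ℝ) : ℂ) ≠ 0 := hdG0 _ hα
  -- the base: local Laguerre law B, or an NL event within the margin
  by_cases hB : LocalB G (a.re - (a.im + δ)) (a.re + (a.im + δ))
  swap
  · obtain ⟨x, hx, hNL⟩ := nlEventOf_of_not_localB hf j hB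
    have hxa : |x - a.re| < a.im + m := by rw [abs_lt]; constructor <;> linarith [hx.1, hx.2]
    exact hnoNL x (hmarg x hNL hxa) hNL
  have hW : SWindow G (fun _ => True) (a.re - (a.im + δ)) (a.re + (a.im + δ)) (a.im + δ) :=
    ⟨by linarith, hr, fun _ _ => trivial, fun _ _ => trivial, fun _ _ _ => trivial, fun _ _ _ => trivial, hGα, hGβ, hdGα, hdGβ⟩
  have hRolle : RolleIdentity G (a.re - (a.im + δ)) (a.re + (a.im + δ)) (a.im + δ) :=
    rolleIdentity_of_localB_core hG.diff hG.real hW hB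
  -- every critical point in the open disc is real — else it is a `NestedStep` child (excluded)
  have hA : ∀ ρ ∈ ball ((a.re : ℝ) : ℂ) (a.im + δ), deriv G ρ = 0 → ρ.im = 0 := by
    intro ρ hρ hdρ
    by_contra hρim
    have hρ' : ‖ρ - (a.re : ℂ)‖ < a.im + m' := by
      rw [mem_ball, dist_eq_norm] at hρ; linarith
    have hdρ' : iteratedDeriv (j + 1) f ρ = 0 := by rw [← e1]; exact hdρ
    exact hnoC ρ hdρ' hρim (hchild ρ hdρ' hρim hρ')
  -- the census with count on the circle and the disc Rolle closure: `N = 2(#asc − #desc)`, against the count law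
  obtain ⟨-, -, hc⟩ := disc_census_count hG.diff hG.real hr hG0 hdG0
  have hN := nonrealZeroMult_eq_of_count hG.diff hr hG0 hc hA hRolle
  have hN' : nonrealZeroMult G a.re (a.im + δ) = 2 * (((ascStarts f j a δ).ncard : ℤ) - (descStarts f j a δ).ncard) := hN
  omega

/-- ★★★ THE CONVERSION (`PinningOfArcCount`, typed in part F): the count law on the small circles ⇒ the `TopPinning` disjunction. -/
theorem pinning_of_arcCount : PinningOfArcCount :=
  fun _ _ _ _ _ _ _ _ hE _ _ ha hapos hAC => pinning_of_arcCount_cofinite hE ha hapos hAC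

/-- ★★★ RUNG 3 (`PinningOfNetNonAscending`, typed in part F): net non-ascent `#asc ≤ #desc` on the small circles ⇒ the `TopPinning` disjunction. -/
theorem pinning_of_netNonAscending : PinningOfNetNonAscending :=
  rung3_of_arcCount pinning_of_arcCount

/-- RUNG 2 recovered from RUNG 3 (consistency; the tree keeps `pinning_of_noAscendingArc` as the direct proof). -/
theorem pinning_of_noAscendingArc' : PinningOfNoAscendingArc :=
  rung2_of_rung3 pinning_of_netNonAscending

/-! ## §4 The law is its net-ascending residual -/

/-- ★ After RUNG 3 the law reduces to its net-ascending residual: `TopPinningNetAscResidual → TopPinning`. -/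
theorem topPinning_of_netAscResidual (h4 : TopPinningNetAscResidual) : TopPinning :=
  topPinning_of_rung3 pinning_of_netNonAscending h4

/-- ★ `TopPinning ⟺ TopPinningNetAscResidual`: the open content of the law is the net-ascending class. -/
theorem topPinning_iff_netAscResidual : TopPinning ↔ TopPinningNetAscResidual :=
  ⟨netAscResidual_of_topPinning, topPinning_of_netAscResidual⟩

/-- ★ … and `TopPinningCrossing` from the same residual. -/
theorem topPinningCrossing_of_netAscResidual (h4 : TopPinningNetAscResidual) : TopPinningCrossing :=
  topPinningCrossing_of_ascResidual (ascResidual_of_rung3 pinning_of_netNonAscending h4)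

end RhW08.Lens1ArcSign


-- ======== GUARDS (critic g25, lax: one #print axioms per theorem) ========
/-- info: 'RhW08.Lens1PinningIso.exists_uniform_far_gap' depends on axioms: [propext, Classical.choice, Quot.sound] -/
#guard_msgs (whitespace := lax) in
#print axioms RhW08.Lens1PinningIso.exists_uniform_far_gap

/-- info: 'RhW08.Lens1PinningIso.exists_nl_margin' depends on axioms: [propext, Classical.choice, Quot.sound] -/
#guard_msgs (whitespace := lax) in
#print axioms RhW08.Lens1PinningIso.exists_nl_margin

/-- info: 'RhW08.Lens1PinningIso.shifted_clear' depends on axioms: [propext, Classical.choice, Quot.sound] -/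
#guard_msgs (whitespace := lax) in
#print axioms RhW08.Lens1PinningIso.shifted_clear

/-- info: 'RhW08.Lens1PinningIso.pinning_of_jensenIsolated'' depends on axioms: [propext, Classical.choice, Quot.sound] -/
#guard_msgs (whitespace := lax) in
#print axioms RhW08.Lens1PinningIso.pinning_of_jensenIsolated'

/-- info: 'RhW08.Lens1PinningIso.topPinning_of_crossing' depends on axioms: [propext, Classical.choice, Quot.sound] -/
#guard_msgs (whitespace := lax) in
#print axioms RhW08.Lens1PinningIso.topPinning_of_crossing

/-- info: 'RhW08.Lens1PinningIso.crossing_of_topPinning' depends on axioms: [propext, Classical.choice, Quot.sound] -/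
#guard_msgs (whitespace := lax) in
#print axioms RhW08.Lens1PinningIso.crossing_of_topPinning

/-- info: 'RhW08.Lens1ArcSign.log_increment_eq' depends on axioms: [propext, Classical.choice, Quot.sound] -/
#guard_msgs (whitespace := lax) in
#print axioms RhW08.Lens1ArcSign.log_increment_eq

/-- info: 'RhW08.Lens1ArcSign.two_mul_wind_eq' depends on axioms: [propext, Classical.choice, Quot.sound] -/
#guard_msgs (whitespace := lax) in
#print axioms RhW08.Lens1ArcSign.two_mul_wind_eq

/-- info: 'RhW08.Lens1ArcSign.circleLoop_ofReal_im' depends on axioms: [propext, Classical.choice, Quot.sound] -/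
#guard_msgs (whitespace := lax) in
#print axioms RhW08.Lens1ArcSign.circleLoop_ofReal_im

/-- info: 'RhW08.Lens1ArcSign.circleLoop_ofReal_zero' depends on axioms: [propext, Classical.choice, Quot.sound] -/
#guard_msgs (whitespace := lax) in
#print axioms RhW08.Lens1ArcSign.circleLoop_ofReal_zero

/-- info: 'RhW08.Lens1ArcSign.circleLoop_ofReal_half' depends on axioms: [propext, Classical.choice, Quot.sound] -/
#guard_msgs (whitespace := lax) in
#print axioms RhW08.Lens1ArcSign.circleLoop_ofReal_half

/-- info: 'RhW08.Lens1ArcSign.circleLoop_im_nonneg' depends on axioms: [propext, Classical.choice, Quot.sound] -/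
#guard_msgs (whitespace := lax) in
#print axioms RhW08.Lens1ArcSign.circleLoop_im_nonneg

/-- info: 'RhW08.Lens1ArcSign.circleLoop_im_nonpos' depends on axioms: [propext, Classical.choice, Quot.sound] -/
#guard_msgs (whitespace := lax) in
#print axioms RhW08.Lens1ArcSign.circleLoop_im_nonpos

/-- info: 'RhW08.Lens1ArcSign.eq_feet_of_sphere_real' depends on axioms: [propext, Classical.choice, Quot.sound] -/
#guard_msgs (whitespace := lax) in
#print axioms RhW08.Lens1ArcSign.eq_feet_of_sphere_real

/-- info: 'RhW08.Lens1ArcSign.ball_subset_box' depends on axioms: [propext, Classical.choice, Quot.sound] -/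
#guard_msgs (whitespace := lax) in
#print axioms RhW08.Lens1ArcSign.ball_subset_box

/-- info: 'RhW08.Lens1ArcSign.mem_ball_of_box_real' depends on axioms: [propext, Classical.choice, Quot.sound] -/
#guard_msgs (whitespace := lax) in
#print axioms RhW08.Lens1ArcSign.mem_ball_of_box_real

/-- info: 'RhW08.Lens1ArcSign.zeroCountC_box_real_eq' depends on axioms: [propext, Classical.choice, Quot.sound] -/
#guard_msgs (whitespace := lax) in
#print axioms RhW08.Lens1ArcSign.zeroCountC_box_real_eq

/-- info: 'RhW08.Lens1ArcSign.analyticOrderAt_ne_top_of_entire' depends on axioms: [propext, Classical.choice, Quot.sound] -/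
#guard_msgs (whitespace := lax) in
#print axioms RhW08.Lens1ArcSign.analyticOrderAt_ne_top_of_entire

/-- info: 'RhW08.Lens1ArcSign.wind_circleLoop_eq_zeroCountC' depends on axioms: [propext, Classical.choice, Quot.sound] -/
#guard_msgs (whitespace := lax) in
#print axioms RhW08.Lens1ArcSign.wind_circleLoop_eq_zeroCountC

/-- info: 'RhW08.Lens1ArcSign.logDeriv_im_ofReal' depends on axioms: [propext, Classical.choice, Quot.sound] -/
#guard_msgs (whitespace := lax) in
#print axioms RhW08.Lens1ArcSign.logDeriv_im_ofReal

/-- info: 'RhW08.Lens1ArcSign.ne_zero_on_sphere' depends on axioms: [propext, Classical.choice, Quot.sound] -/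
#guard_msgs (whitespace := lax) in
#print axioms RhW08.Lens1ArcSign.ne_zero_on_sphere

/-- info: 'RhW08.Lens1ArcSign.deriv_ne_zero_on_sphere' depends on axioms: [propext, Classical.choice, Quot.sound] -/
#guard_msgs (whitespace := lax) in
#print axioms RhW08.Lens1ArcSign.deriv_ne_zero_on_sphere

/-- info: 'RhW08.Lens1ArcSign.disc_census' depends on axioms: [propext, Classical.choice, Quot.sound] -/
#guard_msgs (whitespace := lax) in
#print axioms RhW08.Lens1ArcSign.disc_census

/-- info: 'RhW08.Lens1ArcSign.no_nonreal_zero_of_disc' depends on axioms: [propext, Classical.choice, Quot.sound] -/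
#guard_msgs (whitespace := lax) in
#print axioms RhW08.Lens1ArcSign.no_nonreal_zero_of_disc

/-- info: 'RhW08.Lens1ArcSign.exists_child_margin' depends on axioms: [propext, Classical.choice, Quot.sound] -/
#guard_msgs (whitespace := lax) in
#print axioms RhW08.Lens1ArcSign.exists_child_margin

/-- info: 'RhW08.Lens1ArcSign.pinning_of_arcSignClear' depends on axioms: [propext, Classical.choice, Quot.sound] -/
#guard_msgs (whitespace := lax) in
#print axioms RhW08.Lens1ArcSign.pinning_of_arcSignClear

/-- info: 'RhW08.Lens1ArcSign.topPinning_case_arcSignClear' depends on axioms: [propext, Classical.choice, Quot.sound] -/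
#guard_msgs (whitespace := lax) in
#print axioms RhW08.Lens1ArcSign.topPinning_case_arcSignClear

/-- info: 'RhW08.Lens1ArcSign.arcSignClear_of_jensenIsolated' depends on axioms: [propext, Classical.choice, Quot.sound] -/
#guard_msgs (whitespace := lax) in
#print axioms RhW08.Lens1ArcSign.arcSignClear_of_jensenIsolated

/-- info: 'RhW08.Lens1ArcSign.pinning_of_jensenIsolated_via_arcSign' depends on axioms: [propext, Classical.choice, Quot.sound] -/
#guard_msgs (whitespace := lax) in
#print axioms RhW08.Lens1ArcSign.pinning_of_jensenIsolated_via_arcSign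

/-- info: 'RhW08.Lens1ArcSign.topPinningCrossing_of_arcResidual' depends on axioms: [propext, Classical.choice, Quot.sound] -/
#guard_msgs (whitespace := lax) in
#print axioms RhW08.Lens1ArcSign.topPinningCrossing_of_arcResidual

/-- info: 'RhW08.Lens1ArcSign.topPinning_of_arcResidual' depends on axioms: [propext, Classical.choice, Quot.sound] -/
#guard_msgs (whitespace := lax) in
#print axioms RhW08.Lens1ArcSign.topPinning_of_arcResidual

/-- info: 'RhW08.Lens1ArcSign.arcResidual_of_topPinning' depends on axioms: [propext, Classical.choice, Quot.sound] -/
#guard_msgs (whitespace := lax) in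
#print axioms RhW08.Lens1ArcSign.arcResidual_of_topPinning

/-- info: 'RhW08.Lens1ArcSign.noAscendingArc_of_im_neg' depends on axioms: [propext, Classical.choice, Quot.sound] -/
#guard_msgs (whitespace := lax) in
#print axioms RhW08.Lens1ArcSign.noAscendingArc_of_im_neg

/-- info: 'RhW08.Lens1ArcSign.arcNoAsc_of_arcSignClear' depends on axioms: [propext, Classical.choice, Quot.sound] -/
#guard_msgs (whitespace := lax) in
#print axioms RhW08.Lens1ArcSign.arcNoAsc_of_arcSignClear

/-- info: 'RhW08.Lens1ArcSign.arcResidual_of_rung2' depends on axioms: [propext, Classical.choice, Quot.sound] -/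
#guard_msgs (whitespace := lax) in
#print axioms RhW08.Lens1ArcSign.arcResidual_of_rung2

/-- info: 'RhW08.Lens1ArcSign.topPinning_of_rung2' depends on axioms: [propext, Classical.choice, Quot.sound] -/
#guard_msgs (whitespace := lax) in
#print axioms RhW08.Lens1ArcSign.topPinning_of_rung2

/-- info: 'RhW08.Lens1ArcSign.ascResidual_of_topPinning' depends on axioms: [propext, Classical.choice, Quot.sound] -/
#guard_msgs (whitespace := lax) in
#print axioms RhW08.Lens1ArcSign.ascResidual_of_topPinning

/-- info: 'RhW08.Lens1ArcSign.rung1_of_rung2' depends on axioms: [propext, Classical.choice, Quot.sound] -/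
#guard_msgs (whitespace := lax) in
#print axioms RhW08.Lens1ArcSign.rung1_of_rung2

/-- info: 'RhW08.Lens1ArcSign.sgn_eq_zsgn' depends on axioms: [propext, Classical.choice, Quot.sound] -/
#guard_msgs (whitespace := lax) in
#print axioms RhW08.Lens1ArcSign.sgn_eq_zsgn

/-- info: 'RhW08.Lens1ArcSign.im_log_I_mul' depends on axioms: [propext, Classical.choice, Quot.sound] -/
#guard_msgs (whitespace := lax) in
#print axioms RhW08.Lens1ArcSign.im_log_I_mul

/-- info: 'RhW08.Lens1ArcSign.im_log_negI_mul' depends on axioms: [propext, Classical.choice, Quot.sound] -/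
#guard_msgs (whitespace := lax) in
#print axioms RhW08.Lens1ArcSign.im_log_negI_mul

/-- info: 'RhW08.Lens1ArcSign.im_incr_piece_down' depends on axioms: [propext, Classical.choice, Quot.sound] -/
#guard_msgs (whitespace := lax) in
#print axioms RhW08.Lens1ArcSign.im_incr_piece_down

/-- info: 'RhW08.Lens1ArcSign.im_incr_piece_up' depends on axioms: [propext, Classical.choice, Quot.sound] -/
#guard_msgs (whitespace := lax) in
#print axioms RhW08.Lens1ArcSign.im_incr_piece_up

/-- info: 'RhW08.Lens1ArcSign.pos_or_neg_of_ne_zero' depends on axioms: [propext, Classical.choice, Quot.sound] -/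
#guard_msgs (whitespace := lax) in
#print axioms RhW08.Lens1ArcSign.pos_or_neg_of_ne_zero

/-- info: 'RhW08.Lens1ArcSign.im_incr_ge_of_noAsc' depends on axioms: [propext, Classical.choice, Quot.sound] -/
#guard_msgs (whitespace := lax) in
#print axioms RhW08.Lens1ArcSign.im_incr_ge_of_noAsc

/-- info: 'RhW08.Lens1ArcSign.two_mul_wind_ge' depends on axioms: [propext, Classical.choice, Quot.sound] -/
#guard_msgs (whitespace := lax) in
#print axioms RhW08.Lens1ArcSign.two_mul_wind_ge

/-- info: 'RhW08.Lens1ArcSign.circleLoop_one_sub' depends on axioms: [propext, Classical.choice, Quot.sound] -/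
#guard_msgs (whitespace := lax) in
#print axioms RhW08.Lens1ArcSign.circleLoop_one_sub

/-- info: 'RhW08.Lens1ArcSign.analyticAt_im_logDeriv_circleLoop' depends on axioms: [propext, Classical.choice, Quot.sound] -/
#guard_msgs (whitespace := lax) in
#print axioms RhW08.Lens1ArcSign.analyticAt_im_logDeriv_circleLoop

/-- info: 'RhW08.Lens1ArcSign.breaks_finite_or_flat' depends on axioms: [propext, Classical.choice, Quot.sound] -/
#guard_msgs (whitespace := lax) in
#print axioms RhW08.Lens1ArcSign.breaks_finite_or_flat

/-- info: 'RhW08.Lens1ArcSign.disc_census_ge' depends on axioms: [propext, Classical.choice, Quot.sound] -/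
#guard_msgs (whitespace := lax) in
#print axioms RhW08.Lens1ArcSign.disc_census_ge

/-- info: 'RhW08.Lens1ArcSign.no_nonreal_zero_of_disc_ge' depends on axioms: [propext, Classical.choice, Quot.sound] -/
#guard_msgs (whitespace := lax) in
#print axioms RhW08.Lens1ArcSign.no_nonreal_zero_of_disc_ge

/-- info: 'RhW08.Lens1ArcSign.arcNoAscCofinite_of_arcNoAsc' depends on axioms: [propext, Classical.choice, Quot.sound] -/
#guard_msgs (whitespace := lax) in
#print axioms RhW08.Lens1ArcSign.arcNoAscCofinite_of_arcNoAsc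

/-- info: 'RhW08.Lens1ArcSign.pinning_of_noAscendingArc_cofinite' depends on axioms: [propext, Classical.choice, Quot.sound] -/
#guard_msgs (whitespace := lax) in
#print axioms RhW08.Lens1ArcSign.pinning_of_noAscendingArc_cofinite

/-- info: 'RhW08.Lens1ArcSign.pinning_of_noAscendingArc' depends on axioms: [propext, Classical.choice, Quot.sound] -/
#guard_msgs (whitespace := lax) in
#print axioms RhW08.Lens1ArcSign.pinning_of_noAscendingArc

/-- info: 'RhW08.Lens1ArcSign.topPinning_of_ascResidual' depends on axioms: [propext, Classical.choice, Quot.sound] -/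
#guard_msgs (whitespace := lax) in
#print axioms RhW08.Lens1ArcSign.topPinning_of_ascResidual

/-- info: 'RhW08.Lens1ArcSign.topPinningCrossing_of_ascResidual' depends on axioms: [propext, Classical.choice, Quot.sound] -/
#guard_msgs (whitespace := lax) in
#print axioms RhW08.Lens1ArcSign.topPinningCrossing_of_ascResidual

/-- info: 'RhW08.Lens1ArcSign.pinning_of_arcSignClear'' depends on axioms: [propext, Classical.choice, Quot.sound] -/
#guard_msgs (whitespace := lax) in
#print axioms RhW08.Lens1ArcSign.pinning_of_arcSignClear'

/-- info: 'RhW08.Lens1ArcSign.ascStarts_eq_empty_of_noAscendingArc' depends on axioms: [propext, Classical.choice, Quot.sound] -/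
#guard_msgs (whitespace := lax) in
#print axioms RhW08.Lens1ArcSign.ascStarts_eq_empty_of_noAscendingArc

/-- info: 'RhW08.Lens1ArcSign.netNonAscending_of_noAscendingArc' depends on axioms: [propext, Classical.choice, Quot.sound] -/
#guard_msgs (whitespace := lax) in
#print axioms RhW08.Lens1ArcSign.netNonAscending_of_noAscendingArc

/-- info: 'RhW08.Lens1ArcSign.arcNetNonAsc_of_arcNoAscCofinite' depends on axioms: [propext, Classical.choice, Quot.sound] -/
#guard_msgs (whitespace := lax) in
#print axioms RhW08.Lens1ArcSign.arcNetNonAsc_of_arcNoAscCofinite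

/-- info: 'RhW08.Lens1ArcSign.rung2_of_rung3' depends on axioms: [propext, Classical.choice, Quot.sound] -/
#guard_msgs (whitespace := lax) in
#print axioms RhW08.Lens1ArcSign.rung2_of_rung3

/-- info: 'RhW08.Lens1ArcSign.arcCountIneq_of_netNonAscending' depends on axioms: [propext, Classical.choice, Quot.sound] -/
#guard_msgs (whitespace := lax) in
#print axioms RhW08.Lens1ArcSign.arcCountIneq_of_netNonAscending

/-- info: 'RhW08.Lens1ArcSign.untop₀_order_pos' depends on axioms: [propext, Classical.choice, Quot.sound] -/
#guard_msgs (whitespace := lax) in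
#print axioms RhW08.Lens1ArcSign.untop₀_order_pos

/-- info: 'RhW08.Lens1ArcSign.two_le_nonrealZeroMult' depends on axioms: [propext, Classical.choice, Quot.sound] -/
#guard_msgs (whitespace := lax) in
#print axioms RhW08.Lens1ArcSign.two_le_nonrealZeroMult

/-- info: 'RhW08.Lens1ArcSign.rung3_of_arcCount' depends on axioms: [propext, Classical.choice, Quot.sound] -/
#guard_msgs (whitespace := lax) in
#print axioms RhW08.Lens1ArcSign.rung3_of_arcCount

/-- info: 'RhW08.Lens1ArcSign.ascResidual_of_rung3' depends on axioms: [propext, Classical.choice, Quot.sound] -/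
#guard_msgs (whitespace := lax) in
#print axioms RhW08.Lens1ArcSign.ascResidual_of_rung3

/-- info: 'RhW08.Lens1ArcSign.topPinning_of_rung3' depends on axioms: [propext, Classical.choice, Quot.sound] -/
#guard_msgs (whitespace := lax) in
#print axioms RhW08.Lens1ArcSign.topPinning_of_rung3

/-- info: 'RhW08.Lens1ArcSign.netAscResidual_of_topPinning' depends on axioms: [propext, Classical.choice, Quot.sound] -/
#guard_msgs (whitespace := lax) in
#print axioms RhW08.Lens1ArcSign.netAscResidual_of_topPinning

/-- info: 'RhW08.Lens1ArcSign.topPinning_of_arcCount' depends on axioms: [propext, Classical.choice, Quot.sound] -/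
#guard_msgs (whitespace := lax) in
#print axioms RhW08.Lens1ArcSign.topPinning_of_arcCount

/-- info: 'RhW08.Lens1ArcSign.ascStarts_eq_ascSet' depends on axioms: [propext, Classical.choice, Quot.sound] -/
#guard_msgs (whitespace := lax) in
#print axioms RhW08.Lens1ArcSign.ascStarts_eq_ascSet

/-- info: 'RhW08.Lens1ArcSign.descStarts_eq_descSet' depends on axioms: [propext, Classical.choice, Quot.sound] -/
#guard_msgs (whitespace := lax) in
#print axioms RhW08.Lens1ArcSign.descStarts_eq_descSet

/-- info: 'RhW08.Lens1ArcSign.ascSet_subset' depends on axioms: [propext, Classical.choice, Quot.sound] -/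
#guard_msgs (whitespace := lax) in
#print axioms RhW08.Lens1ArcSign.ascSet_subset

/-- info: 'RhW08.Lens1ArcSign.descSet_subset' depends on axioms: [propext, Classical.choice, Quot.sound] -/
#guard_msgs (whitespace := lax) in
#print axioms RhW08.Lens1ArcSign.descSet_subset

/-- info: 'RhW08.Lens1ArcSign.card_filter_le_step' depends on axioms: [propext, Classical.choice, Quot.sound] -/
#guard_msgs (whitespace := lax) in
#print axioms RhW08.Lens1ArcSign.card_filter_le_step

/-- info: 'RhW08.Lens1ArcSign.im_incr_eq_count' depends on axioms: [propext, Classical.choice, Quot.sound] -/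
#guard_msgs (whitespace := lax) in
#print axioms RhW08.Lens1ArcSign.im_incr_eq_count

/-- info: 'RhW08.Lens1ArcSign.ascSet_eq_empty_of_flat' depends on axioms: [propext, Classical.choice, Quot.sound] -/
#guard_msgs (whitespace := lax) in
#print axioms RhW08.Lens1ArcSign.ascSet_eq_empty_of_flat

/-- info: 'RhW08.Lens1ArcSign.descSet_eq_empty_of_flat' depends on axioms: [propext, Classical.choice, Quot.sound] -/
#guard_msgs (whitespace := lax) in
#print axioms RhW08.Lens1ArcSign.descSet_eq_empty_of_flat

/-- info: 'RhW08.Lens1ArcSign.two_mul_wind_eq_count' depends on axioms: [propext, Classical.choice, Quot.sound] -/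
#guard_msgs (whitespace := lax) in
#print axioms RhW08.Lens1ArcSign.two_mul_wind_eq_count

/-- info: 'RhW08.Lens1ArcSign.disc_census_count' depends on axioms: [propext, Classical.choice, Quot.sound] -/
#guard_msgs (whitespace := lax) in
#print axioms RhW08.Lens1ArcSign.disc_census_count

/-- info: 'RhW08.Lens1ArcSign.nonrealZeroMult_eq_of_count' depends on axioms: [propext, Classical.choice, Quot.sound] -/
#guard_msgs (whitespace := lax) in
#print axioms RhW08.Lens1ArcSign.nonrealZeroMult_eq_of_count

/-- info: 'RhW08.Lens1ArcSign.pinning_of_arcCount_cofinite' depends on axioms: [propext, Classical.choice, Quot.sound] -/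
#guard_msgs (whitespace := lax) in
#print axioms RhW08.Lens1ArcSign.pinning_of_arcCount_cofinite

/-- info: 'RhW08.Lens1ArcSign.pinning_of_arcCount' depends on axioms: [propext, Classical.choice, Quot.sound] -/
#guard_msgs (whitespace := lax) in
#print axioms RhW08.Lens1ArcSign.pinning_of_arcCount

/-- info: 'RhW08.Lens1ArcSign.pinning_of_netNonAscending' depends on axioms: [propext, Classical.choice, Quot.sound] -/
#guard_msgs (whitespace := lax) in
#print axioms RhW08.Lens1ArcSign.pinning_of_netNonAscending

/-- info: 'RhW08.Lens1ArcSign.pinning_of_noAscendingArc'' depends on axioms: [propext, Classical.choice, Quot.sound] -/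
#guard_msgs (whitespace := lax) in
#print axioms RhW08.Lens1ArcSign.pinning_of_noAscendingArc'

/-- info: 'RhW08.Lens1ArcSign.topPinning_of_netAscResidual' depends on axioms: [propext, Classical.choice, Quot.sound] -/
#guard_msgs (whitespace := lax) in
#print axioms RhW08.Lens1ArcSign.topPinning_of_netAscResidual

/-- info: 'RhW08.Lens1ArcSign.topPinning_iff_netAscResidual' depends on axioms: [propext, Classical.choice, Quot.sound] -/
#guard_msgs (whitespace := lax) in
#print axioms RhW08.Lens1ArcSign.topPinning_iff_netAscResidual

/-- info: 'RhW08.Lens1ArcSign.topPinningCrossing_of_netAscResidual' depends on axioms: [propext, Classical.choice, Quot.sound] -/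
#guard_msgs (whitespace := lax) in
#print axioms RhW08.Lens1ArcSign.topPinningCrossing_of_netAscResidual
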